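import Mathlib
import Summits.ValiantsHypothesis.ValiantsHypothesis.Theses.NewtonUnitEquations
import Summits.ValiantsHypothesis.ValiantsHypothesis.Theorems.NewtonUnitEquationsTwoProductsExposure
import Summits.ValiantsHypothesis.ValiantsHypothesis.Theorems.NewtonUnitEquationsTwoProductsSweep
import Summits.ValiantsHypothesis.ValiantsHypothesis.Theorems.NewtonUnitEquationsTwoProductsSectorCover
import Summits.ValiantsHypothesis.ValiantsHypothesis.Theorems.NewtonUnitEquationsTwoProductsConeChart
import Summits.ValiantsHypothesis.ValiantsHypothesis.Theorems.NewtonUnitEquationsTwoProductsPowerSumCriterion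
import Summits.ValiantsHypothesis.ValiantsHypothesis.Theorems.NewtonUnitEquationsTwoProductsRaySeries
import Summits.ValiantsHypothesis.ValiantsHypothesis.Theorems.NewtonUnitEquationsTwoProductsEquivalence
import Summits.ValiantsHypothesis.ValiantsHypothesis.Theorems.NewtonUnitEquationsTwoProductsLocalisation
import Summits.ValiantsHypothesis.ValiantsHypothesis.Theorems.NewtonUnitEquationsTwoProductsRecordReduction
import Summits.ValiantsHypothesis.ValiantsHypothesis.Theorems.NewtonUnitEquationsTwoProductsDissocRecords
import Summits.ValiantsHypothesis.ValiantsHypothesis.Theorems.NewtonUnitEquationsTwoProductsDissocRecordCard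
import Summits.ValiantsHypothesis.ValiantsHypothesis.Theorems.NewtonUnitEquationsTwoProductsDissocLift
import Summits.ValiantsHypothesis.ValiantsHypothesis.Theorems.NewtonUnitEquationsTwoProductsDissocCount
import Summits.ValiantsHypothesis.ValiantsHypothesis.Theorems.NewtonUnitEquationsTwoProductsDissocBridge
import Summits.ValiantsHypothesis.ValiantsHypothesis.Theorems.NewtonUnitEquationsTwoProductsDissociated
import Summits.ValiantsHypothesis.ValiantsHypothesis.Theorems.NewtonUnitEquationsTwoProductsPeelShallow
import Summits.ValiantsHypothesis.ValiantsHypothesis.Theorems.NewtonUnitEquationsTwoProductsLetterPredecessor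
import Summits.ValiantsHypothesis.ValiantsHypothesis.Theorems.NewtonUnitEquationsTwoProductsPencil
import Summits.ValiantsHypothesis.ValiantsHypothesis.Theorems.NewtonUnitEquationsTwoProductsQuotientPredecessor
import Summits.ValiantsHypothesis.ValiantsHypothesis.Theorems.NewtonUnitEquationsTwoProductsLetterBelow
import Summits.ValiantsHypothesis.ValiantsHypothesis.Theorems.NewtonUnitEquationsTwoProductsPinnedConverse
import Summits.ValiantsHypothesis.ValiantsHypothesis.Theorems.NewtonUnitEquationsTwoProductsRadixResidueOff
import Summits.ValiantsHypothesis.ValiantsHypothesis.Theorems.NewtonUnitEquationsTwoProductsRadixResidueOn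
import Summits.ValiantsHypothesis.ValiantsHypothesis.Theorems.NewtonUnitEquationsTwoProductsRadix
import Summits.ValiantsHypothesis.ValiantsHypothesis.Theorems.NewtonUnitEquationsTwoProductsRadixClassMin
import Summits.ValiantsHypothesis.ValiantsHypothesis.Theorems.NewtonUnitEquationsTwoProductsRadixCosetOn
import Summits.ValiantsHypothesis.ValiantsHypothesis.Theorems.NewtonUnitEquationsTwoProductsRadixClassTransport
import Summits.ValiantsHypothesis.ValiantsHypothesis.Theorems.NewtonUnitEquationsTwoProductsPinnedRadix
import Summits.ValiantsHypothesis.ValiantsHypothesis.Theorems.NewtonUnitEquationsTwoProductsDrillingDichotomy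
import Summits.ValiantsHypothesis.ValiantsHypothesis.Theorems.NewtonUnitEquationsTwoProductsRadixPairCosetOn
import Summits.ValiantsHypothesis.ValiantsHypothesis.Theorems.NewtonUnitEquationsTwoProductsCosetTransport
import Summits.ValiantsHypothesis.ValiantsHypothesis.Theorems.NewtonUnitEquationsTwoProductsNetTransversal
import Summits.ValiantsHypothesis.ValiantsHypothesis.Theorems.NewtonUnitEquationsTwoProductsEchelonPivots
import Summits.ValiantsHypothesis.ValiantsHypothesis.Theorems.NewtonUnitEquationsTwoProductsResonanceDichotomy
import Summits.ValiantsHypothesis.ValiantsHypothesis.Theorems.NewtonUnitEquationsTwoProductsCollinear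
import Summits.ValiantsHypothesis.ValiantsHypothesis.Theorems.NewtonUnitEquationsTwoProductsNonResonant
import Summits.ValiantsHypothesis.ValiantsHypothesis.Theorems.NewtonUnitEquationsTwoProductsSeparated
import Summits.ValiantsHypothesis.ValiantsHypothesis.Theorems.NewtonUnitEquationsTwoProductsSeparatedRank
import Summits.ValiantsHypothesis.ValiantsHypothesis.Theorems.NewtonUnitEquationsTwoProductsLevelCount
import Summits.ValiantsHypothesis.ValiantsHypothesis.Theorems.NewtonUnitEquationsTwoProductsProjectionBound
import Summits.ValiantsHypothesis.ValiantsHypothesis.Theorems.NewtonUnitEquationsTwoProductsMinkowskiSW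
import Summits.ValiantsHypothesis.ValiantsHypothesis.Theorems.NewtonUnitEquationsTwoProductsTwoRayAxial
import Summits.ValiantsHypothesis.ValiantsHypothesis.Theorems.NewtonUnitEquationsTwoProductsTaggedCores
import Summits.ValiantsHypothesis.ValiantsHypothesis.Theorems.NewtonUnitEquationsTwoProductsEulerLeibnizAppend
import Summits.ValiantsHypothesis.ValiantsHypothesis.Theorems.NewtonUnitEquationsTwoProductsBlockLift
import Summits.ValiantsHypothesis.ValiantsHypothesis.Theorems.NewtonUnitEquationsTwoProductsEulerTransfer
import Summits.ValiantsHypothesis.ValiantsHypothesis.Theorems.NewtonUnitEquationsTwoProductsUniqueWords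
import Summits.ValiantsHypothesis.ValiantsHypothesis.Theorems.NewtonUnitEquationsTwoProductsRadixPairCarryFree
import Summits.ValiantsHypothesis.ValiantsHypothesis.Theorems.NewtonUnitEquationsTwoProductsNoSharing
import Summits.ValiantsHypothesis.ValiantsHypothesis.Theorems.NewtonUnitEquationsTwoProductsTwoBaseRadix
import Summits.ValiantsHypothesis.ValiantsHypothesis.Theorems.NewtonUnitEquationsTwoProductsRowDissociated

/-!
# Line `corner-log-linearization` — LEAD skeleton (reshaped) for crux `TwoProducts` (stmt-ValiantsHypothesis-5906)

Crux decl `Summit.ValiantsHypothesis.ValiantsHypothesis.Theses.NewtonUnitEquations.TwoProducts`: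
`∃ a b, ∀ m t (f g : Fin m → ℂ[X,Y])`, `t`-sparse ⇒ `#extremePoints conv(supp(∏ f − ∏ g)) ≤ 2^(a·m)·(t+2)^b`.

Lead reshape (session prover-line-stmt-ValiantsHypothesis-5906-0) of the planner's skeleton
`Lines/corner-log-linearization.lean`: the L-sized `stub_cornerLocalisation` is split into three M-sized registered
stubs — `stub_sweep` (plane geometry of integer weights: sectors between consecutive critical directions, ≤ 4|D|+4 of
them, each a positive cone over two integer boundary vectors), `stub_sectorCover` (every combinatorial vertex of
`∏ f − ∏ g` is a sector vertex for one of the sectors' constant top-assignments; count ≤ #sectors × per-sector bound) and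
`stub_coneChart` (the injective additive chart `L = (r₁; r₂)` carries a sector with top-assignment `(μ, ν)` to a LOCAL
instance `u, v` with constant terms `1`; per-sector vertices ≤ south-west vertices of `∏ u − ∏ v` plus `2`).  The other
stubs are the planner's: `stub_exposure`, `stub_powerSumCriterion` (the lever), `stub_raySeries` (`t ≤ 2` rung) and the
OPEN engine `stub_logSumNewton` (held by the lead).  Registered stub statements are Mathlib-only (all line objects
inlined) so that each lands as an independent `--supports` file; the readable `def`s below are definitionally the same.

Weights are INTEGER vectors `w ∈ ℤ²`, `wt w e = w₀e₀ + w₁e₁`; a vertex is a UNIQUE MINIMISER (`IsStrictMin`) of `wt w`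
on a support; `swVertSet` = unique minimisers for some `w` with both `wᵢ > 0`; `logPowerSum R u v = Σ_{r=1}^{R}
((−1)^{r+1}/r)·(Σ_i (u_i − 1)^r − Σ_i (v_i − 1)^r)`; `logVertSet u v` = stable south-west vertices of the log series.

LEAD c1 RESHAPE (2026-08-16): the engine (old stub 7 `stub_logSumNewton`, crux-equivalent) is now DERIVED from two
registered stubs — 7a `stub_localisation` (provable now: a south-west vertex of `∏u − ∏v` is an alive first-order
exponent or a south-west vertex of the DEAD-LETTER instance obtained by deleting from every factor its monomials that
survive in `∏u − ∏v`) and 7b `stub_allDeadEngine` (OPEN: the bound `2^(an)(t+2)^b` for ALL-DEAD instances, in which no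
monomial of any factor survives) — by strong induction on the letter count (`sw_le_letters_add`, `sw_bound`,
`logSumNewton_of_reshape`, all proved below).  So `V ≤ #letters + V(all-dead core)`: the first-order count (Disproof F9)
is reduced to all-dead instances, and the crux is closed modulo 7a + 7b.

LEAD c2 (2026-08-16): 7a is LANDED (p101962), so the composition `TwoProducts_of : Stmt.stub_allDeadEngine → TwoProducts`
takes exactly the ONE open registered stub; nothing else changed.

LEAD c3 (2026-08-16): the main line is unchanged (ONE open stub, 7b); this seat adds the rung stubs R1–R4 +
`stub_engineDissociated` (section "Rung stubs (lead c3)" below): the DISSOCIATED regime of the engine (exponent map injective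
on the lifted window) is bounded with the crux's shape, `≤ (s²+2)·2n·4^{2n−1}`, by the moment / record normal form.

LEAD c4 (2026-08-16): 7c `stub_recordReduction` (p117598) and the rung pieces R1–R4 (p116595, p116436, p116658, p116759,
p117905) are LANDED and discharged below by import; open registered stubs: 7d `stub_rowRecordBound` (held by the lead) and the
rung compositions `stub_engineDissociated` / `stub_engineDepthK` — LANDED during this seat's wave 1 (p120118 by lead c3,
p121024), so the ONLY sorry left in this file is 7d.

LEAD c5 (2026-08-16): the landed Pencil rung (p124676) is discharged by import; the open registered stub is c4's 7f `stub_shallowBound`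
(held by the lead; first target its `(k,m) = (0,1)` case, the kinetic `t`-shallow count of `supp(v⁻¹)`), plus two provable structural
stubs of the support-only normal form (`stub_quotientPredecessor` p126012, `stub_letterBelow` p126078, section "LEAD c5" below) LANDED in wave 1;
later in that seat 7f was de-registered in favour of the PINNED form 7g `stub_pinnedShallowBound` (engine-equivalent, 7h `stub_pinnedConverse`
p126739), the one open stub of the main line.

LEAD c6 (2026-08-16): main line unchanged (ONE open engine stub, 7g, held by the lead).  This seat adds the RIGID RADIX rung (section
"Rung stubs (lead c6)" below): the multiscale-with-carries regime `f_i = φ_i(x^{M^i}, y^{M^i})` has `≤ k³q²t` south-west vertices of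
`∏ f_i − 1`, by a residue decomposition `mod M` (pieces `stub_radixResidueOff`, `stub_radixResidueOn`, composition `stub_engineRadix`);
all three LANDED in this seat's wave 1 (p128514, p128352, p128818) and are discharged by import.  Wave 2 registers the PINNED radix
rung (`stub_radixClassMin`, `stub_radixCosetOn`, `stub_radixClassTransport`, composition `stub_enginePinnedRadix`: stub 7g at `m = 0` on
rigid radix frames, affine in `|L|`) — all four LANDED (p129269, p129304, p129320, p129495) and discharged by import.  Wave 3: the
structural `stub_drillingDichotomy` (one peeling step, p129907) and the two-product radix bricks `stub_radixPairCosetOn` (p129998),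
`stub_cosetTransport` (p130003) LANDED and discharged by import, so the ONLY sorry in this file is again 7g `stub_pinnedShallowBound`,
and `TwoProducts_of` takes exactly it.

LEAD c7 (2026-08-16/17): main line unchanged (ONE open engine stub, 7g `stub_pinnedShallowBound`, held by the lead).  This seat LANDED
(all --supports 5906): the rank-2 transversal net rung (p132159), the RESONANCE LOCALISATION for every rank — echelon pivots (p132414) +
resonance dichotomy (p132489) + the non-resonant engine (p133215: no small additive relation among ≤ 2n letters ⇒ crux-shaped) —, the
collinear rung (p132492), the SLICE-RANK tool (p133405, p133609: factors of xy-rank ≤ c ⇒ ≤ 2c^n vertices, t-free), the level count and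
projection bound (p133723, p134003: V ≤ 2·#ℓ-levels ≤ 2(|Σℓ(A_i)| + |Σℓ(B_i)|)), the Minkowski brick (p134096), the two-ray transport (p134763) and the tagged-cores rung (p134877: generic tags are harmless multipliers).  Net effect: every
cancellation of the engine is certified by a small additive relation among the pivot letters of its cell, and every regime except
non-rigid MULTISCALE letter sets (exponentially spread in every projection, resonant, high GAP rank, scale-mixing) is crux-shaped; the ONLY
sorry of this file is again 7g.

LEAD c8 (2026-08-17): RESHAPE to the PARTIAL-FRACTION normal form (section "LEAD c8 RESHAPE" below).  7g is de-registered (documented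
sufficient condition, like 7f); the registered stubs are 8a `stub_eulerTransfer` (strict minimisers of `supp(∏u − ∏v)` = those of
`supp(θ(∏u)·∏v − ∏u·θ(∏v))`, θ the Euler operator; provable), 8b `stub_eulerLeibnizAppend` (Leibniz: that polynomial is the partial-fraction
numerator `Σ_j p_j ∏_{i≠j} q_i` of the `2n` pairs `((θu, −θv), (u, v))`; provable), 8c `stub_blockLift` (the block substitution
`q_j + x^K y^K p_j` embeds the south-west vertices of any partial-fraction numerator into a two-products instance; provable; gives
`partialFraction_of_crux`) and the ONE open stub 8d `stub_partialFractionBound` (`#swVert(Σ_{j<N} p_j ∏_{i≠j} q_i) ≤ 2^(aN)(t+2)^b` for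
`t`-sparse `p_j, q_j`; crux-EQUIVALENT, LINEAR in the numerators, held by the lead).  `TwoProducts_of : Stmt.stub_partialFractionBound → crux`.

LEAD c9 (2026-08-17): `stub_engineNoSharing` LANDED (p138163, c8 wave 3) and is discharged by import, so the ONLY sorry of this file is 8d
`stub_partialFractionBound` — kernel-certified crux-EQUIVALENT (8a+8b: engine ⟸ 8d; 8c: crux ⟹ 8d) and ⊇ KPTT §5.2 in its printed `2^{O(m)}t^{O(1)}`
form.  No tenth normal form: this seat holds 8d, tests FOC in the residual regime at farm scale (kit j023302), and landed the two rungs of section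
"Rung stubs (lead c9)" (R9a two-base rigid radix with carries p143675 — KPTT Example 3 and its carried thickenings are tame —, R9b row-dissociation
p144464; Framework IX = crux NOTES-c9-framework-IX.md).  `TwoProducts_of : Stmt.stub_partialFractionBound → crux` unchanged.

COMPOSITION (kernel-checked below, no sorry outside `stub_*`): stubs 5–7 give the local south-west bound
`2^((a+1)n)(t+2)^b` (`local_bound`); stub 4 turns it into a per-sector bound `+2`; stubs 2–3 give
`#vertSet ≤ (4|D|+4)·(N+2)` with `|D| ≤ 2mt²` for families of NONZERO factors, the zero-factor cases being reduced to
that one by the doubling trick `∏g − ∏g' = −∏g` (`g'` = `g` with one factor doubled); stub 1 injects the extreme points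
into `emb '' vertSet`; `bound_arith` closes with `(A, B) = (a+2, b+8)`.
-/

set_option linter.dupNamespace false

namespace Summit.ValiantsHypothesis.ValiantsHypothesis.Cruxes.TwoProducts.CornerLogLinearization

open scoped BigOperators Classical

noncomputable section

/-! ## Objects of the line (readable defs; the registered stubs inline them verbatim) -/

/-- Exponent vectors of bivariate monomials. -/
abbrev Expo := Fin 2 →₀ ℕ

/-- The embedding `ℕ² → ℝ²` used VERBATIM by the crux. -/
abbrev emb (e : Expo) : Fin 2 → ℝ := fun i => ((e i : ℕ) : ℝ)

/-- The integer linear form `⟨w, e⟩ = w₀ e₀ + w₁ e₁`. -/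
def wt (w : Fin 2 → ℤ) (e : Expo) : ℤ := w 0 * (e 0 : ℤ) + w 1 * (e 1 : ℤ)

/-- `e` is the UNIQUE minimiser of `wt w` on the finite set `S` (in particular `e ∈ S`). -/
def IsStrictMin (w : Fin 2 → ℤ) (S : Finset Expo) (e : Expo) : Prop :=
  e ∈ S ∧ ∀ e' ∈ S, e' ≠ e → wt w e < wt w e'

/-- Combinatorial vertex set: exponents that are the unique minimiser of SOME integer form on the support. -/
def vertSet (F : MvPolynomial (Fin 2) ℂ) : Set Expo :=
  {e | ∃ w : Fin 2 → ℤ, IsStrictMin w F.support e}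

/-- South-west vertex set: unique minimisers for an integer form with BOTH weights strictly positive. -/
def swVertSet (D : MvPolynomial (Fin 2) ℂ) : Set Expo :=
  {e | ∃ w : Fin 2 → ℤ, 0 < w 0 ∧ 0 < w 1 ∧ IsStrictMin w D.support e}

/-- Order-`R` log power-sum polynomial of a local instance. -/
def logPowerSum {n : ℕ} (R : ℕ) (u v : Fin n → MvPolynomial (Fin 2) ℂ) : MvPolynomial (Fin 2) ℂ :=
  ∑ r ∈ Finset.Icc 1 R, ((-1 : ℂ) ^ (r + 1) / (r : ℂ)) • (∑ i, (u i - 1) ^ r - ∑ i, (v i - 1) ^ r)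

/-- Stable south-west vertices of the log series. -/
def logVertSet {n : ℕ} (u v : Fin n → MvPolynomial (Fin 2) ℂ) : Set Expo :=
  {e | ∃ w : Fin 2 → ℤ, 0 < w 0 ∧ 0 < w 1 ∧
    ∀ R : ℕ, wt w e < (R : ℤ) → IsStrictMin w (logPowerSum R u v).support e}

variable {m : ℕ}

/-- Sector data `(μ, ν, r₁, r₂)` is ADAPTED to `(f, g)`: the chart rows `r₁, r₂ ∈ ℤ²` are independent and weakly
minimised at the assigned tops `μ j` / `ν j` on every support (so the chart `p ↦ (⟨r₁,p−μ_j⟩, ⟨r₂,p−μ_j⟩)` lands in `ℕ²`). -/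
def Adapted (f g : Fin m → MvPolynomial (Fin 2) ℂ) (μ ν : Fin m → Expo) (r₁ r₂ : Fin 2 → ℤ) : Prop :=
  r₁ 0 * r₂ 1 ≠ r₁ 1 * r₂ 0 ∧
    (∀ j, ∀ p ∈ (f j).support, wt r₁ (μ j) ≤ wt r₁ p ∧ wt r₂ (μ j) ≤ wt r₂ p) ∧
    (∀ j, ∀ p ∈ (g j).support, wt r₁ (ν j) ≤ wt r₁ p ∧ wt r₂ (ν j) ≤ wt r₂ p)

/-- The SECTOR VERTEX SET of sector data: exponents that are the unique `w`-minimiser of `supp(∏f − ∏g)` for a weight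
`w = a•r₁ + b•r₂` (`a, b > 0` integers) which makes every `μ j` / `ν j` the unique `w`-minimiser of its factor. -/
def sectSet (f g : Fin m → MvPolynomial (Fin 2) ℂ) (μ ν : Fin m → Expo) (r₁ r₂ : Fin 2 → ℤ) : Set Expo :=
  {e | ∃ a b : ℤ, 0 < a ∧ 0 < b ∧ (∀ j, IsStrictMin (a • r₁ + b • r₂) (f j).support (μ j)) ∧
    (∀ j, IsStrictMin (a • r₁ + b • r₂) (g j).support (ν j)) ∧
    IsStrictMin (a • r₁ + b • r₂) (∏ j, f j - ∏ j, g j).support e}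

/-! ## Registered stubs (statements Mathlib-only, objects inlined).  Stubs 1–6 LANDED (wave 1: p78572, p78965, p81938,
p78732, p79909, p80017) and are discharged by the landed theorems; 7a landed as p101962, 7c as p117598, 7e as p122612, 7h as p126739;
the open MAIN-LINE stub is 7g `stub_pinnedShallowBound`; every rung stub except lead c6's radix pieces is landed. -/

/-- STUB 1 — EXPOSURE BY AN INTEGER FORM (M).  Every extreme point of `conv(emb '' S)` (`S ⊂ ℕ²` finite) is `emb e` for an
`e ∈ S` that is the unique minimiser on `S` of an integer linear form.  (Strict separation of an extreme point of a finite
set from the hull of the others — `geometric_hahn_banach_point_closed`, cf. the tree's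
`KPTT.EPRS.exists_support_of_convexIndependent` / sibling kit `exists_strict_sep_of_mem_extremePoints_convexHull` — gives a
real form with positive gaps on the finite set; round `K·ξ` coordinatewise for `K` large: integer gaps stay positive.) -/
theorem stub_exposure : ∀ (S : Finset (Fin 2 →₀ ℕ)) (p : Fin 2 → ℝ),
    p ∈ Set.extremePoints ℝ (convexHull ℝ
      ((fun e : Fin 2 →₀ ℕ => fun i : Fin 2 => ((e i : ℕ) : ℝ)) '' (S : Set (Fin 2 →₀ ℕ)))) →
    ∃ e : Fin 2 →₀ ℕ, (fun i : Fin 2 => ((e i : ℕ) : ℝ)) = p ∧ ∃ w : Fin 2 → ℤ,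
      e ∈ S ∧ ∀ e' ∈ S, e' ≠ e →
        w 0 * (e 0 : ℤ) + w 1 * (e 1 : ℤ) < w 0 * (e' 0 : ℤ) + w 1 * (e' 1 : ℤ) :=
  Summit.ValiantsHypothesis.ValiantsHypothesis.Theorems.TwoProducts.Exposure.stub_exposure

/-- STUB 2 — SWEEP (M; plane geometry of integer weights).  For a finite set `D ⊂ ℤ²` of critical vectors there are
`≤ 4|D| + 4` SECTORS, each given by two independent integer boundary vectors `(r₁, r₂)`, such that every integer weight
`w` off the axes and off all critical lines `⟨w, d⟩ = 0` is, after scaling by some `K > 0`, a combination `a•r₁ + b•r₂`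
with `a, b > 0`, and `⟨w, d⟩ > 0 ⇒ ⟨r₁, d⟩ ≥ 0 ∧ ⟨r₂, d⟩ ≥ 0` for `d ∈ D` (sign consistency up to the boundary).
(Per open quadrant, sort the critical slopes; a sector is the open cone between consecutive ones, its boundary rays are
the quadrant's axes or rational directions `±d^⊥`; `⟨(1,σ), d⟩ = d₀ + σ d₁` is affine in the slope `σ`, so its sign is
constant between consecutive roots and weakly the same at the two ends; `a, b, K` by Cramer's rule.  The sibling kit
`Cruxes/DissociatedFixedK/FullProof-annihilator-product-functional.lean` §E2 has the checked sweep count.) -/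
theorem stub_sweep : ∀ (D : Finset (Fin 2 → ℤ)),
    ∃ Sec : Finset ((Fin 2 → ℤ) × (Fin 2 → ℤ)), Sec.card ≤ 4 * D.card + 4 ∧
      ∀ w : Fin 2 → ℤ, w 0 ≠ 0 → w 1 ≠ 0 → (∀ d ∈ D, w 0 * d 0 + w 1 * d 1 ≠ 0) →
        ∃ rr ∈ Sec, rr.1 0 * rr.2 1 ≠ rr.1 1 * rr.2 0 ∧
          ∃ a b K : ℤ, 0 < a ∧ 0 < b ∧ 0 < K ∧ K • w = a • rr.1 + b • rr.2 ∧
            ∀ d ∈ D, 0 < w 0 * d 0 + w 1 * d 1 →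
              0 ≤ rr.1 0 * d 0 + rr.1 1 * d 1 ∧ 0 ≤ rr.2 0 * d 0 + rr.2 1 * d 1 :=
  Summit.ValiantsHypothesis.ValiantsHypothesis.Theorems.TwoProducts.Sweep.stub_sweep

/-- STUB 3 — SECTOR COVER (M).  For NONZERO `t`-sparse factors and a family `Sec` of sectors with the sweep property
relative to the within-factor difference vectors (every integer weight off the axes and without ties inside any single
factor is, up to scaling, a positive combination of the boundary vectors of some sector in `Sec`, weakly order-consistently
on each factor's support), if every ADAPTED sector datum `(μ, ν, r₁, r₂)` has `≤ B` sector vertices then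
`#vertSet(∏f − ∏g) ≤ |Sec|·B`.  (Perturb a witness weight of a vertex `e` to a generic one keeping `e` the strict
minimiser — integer gaps are `≥ 1`, so `K·w + v` with `v` off finitely many lines and `K` large works; take the sector
`(r₁, r₂)` of the generic weight and `μ j, ν j :=` its unique minimisers on the factors: the datum is adapted by weak
consistency, `e` is one of its sector vertices, and two weights in the same sector have the SAME minimisers — weak
consistency both ways gives `⟨r_i, μ_j − μ'_j⟩ = 0`, `i = 1, 2`, and `det(r₁,r₂) ≠ 0` — so `vertSet ⊆ ⋃_{rr ∈ Sec} sectSet(μ(rr), ν(rr), rr)`.) -/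
theorem stub_sectorCover : ∀ (m t : ℕ) (f g : Fin m → MvPolynomial (Fin 2) ℂ),
    (∀ j, (f j).support.card ≤ t) → (∀ j, (g j).support.card ≤ t) → (∀ j, f j ≠ 0) → (∀ j, g j ≠ 0) →
    ∀ (Sec : Finset ((Fin 2 → ℤ) × (Fin 2 → ℤ))),
    (∀ w : Fin 2 → ℤ, w 0 ≠ 0 → w 1 ≠ 0 →
      (∀ j, ∀ p ∈ (f j).support, ∀ q ∈ (f j).support, p ≠ q →
        w 0 * (p 0 : ℤ) + w 1 * (p 1 : ℤ) ≠ w 0 * (q 0 : ℤ) + w 1 * (q 1 : ℤ)) →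
      (∀ j, ∀ p ∈ (g j).support, ∀ q ∈ (g j).support, p ≠ q →
        w 0 * (p 0 : ℤ) + w 1 * (p 1 : ℤ) ≠ w 0 * (q 0 : ℤ) + w 1 * (q 1 : ℤ)) →
      ∃ rr ∈ Sec, rr.1 0 * rr.2 1 ≠ rr.1 1 * rr.2 0 ∧
        ∃ a b K : ℤ, 0 < a ∧ 0 < b ∧ 0 < K ∧ K • w = a • rr.1 + b • rr.2 ∧
          (∀ j, ∀ p ∈ (f j).support, ∀ q ∈ (f j).support,
            w 0 * (p 0 : ℤ) + w 1 * (p 1 : ℤ) < w 0 * (q 0 : ℤ) + w 1 * (q 1 : ℤ) →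
            rr.1 0 * (p 0 : ℤ) + rr.1 1 * (p 1 : ℤ) ≤ rr.1 0 * (q 0 : ℤ) + rr.1 1 * (q 1 : ℤ) ∧
            rr.2 0 * (p 0 : ℤ) + rr.2 1 * (p 1 : ℤ) ≤ rr.2 0 * (q 0 : ℤ) + rr.2 1 * (q 1 : ℤ)) ∧
          (∀ j, ∀ p ∈ (g j).support, ∀ q ∈ (g j).support,
            w 0 * (p 0 : ℤ) + w 1 * (p 1 : ℤ) < w 0 * (q 0 : ℤ) + w 1 * (q 1 : ℤ) →
            rr.1 0 * (p 0 : ℤ) + rr.1 1 * (p 1 : ℤ) ≤ rr.1 0 * (q 0 : ℤ) + rr.1 1 * (q 1 : ℤ) ∧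
            rr.2 0 * (p 0 : ℤ) + rr.2 1 * (p 1 : ℤ) ≤ rr.2 0 * (q 0 : ℤ) + rr.2 1 * (q 1 : ℤ))) →
    ∀ B : ℕ,
    (∀ (μ ν : Fin m → (Fin 2 →₀ ℕ)) (r₁ r₂ : Fin 2 → ℤ),
      (r₁ 0 * r₂ 1 ≠ r₁ 1 * r₂ 0 ∧
        (∀ j, ∀ p ∈ (f j).support,
          r₁ 0 * ((μ j) 0 : ℤ) + r₁ 1 * ((μ j) 1 : ℤ) ≤ r₁ 0 * (p 0 : ℤ) + r₁ 1 * (p 1 : ℤ) ∧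
          r₂ 0 * ((μ j) 0 : ℤ) + r₂ 1 * ((μ j) 1 : ℤ) ≤ r₂ 0 * (p 0 : ℤ) + r₂ 1 * (p 1 : ℤ)) ∧
        (∀ j, ∀ p ∈ (g j).support,
          r₁ 0 * ((ν j) 0 : ℤ) + r₁ 1 * ((ν j) 1 : ℤ) ≤ r₁ 0 * (p 0 : ℤ) + r₁ 1 * (p 1 : ℤ) ∧
          r₂ 0 * ((ν j) 0 : ℤ) + r₂ 1 * ((ν j) 1 : ℤ) ≤ r₂ 0 * (p 0 : ℤ) + r₂ 1 * (p 1 : ℤ))) →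
      {e : Fin 2 →₀ ℕ | ∃ a b : ℤ, 0 < a ∧ 0 < b ∧
        (∀ j, μ j ∈ (f j).support ∧ ∀ e' ∈ (f j).support, e' ≠ μ j →
          (a • r₁ + b • r₂) 0 * ((μ j) 0 : ℤ) + (a • r₁ + b • r₂) 1 * ((μ j) 1 : ℤ) <
            (a • r₁ + b • r₂) 0 * (e' 0 : ℤ) + (a • r₁ + b • r₂) 1 * (e' 1 : ℤ)) ∧
        (∀ j, ν j ∈ (g j).support ∧ ∀ e' ∈ (g j).support, e' ≠ ν j →
          (a • r₁ + b • r₂) 0 * ((ν j) 0 : ℤ) + (a • r₁ + b • r₂) 1 * ((ν j) 1 : ℤ) <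
            (a • r₁ + b • r₂) 0 * (e' 0 : ℤ) + (a • r₁ + b • r₂) 1 * (e' 1 : ℤ)) ∧
        (e ∈ (∏ j, f j - ∏ j, g j).support ∧ ∀ e' ∈ (∏ j, f j - ∏ j, g j).support, e' ≠ e →
          (a • r₁ + b • r₂) 0 * (e 0 : ℤ) + (a • r₁ + b • r₂) 1 * (e 1 : ℤ) <
            (a • r₁ + b • r₂) 0 * (e' 0 : ℤ) + (a • r₁ + b • r₂) 1 * (e' 1 : ℤ))}.ncard ≤ B) →
    {e : Fin 2 →₀ ℕ | ∃ w : Fin 2 → ℤ, e ∈ (∏ j, f j - ∏ j, g j).support ∧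
      ∀ e' ∈ (∏ j, f j - ∏ j, g j).support, e' ≠ e →
        w 0 * (e 0 : ℤ) + w 1 * (e 1 : ℤ) < w 0 * (e' 0 : ℤ) + w 1 * (e' 1 : ℤ)}.ncard ≤ Sec.card * B :=
  Summit.ValiantsHypothesis.ValiantsHypothesis.Theorems.TwoProducts.SectorCover.stub_sectorCover

/-- STUB 4 — CONE CHART (M).  For `t`-sparse factors and an ADAPTED sector datum whose sector vertex set is nonempty there
is a LOCAL instance `u, v : Fin m → ℂ[X,Y]` (`t`-sparse, constant terms `1`) with
`#sectSet ≤ #swVertSet(∏u − ∏v) + 2`.  (Chart `L p = (⟨r₁,p⟩, ⟨r₂,p⟩)`, injective since `det ≠ 0`;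
`u_j := Σ_{p ∈ supp f_j} (coeff_p f_j / coeff_{μ_j} f_j)·X^{L(p) − L(μ_j)}` — exponents in `ℕ²` by adaptedness, constant
term `1`, `|supp u_j| = |supp f_j|`; expanding both products over words (`Finset.prod_univ_sum` / `Fintype.piFinset`)
and reindexing `p_j ↔ L(p_j − μ_j)`: `coeff_{L(e − Σμ)}(∏u) = coeff_e(∏f)/∏coeff_{μ_j}f_j`; for `w = a•r₁ + b•r₂`,
`wt w p − wt w q = ⟨(a,b), L p − L q⟩`; so if `Σμ = Σν` and the leading coefficients agree the sector vertices are `L`-charted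
onto south-west vertices of `∏u − ∏v`, and otherwise a sector vertex is one of the two product corners `Σμ`, `Σν`.) -/
theorem stub_coneChart : ∀ (m t : ℕ) (f g : Fin m → MvPolynomial (Fin 2) ℂ),
    (∀ j, (f j).support.card ≤ t) → (∀ j, (g j).support.card ≤ t) →
    ∀ (μ ν : Fin m → (Fin 2 →₀ ℕ)) (r₁ r₂ : Fin 2 → ℤ),
    (r₁ 0 * r₂ 1 ≠ r₁ 1 * r₂ 0 ∧
      (∀ j, ∀ p ∈ (f j).support,
        r₁ 0 * ((μ j) 0 : ℤ) + r₁ 1 * ((μ j) 1 : ℤ) ≤ r₁ 0 * (p 0 : ℤ) + r₁ 1 * (p 1 : ℤ) ∧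
        r₂ 0 * ((μ j) 0 : ℤ) + r₂ 1 * ((μ j) 1 : ℤ) ≤ r₂ 0 * (p 0 : ℤ) + r₂ 1 * (p 1 : ℤ)) ∧
      (∀ j, ∀ p ∈ (g j).support,
        r₁ 0 * ((ν j) 0 : ℤ) + r₁ 1 * ((ν j) 1 : ℤ) ≤ r₁ 0 * (p 0 : ℤ) + r₁ 1 * (p 1 : ℤ) ∧
        r₂ 0 * ((ν j) 0 : ℤ) + r₂ 1 * ((ν j) 1 : ℤ) ≤ r₂ 0 * (p 0 : ℤ) + r₂ 1 * (p 1 : ℤ))) →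
    {e : Fin 2 →₀ ℕ | ∃ a b : ℤ, 0 < a ∧ 0 < b ∧
        (∀ j, μ j ∈ (f j).support ∧ ∀ e' ∈ (f j).support, e' ≠ μ j →
          (a • r₁ + b • r₂) 0 * ((μ j) 0 : ℤ) + (a • r₁ + b • r₂) 1 * ((μ j) 1 : ℤ) <
            (a • r₁ + b • r₂) 0 * (e' 0 : ℤ) + (a • r₁ + b • r₂) 1 * (e' 1 : ℤ)) ∧
        (∀ j, ν j ∈ (g j).support ∧ ∀ e' ∈ (g j).support, e' ≠ ν j →
          (a • r₁ + b • r₂) 0 * ((ν j) 0 : ℤ) + (a • r₁ + b • r₂) 1 * ((ν j) 1 : ℤ) <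
            (a • r₁ + b • r₂) 0 * (e' 0 : ℤ) + (a • r₁ + b • r₂) 1 * (e' 1 : ℤ)) ∧
        (e ∈ (∏ j, f j - ∏ j, g j).support ∧ ∀ e' ∈ (∏ j, f j - ∏ j, g j).support, e' ≠ e →
          (a • r₁ + b • r₂) 0 * (e 0 : ℤ) + (a • r₁ + b • r₂) 1 * (e 1 : ℤ) <
            (a • r₁ + b • r₂) 0 * (e' 0 : ℤ) + (a • r₁ + b • r₂) 1 * (e' 1 : ℤ))}.Nonempty →
    ∃ u v : Fin m → MvPolynomial (Fin 2) ℂ,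
      (∀ i, (u i).support.card ≤ t) ∧ (∀ i, (v i).support.card ≤ t) ∧
      (∀ i, MvPolynomial.coeff 0 (u i) = 1) ∧ (∀ i, MvPolynomial.coeff 0 (v i) = 1) ∧
      {e : Fin 2 →₀ ℕ | ∃ a b : ℤ, 0 < a ∧ 0 < b ∧
        (∀ j, μ j ∈ (f j).support ∧ ∀ e' ∈ (f j).support, e' ≠ μ j →
          (a • r₁ + b • r₂) 0 * ((μ j) 0 : ℤ) + (a • r₁ + b • r₂) 1 * ((μ j) 1 : ℤ) <
            (a • r₁ + b • r₂) 0 * (e' 0 : ℤ) + (a • r₁ + b • r₂) 1 * (e' 1 : ℤ)) ∧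
        (∀ j, ν j ∈ (g j).support ∧ ∀ e' ∈ (g j).support, e' ≠ ν j →
          (a • r₁ + b • r₂) 0 * ((ν j) 0 : ℤ) + (a • r₁ + b • r₂) 1 * ((ν j) 1 : ℤ) <
            (a • r₁ + b • r₂) 0 * (e' 0 : ℤ) + (a • r₁ + b • r₂) 1 * (e' 1 : ℤ)) ∧
        (e ∈ (∏ j, f j - ∏ j, g j).support ∧ ∀ e' ∈ (∏ j, f j - ∏ j, g j).support, e' ≠ e →
          (a • r₁ + b • r₂) 0 * (e 0 : ℤ) + (a • r₁ + b • r₂) 1 * (e 1 : ℤ) <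
            (a • r₁ + b • r₂) 0 * (e' 0 : ℤ) + (a • r₁ + b • r₂) 1 * (e' 1 : ℤ))}.ncard ≤
      {e : Fin 2 →₀ ℕ | ∃ w : Fin 2 → ℤ, 0 < w 0 ∧ 0 < w 1 ∧ e ∈ (∏ i, u i - ∏ i, v i).support ∧
        ∀ e' ∈ (∏ i, u i - ∏ i, v i).support, e' ≠ e →
          w 0 * (e 0 : ℤ) + w 1 * (e 1 : ℤ) < w 0 * (e' 0 : ℤ) + w 1 * (e' 1 : ℤ)}.ncard + 2 :=
  Summit.ValiantsHypothesis.ValiantsHypothesis.Theorems.TwoProducts.ConeChart.stub_coneChart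

/-- STUB 5 — POWER-SUM CRITERION (M–L; the lever).  For factors with constant term `1` and a strictly positive integer
weight `w`, `e` is the unique `w`-minimiser of `supp(∏ u − ∏ v)` iff it is the unique `w`-minimiser of `supp Λ_R`, for
every `R > wt w e`.  (Polynomial proof: `θ_w = w₀X∂_X + w₁Y∂_Y` is a derivation scaling `X^p` by `wt w p`; work modulo the
span `I_R` of monomials of `w`-weight `≥ R` — every monomial of a tail `h = u_i − 1` has weight `≥ 1`, so `h^R ∈ I_R`,
`(1+h)·Σ_{s<R}(−h)^s ≡ 1` and `θ log_R(1+h) ≡ θh·Σ_{s<R}(−h)^s`, whence `θP·Q − P·θQ ≡ PQ·θΛ_R (mod I_R)` for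
`P = ∏u`, `Q = ∏v`; lowest `w`-components: `in(θP·Q − P·θQ) = d·in(P − Q)` (`d ≥ 1` the `w`-order of `P − Q`),
`in(PQ·θΛ_R) = in(θΛ_R) = d'·in(Λ_R)` below weight `R`; so below weight `R` a strict minimiser on either side is one on
the other.  Both sides are false when `∏u = ∏v`.) -/
theorem stub_powerSumCriterion : ∀ (n : ℕ) (u v : Fin n → MvPolynomial (Fin 2) ℂ),
    (∀ i, MvPolynomial.coeff 0 (u i) = 1) → (∀ i, MvPolynomial.coeff 0 (v i) = 1) →
    ∀ (w : Fin 2 → ℤ), 0 < w 0 → 0 < w 1 →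
    ∀ (e : Fin 2 →₀ ℕ) (R : ℕ), w 0 * (e 0 : ℤ) + w 1 * (e 1 : ℤ) < (R : ℤ) →
      ((e ∈ (∏ i, u i - ∏ i, v i).support ∧ ∀ e' ∈ (∏ i, u i - ∏ i, v i).support, e' ≠ e →
          w 0 * (e 0 : ℤ) + w 1 * (e 1 : ℤ) < w 0 * (e' 0 : ℤ) + w 1 * (e' 1 : ℤ)) ↔
        (e ∈ (∑ r ∈ Finset.Icc 1 R, ((-1 : ℂ) ^ (r + 1) / (r : ℂ)) •
              (∑ i, (u i - 1) ^ r - ∑ i, (v i - 1) ^ r)).support ∧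
          ∀ e' ∈ (∑ r ∈ Finset.Icc 1 R, ((-1 : ℂ) ^ (r + 1) / (r : ℂ)) •
              (∑ i, (u i - 1) ^ r - ∑ i, (v i - 1) ^ r)).support, e' ≠ e →
            w 0 * (e 0 : ℤ) + w 1 * (e 1 : ℤ) < w 0 * (e' 0 : ℤ) + w 1 * (e' 1 : ℤ))) :=
  Summit.ValiantsHypothesis.ValiantsHypothesis.Theorems.TwoProducts.PowerSum.stub_powerSumCriterion

/-- STUB 6 — RAY SERIES (M; the binomial rung `t ≤ 2`).  If every factor has at most two monomials (so `u_i = 1 + c_i X^{g_i}`),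
`supp Λ_R` lies on the `≤ 2n` rays `ℕ_{≥1}·g_i`, `ℕ_{≥1}·g'_i`, and two stable unique minimisers on one ray are impossible
(the lower one is in `supp Λ_R` for all large `R` and beats the upper one for every positive weight): `#logVertSet ≤ 2n`. -/
theorem stub_raySeries : ∀ (n : ℕ) (u v : Fin n → MvPolynomial (Fin 2) ℂ),
    (∀ i, (u i).support.card ≤ 2) → (∀ i, (v i).support.card ≤ 2) →
    (∀ i, MvPolynomial.coeff 0 (u i) = 1) → (∀ i, MvPolynomial.coeff 0 (v i) = 1) →
    {e : Fin 2 →₀ ℕ | ∃ w : Fin 2 → ℤ, 0 < w 0 ∧ 0 < w 1 ∧ ∀ R : ℕ, w 0 * (e 0 : ℤ) + w 1 * (e 1 : ℤ) < (R : ℤ) →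
      (e ∈ (∑ r ∈ Finset.Icc 1 R, ((-1 : ℂ) ^ (r + 1) / (r : ℂ)) •
            (∑ i, (u i - 1) ^ r - ∑ i, (v i - 1) ^ r)).support ∧
        ∀ e' ∈ (∑ r ∈ Finset.Icc 1 R, ((-1 : ℂ) ^ (r + 1) / (r : ℂ)) •
            (∑ i, (u i - 1) ^ r - ∑ i, (v i - 1) ^ r)).support, e' ≠ e →
          w 0 * (e 0 : ℤ) + w 1 * (e 1 : ℤ) < w 0 * (e' 0 : ℤ) + w 1 * (e' 1 : ℤ))}.ncard ≤ 2 * n :=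
  Summit.ValiantsHypothesis.ValiantsHypothesis.Theorems.TwoProducts.RaySeries.stub_raySeries

/-- STUB 7a — LOCALISATION TO THE DEAD LETTERS (M; LANDED p101962 `…TwoProductsLocalisation.lean`; lead c1 reshape).  Let `D = ∏ u − ∏ v`
(constant terms `1`), `w` a strictly positive integer weight and `e` the unique `w`-minimiser of `supp D`.  Then
EITHER `e` is an ALIVE FIRST-ORDER exponent (a monomial of some factor which survives in `D`), OR `e` is still the
unique `w`-minimiser of `supp D‡`, where `D‡ = ∏ u‡ − ∏ v‡` and `u‡_i` is `u_i` with every monomial lying in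
`supp D` deleted (the constant term stays: `0 ∉ supp D`).  (Expand `∏ (u‡_i + r_i)`, `r_i = u_i − u‡_i`: a word
using a letter `a ∈ supp D` has exponent `a + rest`, and `wt a < wt e` unless `rest = 0`, `a = e`; so for `e` not
alive first-order `coeff_e D = coeff_e D‡ ≠ 0`, and every `e' ∈ supp D‡ ∖ supp D` has `wt e' ≥ wt a ≥ wt e` with
equality only for `e' = a = e`.)  With 7b this gives FOC-type localisation: all difficulty sits in ALL-DEAD instances. -/
theorem stub_localisation : ∀ (n : ℕ) (u v : Fin n → MvPolynomial (Fin 2) ℂ),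
    (∀ i, MvPolynomial.coeff 0 (u i) = 1) → (∀ i, MvPolynomial.coeff 0 (v i) = 1) →
    ∀ (w : Fin 2 → ℤ), 0 < w 0 → 0 < w 1 → ∀ (e : Fin 2 →₀ ℕ),
    (e ∈ (∏ i, u i - ∏ i, v i).support ∧ ∀ e' ∈ (∏ i, u i - ∏ i, v i).support, e' ≠ e →
      w 0 * (e 0 : ℤ) + w 1 * (e 1 : ℤ) < w 0 * (e' 0 : ℤ) + w 1 * (e' 1 : ℤ)) →
    (∃ i, e ∈ (u i).support ∨ e ∈ (v i).support) ∨
    (e ∈ (∏ i, (∑ a ∈ (u i).support with a ∉ (∏ j, u j - ∏ j, v j).support,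
              MvPolynomial.monomial a (MvPolynomial.coeff a (u i))) -
          ∏ i, (∑ a ∈ (v i).support with a ∉ (∏ j, u j - ∏ j, v j).support,
              MvPolynomial.monomial a (MvPolynomial.coeff a (v i)))).support ∧
      ∀ e' ∈ (∏ i, (∑ a ∈ (u i).support with a ∉ (∏ j, u j - ∏ j, v j).support,
              MvPolynomial.monomial a (MvPolynomial.coeff a (u i))) -
          ∏ i, (∑ a ∈ (v i).support with a ∉ (∏ j, u j - ∏ j, v j).support,
              MvPolynomial.monomial a (MvPolynomial.coeff a (v i)))).support, e' ≠ e →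
        w 0 * (e 0 : ℤ) + w 1 * (e 1 : ℤ) < w 0 * (e' 0 : ℤ) + w 1 * (e' 1 : ℤ)) :=
  Summit.ValiantsHypothesis.ValiantsHypothesis.Theorems.TwoProducts.Localisation.stub_localisation

/-! ## LEAD c3 RESHAPE of stub 7b (2026-08-16): the RECORD normal form — a λ-free engine

For ANY family `f : Fin N → ℂ[X,Y]` with constant terms `1` let `𝐋[p, i] = [x^p] log f_i` (read off the order-`R`
truncation `Σ_{r ≤ R} κ_r (f_i − 1)^r` with `R = wt_w p + 1`, which is exact at weights `≤ wt_w p`).  A south-west vertex `e`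
of `∏u − ∏v` exposed by `w` (indeed every stable strict `w`-minimiser of the log power sums) is a ROW-RECORD of `𝐋` for the
family `Fin.append u v` in `w`-order: `row_e ∉ span{row_q : wt_w q < wt_w e}` — because `coeff_q Λ_R = ⟨λ, row_q⟩` with
`λ = (1,…,1,−1,…,−1)` vanishes below `e` and not at `e` (`stub_recordReduction`, provable now).  For each `w` there are at most
`rank 𝐋 ≤ N` records, and the records do not depend on `λ`: the engine follows from the λ-FREE bound
`stub_rowRecordBound` — the union over all positive weights of the greedy (min-weight) row bases of `𝐋` is finite of size
`≤ 2^(aN)(t+2)^b` for `t`-sparse factors.  Equivalently (this seat's NOTES, Framework III): the union over ALL complex exponent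
vectors `ν` of the south-west vertex sets of `∏ f_i^{ν_i} − 1` is small.  TRUE with `(s²+2)·N·4^N`-type bounds in the
dissociated regime (the rung below, same proof), for generic coefficients (greedy bases = the `N` lightest semigroup points),
for rays; numerically `|⋃_w GB_w| ≤ N·s` in every instance tried (exp/eeff*.py; sharp on rays), `N log N` for `s = 2` and
generic atoms.  Stub 7b is DERIVED below from the two new stubs (so every older composition remains valid). -/

/-- STUB 7c — RECORD REDUCTION (M, provable now).  Constant terms `1`, `w > 0`; if `e` is the unique `w`-lightest support point
of the log power sum `Λ_R` for every `R > wt_w e` (a stable log-vertex), then `e` is a `w`-row-record of the log-coefficient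
matrix of the family `Fin.append u v`: its row (at truncation order `wt_w e + 1`) is not in the `ℂ`-span of the rows of the
strictly `w`-lighter exponents.  (`coeff_q Λ_R = Σ_i row_q(inl i) − Σ_i row_q(inr i)`; apply this functional to a putative
linear relation.) -/
theorem stub_recordReduction : ∀ (n : ℕ) (u v : Fin n → MvPolynomial (Fin 2) ℂ),
    (∀ i, MvPolynomial.coeff 0 (u i) = 1) → (∀ i, MvPolynomial.coeff 0 (v i) = 1) →
    ∀ (w : Fin 2 → ℤ), 0 < w 0 → 0 < w 1 → ∀ (e : Fin 2 →₀ ℕ),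
    (∀ R : ℕ, w 0 * (e 0 : ℤ) + w 1 * (e 1 : ℤ) < (R : ℤ) →
      (e ∈ (∑ r ∈ Finset.Icc 1 R, ((-1 : ℂ) ^ (r + 1) / (r : ℂ)) •
          (∑ i, (u i - 1) ^ r - ∑ i, (v i - 1) ^ r)).support ∧
        ∀ e' ∈ (∑ r ∈ Finset.Icc 1 R, ((-1 : ℂ) ^ (r + 1) / (r : ℂ)) •
          (∑ i, (u i - 1) ^ r - ∑ i, (v i - 1) ^ r)).support, e' ≠ e →
          w 0 * (e 0 : ℤ) + w 1 * (e 1 : ℤ) < w 0 * (e' 0 : ℤ) + w 1 * (e' 1 : ℤ))) →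
    (fun i : Fin (n + n) => MvPolynomial.coeff e
          (∑ r ∈ Finset.Icc 1 ((w 0 * (e 0 : ℤ) + w 1 * (e 1 : ℤ)).toNat + 1),
            ((-1 : ℂ) ^ (r + 1) / (r : ℂ)) • (Fin.append u v i - 1) ^ r)) ∉
        Submodule.span ℂ ((fun q : Fin 2 →₀ ℕ => fun i : Fin (n + n) => MvPolynomial.coeff q
          (∑ r ∈ Finset.Icc 1 ((w 0 * (e 0 : ℤ) + w 1 * (e 1 : ℤ)).toNat + 1),
            ((-1 : ℂ) ^ (r + 1) / (r : ℂ)) • (Fin.append u v i - 1) ^ r)) ''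
          {q : Fin 2 →₀ ℕ | w 0 * (q 0 : ℤ) + w 1 * (q 1 : ℤ) < w 0 * (e 0 : ℤ) + w 1 * (e 1 : ℤ)}) :=
  Summit.ValiantsHypothesis.ValiantsHypothesis.Theorems.TwoProducts.RecordReduction.stub_recordReduction

/-! STUB 7d `stub_rowRecordBound` (lead c3's λ-free ROW-RECORD BOUND) is SUPERSEDED (lead c4, 2026-08-16) and no longer
registered: its natural multiset refinements are false (H1 "vertex = sum of ≤ N−1 column-record letters" dies on the ray
cascade `(1+x)(1−x+…+x⁶) − 1 = x⁷`; H2 "one free letter + records" dies on `u₁ = 1+x+y`, `u₂ = [u₁⁻¹]_{<2K}` w.r.t. `(1,K)`,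
vertex `y²`), leaving no proof path beyond the landed dissociated regime.  The statement survives as `Stmt.stub_rowRecordBound`
with its derivation `TwoProducts_of_records` (documentation).  The live engine stubs are the PEEL–SHALLOW pair below. -/

/-! ## LEAD c4 RESHAPE (2026-08-16): the PEEL–SHALLOW normal form — a support-only engine

Peel the last factor and invert the rest: with `Q' = ∏_{j≥1} v_j` (a unit of `ℂ[[x,y]]`) and the power series
`G = (∏ u_i)·Q'⁻¹`, one has `∏u − ∏v = Q'·(G − v₀)`, and multiplication by a power series with constant term `1` preserves
strict `w`-minimisers of supports for every positive weight `w` (induction on the weight).  So the south-west vertices of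
`∏u − ∏v` are those of the power series `G − v₀`; and if `e` is one of them then every OTHER support point `q ≠ 0` of `G` of
weight `≤ wt_w e` is cancelled by `v₀`, i.e. is one of the `≤ t − 1` nonzero letters of `v₀` (`stub_peelShallow`, provable).
Hence `V ≤ t + #T_t(supp G)` where `T_t(S) = {e ∈ S : ∃ w > 0, #{q ∈ S ∖ {0,e} : wt_w q ≤ wt_w e} ≤ t − 1}` is the set of
`t`-SHALLOW points of the support — a notion that sees only the SUPPORT of the unit product `G = ∏u_i · ∏ v_j⁻¹` and no longer
the peeled factor.  The engine is thereby EQUIVALENT (up to `(a,b) ↦ (2a+1,b+1)`, and conversely by truncating `G` below a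
shallow point, which produces a two-products instance) to `stub_shallowBound`: unit products of `k` sparse polynomials and `m`
inverses of sparse polynomials (constant terms `1`, `≤ t` monomials) have `≤ 2^(a(k+m))(t+2)^b` `t`-shallow support points.
Evidence (this seat, exact, exp/conjG*.py): `|T_t(supp G)| ≈ 1.5t–3t + O(L)` on random mixed-sign unit products, sumsets,
deep-agreement (hole-rich) designs, combs `P/(1−z)` and doubly periodic thin `P`; `Θ(t log t)` on `ℕ²`; it CAN reach
`≈ L + |A|·|B|` (exponential chain `A` plus a small cluster `B`, `t ≈ 2|B|`), so the sharp form is polynomial (`≈ L·t`), not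
`O(L + t)`.  KPTT's `fg + 1` is the case `k = 0, m = 1` (`T_t(supp f⁻¹)`). -/

/-- STUB 7e — PEEL–SHALLOW REDUCTION (LANDED p122612, lead c4 wave 2; discharged by import).  For polynomials `u_i`, units `v_j`
(constant terms `1`) and a polynomial `p`, every south-west vertex `e` (strict `w`-minimiser of the support, `w > 0`) of
`∏ u_i − p·∏ v_j` is a letter of `p`, or a support point of the power series `G = (∏ u_i)·(∏ v_j)⁻¹` such that every other
nonzero support point of `G` of `w`-weight `≤ wt_w e` is a letter of `p`.  (`∏u − p∏v = (∏v)·(G − p)`; a power series with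
constant term `1` preserves strict minimisers — strong induction on the weight through `MvPowerSeries.coeff_mul` over the
antidiagonal; below `e` the series `G − p` vanishes, so `G` agrees with `p` there.) -/
theorem stub_peelShallow : ∀ (k m : ℕ) (u : Fin k → MvPolynomial (Fin 2) ℂ) (v : Fin m → MvPolynomial (Fin 2) ℂ)
    (p : MvPolynomial (Fin 2) ℂ), (∀ j, MvPolynomial.coeff 0 (v j) = 1) →
    ∀ (w : Fin 2 → ℤ), 0 < w 0 → 0 < w 1 → ∀ (e : Fin 2 →₀ ℕ),
    (e ∈ ((∏ i, u i) - p * ∏ j, v j).support ∧ ∀ e' ∈ ((∏ i, u i) - p * ∏ j, v j).support, e' ≠ e →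
      w 0 * (e 0 : ℤ) + w 1 * (e 1 : ℤ) < w 0 * (e' 0 : ℤ) + w 1 * (e' 1 : ℤ)) →
    e ∈ p.support ∨
      (MvPowerSeries.coeff e ((∏ i, ((u i : MvPolynomial (Fin 2) ℂ) : MvPowerSeries (Fin 2) ℂ)) *
          (∏ j, ((v j : MvPolynomial (Fin 2) ℂ) : MvPowerSeries (Fin 2) ℂ))⁻¹) ≠ 0 ∧
        ∀ q : Fin 2 →₀ ℕ, q ≠ 0 → q ≠ e →
          MvPowerSeries.coeff q ((∏ i, ((u i : MvPolynomial (Fin 2) ℂ) : MvPowerSeries (Fin 2) ℂ)) *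
              (∏ j, ((v j : MvPolynomial (Fin 2) ℂ) : MvPowerSeries (Fin 2) ℂ))⁻¹) ≠ 0 →
          w 0 * (q 0 : ℤ) + w 1 * (q 1 : ℤ) ≤ w 0 * (e 0 : ℤ) + w 1 * (e 1 : ℤ) → q ∈ p.support) :=
  Summit.ValiantsHypothesis.ValiantsHypothesis.Theorems.TwoProducts.PeelShallow.stub_peelShallow

/-! STUB 7f `stub_shallowBound` (lead c4's `t`-SHALLOW BOUND) is SUPERSEDED (lead c5, 2026-08-16) and no longer registered: it
forgets that the competitors of a vertex of `G − p` all lie in the ONE fixed set `supp p ∖ {0}` and keeps only their NUMBER `≤ t − 1`, which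
turns the count into a kinetic `(≤ t)`-level count (a union over all positive directions `w` of the `t` lightest support points of `G`) that
is NOT implied by the engine and has no known bound already at `(k,m) = (0,1)` (the `t` lightest points of `supp(v⁻¹)` over all `w`; lead c5
NOTES, exp/shallow.py, kit j019940–2).  The statement survives as `Stmt.stub_shallowBound`, a documented SUFFICIENT condition
(`pinned_of_shallow` below).  The live engine stub is the PINNED form 7g, which is support-only AND engine-equivalent. -/

/-! ## LEAD c5 RESHAPE (2026-08-16): the PINNED–SHALLOW normal form — support-only and crux-EQUIVALENT

For a vertex `e` (strict `w`-minimiser, `w > 0`) of `G − p` the nonzero support points of `G` that are `w`-lighter than or as light as `e`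
form a subset of the FIXED set `L = supp p ∖ {0}` (`|L| ≤ t − 1`), the same `L` for every `w` (7e).  Conversely, if the `w`-lower set of a
support point `e ∉ L ∪ {0}` of `G` lies inside a finite set `L`, then `e` is the strict `w`-minimiser of `supp(G − p_L)` for the truncation
`p_L = Σ_{q ∈ L ∪ {0}} G_q x^q` (a polynomial with `≤ |L| + 1` terms and constant term `1`), i.e. a south-west vertex of the two-products
instance `∏ u_i − p_L·∏ v_j` with ONE more `t`-sparse factor (7h, provable: a unit series does not move a strict minimiser, easy direction).
So the engine for `(k, m+1)` factors bounds the `L`-pinned points of `(k, m)`-quotients and vice versa: 7g below is EQUIVALENT to the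
engine (up to `(a,b) ↦ (2a+1, b+1)` one way and `m ↦ m+1` the other), and it mentions only `supp G` and a `(t−1)`-subset `L` of exponents. -/

/-! STUB 7g `stub_pinnedShallowBound` (lead c5's PINNED SHALLOW BOUND: for `k` polynomials `u_i` and `m` polynomials `v_j` with constant
terms `1` and `≤ t` monomials, and ANY set `L` of `≤ t − 1` exponents, the `L`-pinned support points of `G = (∏ u_i)·(∏ v_j)⁻¹` number
`≤ 2^(a(k+m))·(t+2)^b`) is DE-REGISTERED by lead c8 (2026-08-17) in favour of the LINEAR partial-fraction normal form (section "LEAD c8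
RESHAPE" below), exactly as 7f was superseded by 7g: it stays TRUE-iff-the-crux (7h p126739 + `allDeadEngine_of_pinned` below), it is kept
as the named statement `Stmt.stub_pinnedShallowBound` with its derivation `allDeadEngine_of_pinned` (documentation, hypothesis-taking, no
`sorry`), and everything c5–c7 landed around it remains imported.  Reason for the switch: three seats (c5, c6, c7) attacked 7g through
multiplicative structure (peeling, radix residues, nets, resonance) and isolated the residual regime without a monovariant; the
partial-fraction form replaces the power series `G` and the kinetic set `L` by ONE polynomial `Σ_j p_j ∏_{i≠j} q_i` that is LINEAR in the
numerators `p_j`, so that "cancellation beyond the first-order budget" becomes rank deficiency of an explicit matrix of inverse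
coefficients `([x^{e−b}] q_j⁻¹)` — a quantity one can compute, design against, and bound. -/

/-- STUB 7h — PINNED CONVERSE (LANDED p126739, lead c5 wave 2; discharged by import; certifies that 7g is not a strengthening of the engine).  With `v_j(0) = 1`,
`G = (∏ u_i)·(∏ v_j)⁻¹`, a finite set `L` of exponents, a positive weight `w` and a nonzero support point `e ∉ L` of `G` all of whose OTHER
nonzero `w`-lighter-or-equal support points lie in `L`: `e` is the strict `w`-minimiser of the support of the polynomial
`∏ u_i − p_L · ∏ v_j`, where `p_L = Σ_{q ∈ insert 0 L} (coeff_q G)·x^q` is the truncation of `G` to `L ∪ {0}`.  (`∏u_i − p_L ∏v_j = (G − p_L)·∏v_j`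
as power series since `(∏v_j)⁻¹·∏v_j = 1`; `G − p_L` vanishes at `0`, on `L`, and — by hypothesis — at every other `w`-lighter-or-equal `q ≠ e`,
while its coefficient at `e` is `G_e ≠ 0`; multiplying by a series with constant term `1` keeps a strict minimiser: in the Cauchy product at
such a `q` every term `(∏v)_a (G − p_L)_b`, `a + b = q`, has `b` lighter-or-equal and `b ≠ e` unless `a = 0, q = e`.) -/
theorem stub_pinnedConverse : ∀ (k m : ℕ) (u : Fin k → MvPolynomial (Fin 2) ℂ)
    (v : Fin m → MvPolynomial (Fin 2) ℂ) (L : Finset (Fin 2 →₀ ℕ)),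
    (∀ j, MvPolynomial.coeff 0 (v j) = 1) →
    ∀ (w : Fin 2 → ℤ), 0 < w 0 → 0 < w 1 → ∀ (e : Fin 2 →₀ ℕ), e ≠ 0 → e ∉ L →
    MvPowerSeries.coeff e ((∏ i, ((u i : MvPolynomial (Fin 2) ℂ) : MvPowerSeries (Fin 2) ℂ)) *
          (∏ j, ((v j : MvPolynomial (Fin 2) ℂ) : MvPowerSeries (Fin 2) ℂ))⁻¹) ≠ 0 →
    (∀ q : Fin 2 →₀ ℕ, q ≠ 0 → q ≠ e →
      MvPowerSeries.coeff q ((∏ i, ((u i : MvPolynomial (Fin 2) ℂ) : MvPowerSeries (Fin 2) ℂ)) *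
          (∏ j, ((v j : MvPolynomial (Fin 2) ℂ) : MvPowerSeries (Fin 2) ℂ))⁻¹) ≠ 0 →
      w 0 * (q 0 : ℤ) + w 1 * (q 1 : ℤ) ≤ w 0 * (e 0 : ℤ) + w 1 * (e 1 : ℤ) → q ∈ L) →
    e ∈ ((∏ i, u i) - (∑ q ∈ insert 0 L, MvPolynomial.monomial q (MvPowerSeries.coeff q
            ((∏ i, ((u i : MvPolynomial (Fin 2) ℂ) : MvPowerSeries (Fin 2) ℂ)) *
              (∏ j, ((v j : MvPolynomial (Fin 2) ℂ) : MvPowerSeries (Fin 2) ℂ))⁻¹))) * ∏ j, v j).support ∧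
      ∀ e' ∈ ((∏ i, u i) - (∑ q ∈ insert 0 L, MvPolynomial.monomial q (MvPowerSeries.coeff q
            ((∏ i, ((u i : MvPolynomial (Fin 2) ℂ) : MvPowerSeries (Fin 2) ℂ)) *
              (∏ j, ((v j : MvPolynomial (Fin 2) ℂ) : MvPowerSeries (Fin 2) ℂ))⁻¹))) * ∏ j, v j).support,
        e' ≠ e → w 0 * (e 0 : ℤ) + w 1 * (e 1 : ℤ) < w 0 * (e' 0 : ℤ) + w 1 * (e' 1 : ℤ) :=
  Summit.ValiantsHypothesis.ValiantsHypothesis.Theorems.TwoProducts.PinnedConverse.stub_pinnedConverse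

/-- RUNG STUB (lead c8) — ONE PRODUCT WITHOUT SHARED LETTERS IS FIRST ORDER (LANDED p138163, lead c8 wave 3; discharged by import by lead c9; formalises the moral that KPTT §5.2's
`f₁⋯f_m + 1` is ENTIRELY about shared supports).  Local one-product instance (constant terms `1`); if no nonzero exponent lies in the supports
of two different factors, then every south-west vertex `e` of `∏u − 1` is a letter of minimal `w`-weight among ALL nonzero letters (so
`V ≤ #swVert(letters) ≤ |U|`).  (Let `m` be the least weight of a nonzero letter, attained at `a ∈ supp u_i`.  In the word expansion of `∏u`
— `uw_prod_expand`/`uw_coeff_prod` of the landed UniqueWords file, with `S i ⊇ supp u_i` — a word summing to `a` has total weight `m`, hence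
exactly one nonzero entry, equal to `a`, sitting in factor `i` by the no-sharing hypothesis: `coeff_a(∏u − 1) = u_i[a] ≠ 0`.  So the strict
minimiser `e` has `wt e ≤ m`; and `e ∈ supp(∏u − 1)` forces `e ≠ 0` and a word with ≥ 1 nonzero entry, `wt e ≥ m`; equality leaves one entry.) -/
theorem stub_engineNoSharing : ∀ (n : ℕ) (u : Fin n → MvPolynomial (Fin 2) ℂ),
    (∀ i, MvPolynomial.coeff 0 (u i) = 1) →
    (∀ i j, i ≠ j → ∀ a ∈ (u i).support, a ∈ (u j).support → a = 0) →
    ∀ (w : Fin 2 → ℤ), 0 < w 0 → 0 < w 1 → ∀ (e : Fin 2 →₀ ℕ),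
    (e ∈ (∏ i, u i - 1).support ∧ ∀ e' ∈ (∏ i, u i - 1).support, e' ≠ e →
      w 0 * (e 0 : ℤ) + w 1 * (e 1 : ℤ) < w 0 * (e' 0 : ℤ) + w 1 * (e' 1 : ℤ)) →
    e ≠ 0 ∧ ∃ i, e ∈ (u i).support ∧
      ∀ j, ∀ a ∈ (u j).support, a ≠ 0 → w 0 * (e 0 : ℤ) + w 1 * (e 1 : ℤ) ≤ w 0 * (a 0 : ℤ) + w 1 * (a 1 : ℤ) :=
  Summit.ValiantsHypothesis.ValiantsHypothesis.Theorems.TwoProducts.NoSharing.stub_engineNoSharing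

/-! ## Landed rung / structural stubs of leads c3–c7 (index; formerly restated verbatim here — trimmed by lead c8 to keep the workfile
under the crux-store size cap; every one is ACCEPTED under `Theorems/` and importable by the module named in its prefix):

* `stub_quotientPredecessor` (p126012) = `Summit.ValiantsHypothesis.ValiantsHypothesis.Theorems.TwoProducts.QuotientPredecessor.stub_quotientPredecessor`
* `stub_letterBelow` (p126078) = `Summit.ValiantsHypothesis.ValiantsHypothesis.Theorems.TwoProducts.LetterBelow.stub_letterBelow`
* `stub_engineLetterPredecessor` (p124066) = `Summit.ValiantsHypothesis.ValiantsHypothesis.Theorems.TwoProducts.LetterPredecessor.stub_engineLetterPredecessor`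
* `stub_enginePencil` (p124676) = `Summit.ValiantsHypothesis.ValiantsHypothesis.Theorems.TwoProducts.Pencil.stub_enginePencil`
* `stub_radixResidueOff` (p128514) = `Summit.ValiantsHypothesis.ValiantsHypothesis.Theorems.TwoProducts.RadixResidueOff.stub_radixResidueOff`
* `stub_radixResidueOn` (p128352) = `Summit.ValiantsHypothesis.ValiantsHypothesis.Theorems.TwoProducts.RadixResidueOn.stub_radixResidueOn`
* `stub_engineRadix` (p128818) = `Summit.ValiantsHypothesis.ValiantsHypothesis.Theorems.TwoProducts.Radix.stub_engineRadix`
* `stub_drillingDichotomy` (p129907) = `Summit.ValiantsHypothesis.ValiantsHypothesis.Theorems.TwoProducts.DrillingDichotomy.stub_drillingDichotomy`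
* `stub_radixPairCosetOn` (p129998) = `Summit.ValiantsHypothesis.ValiantsHypothesis.Theorems.TwoProducts.RadixPairCosetOn.stub_radixPairCosetOn`
* `stub_cosetTransport` (p130003) = `Summit.ValiantsHypothesis.ValiantsHypothesis.Theorems.TwoProducts.CosetTransport.stub_cosetTransport`
* `stub_radixClassMin` (p129269) = `Summit.ValiantsHypothesis.ValiantsHypothesis.Theorems.TwoProducts.RadixClassMin.stub_radixClassMin`
* `stub_radixCosetOn` (p129304) = `Summit.ValiantsHypothesis.ValiantsHypothesis.Theorems.TwoProducts.RadixCosetOn.stub_radixCosetOn`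
* `stub_radixClassTransport` (p129320) = `Summit.ValiantsHypothesis.ValiantsHypothesis.Theorems.TwoProducts.RadixClassTransport.stub_radixClassTransport`
* `stub_enginePinnedRadix` (p129495) = `Summit.ValiantsHypothesis.ValiantsHypothesis.Theorems.TwoProducts.PinnedRadix.stub_enginePinnedRadix`
* `stub_engineNetTransversal` (p132159) = `Summit.ValiantsHypothesis.ValiantsHypothesis.Theorems.TwoProducts.NetTransversal.stub_engineNetTransversal`
* `stub_echelonPivots` (p132414) = `Summit.ValiantsHypothesis.ValiantsHypothesis.Theorems.TwoProducts.EchelonPivots.stub_echelonPivots`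
* `stub_resonanceDichotomy` (p132489) = `Summit.ValiantsHypothesis.ValiantsHypothesis.Theorems.TwoProducts.ResonanceDichotomy.stub_resonanceDichotomy`
* `stub_engineNonResonant` (p133215) = `Summit.ValiantsHypothesis.ValiantsHypothesis.Theorems.TwoProducts.NonResonant.stub_engineNonResonant`
* `stub_engineSeparated` (p133405) = `Summit.ValiantsHypothesis.ValiantsHypothesis.Theorems.TwoProducts.Separated.stub_engineSeparated`
* `stub_levelCount` (p133723) = `Summit.ValiantsHypothesis.ValiantsHypothesis.Theorems.TwoProducts.LevelCount.stub_levelCount`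
* `stub_projectionBound` (p134003) = `Summit.ValiantsHypothesis.ValiantsHypothesis.Theorems.TwoProducts.ProjectionBound.stub_projectionBound`
* `stub_engineSeparatedRank` (p133609) = `Summit.ValiantsHypothesis.ValiantsHypothesis.Theorems.TwoProducts.SeparatedRank.stub_engineSeparatedRank`
* `stub_minkowskiSW` (p134096) = `Summit.ValiantsHypothesis.ValiantsHypothesis.Theorems.TwoProducts.MinkowskiSW.stub_minkowskiSW`
* `stub_engineTaggedCores` (p134877) = `Summit.ValiantsHypothesis.ValiantsHypothesis.Theorems.TwoProducts.TaggedCores.stub_engineTaggedCores`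
* `stub_engineTwoRayAxial` (p134763) = `Summit.ValiantsHypothesis.ValiantsHypothesis.Theorems.TwoProducts.TwoRayAxial.stub_engineTwoRayAxial`
* `stub_engineCollinear` (p132492) = `Summit.ValiantsHypothesis.ValiantsHypothesis.Theorems.TwoProducts.Collinear.stub_engineCollinear`
* `stub_dissocRecords` (p116595) = `Summit.ValiantsHypothesis.ValiantsHypothesis.Theorems.TwoProducts.DissocRecords.stub_dissocRecords`
* `stub_dissocRecordCard` (p116436) = `Summit.ValiantsHypothesis.ValiantsHypothesis.Theorems.TwoProducts.DissocRecordCard.stub_dissocRecordCard`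
* `stub_dissocLift` (p116658) = `Summit.ValiantsHypothesis.ValiantsHypothesis.Theorems.TwoProducts.DissocLift.stub_dissocLift`
* `stub_dissocBridge` (p117905) = `Summit.ValiantsHypothesis.ValiantsHypothesis.Theorems.TwoProducts.DissocBridge.stub_dissocBridge`
* `stub_dissocCount` (p116759) = `Summit.ValiantsHypothesis.ValiantsHypothesis.Theorems.TwoProducts.DissocCount.stub_dissocCount`
* `stub_engineDissociated` (p120118) = `Summit.ValiantsHypothesis.ValiantsHypothesis.Theorems.TwoProducts.Dissociated.stub_engineDissociated`

Their statements, proofs-of-concept and the regimes they close are described in the crux NOTES.md (Frameworks III–VII) and in the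
docstrings of the landed files. -/

/-! ## LEAD c8 RESHAPE (2026-08-17): the PARTIAL-FRACTION normal form — a LINEAR engine, crux-equivalent

Let `θ = x∂_x + y∂_y` be the Euler operator (`θ x^a = (a₀+a₁) x^a`: it kills exactly the constant term and rescales every other
coefficient by a NONZERO integer) and let `P = ∏ u_i`, `Q = ∏ v_i` have the same nonzero constant term.  With `R = P − Q` one has
`θP·Q − P·θQ = θR·Q − R·θQ`; for a positive weight `w` the `w`-lightest part of the right side is `Q(0)·θ(in_w R)`, which has the SAME
support as `in_w R` — so the strict `w`-minimisers of `supp(P − Q)` and of `supp(θP·Q − P·θQ)` coincide (8a `stub_eulerTransfer`; no power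
series, no logarithm).  By Leibniz, `θP·Q − P·θQ = Σ_j (θu_j)(∏_{i≠j} u_i)(∏ v) − Σ_j (θv_j)(∏ u)(∏_{i≠j} v_i)`, i.e. the instance
`N = 2n`, `(p, q) = ((θu, −θv), (u, v))` of the PARTIAL-FRACTION NUMERATOR `Σ_{j<N} p_j ∏_{i≠j} q_i` of the sum of sparse fractions
`Σ_j p_j/q_j` (8b `stub_eulerLeibnizAppend`, the `Fin.append` bookkeeping included).  Hence the engine follows from

  8d `stub_partialFractionBound` (OPEN, held by the lead):  `#swVert(Σ_{j<N} p_j ∏_{i≠j} q_i) ≤ 2^(aN)·(t+2)^b` for `t`-sparse `p_j, q_j`.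

Conversely (8c `stub_blockLift`, provable): for `K > N·(max total degree)` the block substitution `f_j = q_j + x^K y^K·p_j`, `g_j = q_j`
gives `∏f − ∏g = x^K y^K·Σ_j p_j ∏_{i≠j} q_i + (blocks of x^K y^K-order ≥ 2, all strictly w-heavier for every w > 0)`, so
`e ↦ e + (K,K)` injects the south-west vertices of the numerator into those of a two-products instance with `2t`-sparse factors:
the crux implies 8d with constants `(a+b, b)` (`partialFraction_of_crux` below).  So 8d is crux-EQUIVALENT, is verbatim a KPTT
sum-of-products instance (`k = N` summands of `N` factors, structured), contains KPTT §5's `fg + 1` (`N = 2`: `p = (f, 1)`, `q = (1, g)`),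
and is LINEAR in `p`: for fixed denominators the coefficient of `x^e` in `Σ_j p_j/q_j` is `Σ_{j,b} p_{j,b}·[x^{e−b}] q_j⁻¹`, so a dead
down-set `Z` costs `rank ([x^{e−b}] q_j⁻¹)_{e ∈ Z, (j,b)}` of the `≤ Σ_j |supp p_j|` numerator unknowns — Disproof F9's first-order
count is the statement that this matrix has (nearly) full rank, and a counterexample needs a sparse-denominator family whose
inverse-coefficient matrices lose rank faster than the budget along a convex staircase (this seat's kit census). -/

/-- The Euler operator `θ = Σ_i X_i ∂_i` on `ℂ[x,y]` (readable name; the registered stubs inline it). -/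
def euler (f : MvPolynomial (Fin 2) ℂ) : MvPolynomial (Fin 2) ℂ :=
  ∑ i : Fin 2, MvPolynomial.X i * MvPolynomial.pderiv i f

/-- The partial-fraction numerator `Σ_j p_j ∏_{i ≠ j} q_i` of `Σ_j p_j / q_j` (readable name; the registered stubs inline it). -/
def pfNum {N : ℕ} (p q : Fin N → MvPolynomial (Fin 2) ℂ) : MvPolynomial (Fin 2) ℂ :=
  ∑ j, p j * ∏ i ∈ Finset.univ.erase j, q i

/-- STUB 8a — EULER TRANSFER (LANDED p136755, lead c8 wave 1; discharged by import).  If `P, Q ∈ ℂ[x,y]` have the same NONZERO constant term, then for every positive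
integer weight `w` the strict `w`-minimisers of `supp(P − Q)` and of `supp(θP·Q − P·θQ)` (`θ = x∂_x + y∂_y`) coincide.  (Put
`R = P − Q`, so `R(0) = 0` and `θP·Q − P·θQ = θR·Q − R·θQ`; `coeff_a θR = (a₀+a₁)·coeff_a R` has the same support as `R`; if `ω` is the
least `w`-weight on `supp R`, the points of weight `ω` in `supp(θR·Q)` are exactly those of `supp R`, with coefficient
`(a₀+a₁)·R_a·Q(0) ≠ 0` (antidiagonal expansion: the partner of a lightest `a` must be `0`), every other point of `supp(θR·Q)` and every
point of `supp(R·θQ) ⊆ supp R + (supp Q ∖ 0)` is strictly heavier; so both supports have least weight `ω` and the same weight-`ω`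
points.  `R = 0` makes both sides empty.) -/
theorem stub_eulerTransfer : ∀ (P Q : MvPolynomial (Fin 2) ℂ),
    MvPolynomial.coeff 0 P = MvPolynomial.coeff 0 Q → MvPolynomial.coeff 0 Q ≠ 0 →
    ∀ (w : Fin 2 → ℤ), 0 < w 0 → 0 < w 1 → ∀ (e : Fin 2 →₀ ℕ),
    ((e ∈ (P - Q).support ∧ ∀ e' ∈ (P - Q).support, e' ≠ e →
        w 0 * (e 0 : ℤ) + w 1 * (e 1 : ℤ) < w 0 * (e' 0 : ℤ) + w 1 * (e' 1 : ℤ)) ↔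
      (e ∈ ((∑ i : Fin 2, MvPolynomial.X i * MvPolynomial.pderiv i P) * Q -
              P * (∑ i : Fin 2, MvPolynomial.X i * MvPolynomial.pderiv i Q)).support ∧
        ∀ e' ∈ ((∑ i : Fin 2, MvPolynomial.X i * MvPolynomial.pderiv i P) * Q -
              P * (∑ i : Fin 2, MvPolynomial.X i * MvPolynomial.pderiv i Q)).support, e' ≠ e →
          w 0 * (e 0 : ℤ) + w 1 * (e 1 : ℤ) < w 0 * (e' 0 : ℤ) + w 1 * (e' 1 : ℤ))) :=
  Summit.ValiantsHypothesis.ValiantsHypothesis.Theorems.TwoProducts.EulerTransfer.stub_eulerTransfer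

/-- STUB 8b — EULER–LEIBNIZ IN PARTIAL-FRACTION FORM (LANDED p136492, lead c8 wave 1; discharged by import).  `θ(∏u)·∏v − ∏u·θ(∏v)` is the partial-fraction
numerator `Σ_{j : Fin (n+n)} p_j ∏_{i ≠ j} q_i` of the appended family `q = Fin.append u v`, `p = Fin.append (θ∘u) (−θ∘v)`.
(`θ = Σ_i X_i·∂_i` is a sum of derivations: Leibniz over `Finset.prod` — cf. the tree's
`Literature.AlgebraicGeometry.Resolution.Derivation.apply_finset_prod` —, then split the sum over `Fin (n+n)` with `Fin.sum_univ_add` and the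
products over `Finset.univ.erase (Fin.castAdd n k)` / `… (Fin.natAdd n k)` with `Fin.prod_univ_add`, `Fin.append_left/right`.) -/
theorem stub_eulerLeibnizAppend : ∀ (n : ℕ) (u v : Fin n → MvPolynomial (Fin 2) ℂ),
    (∑ i : Fin 2, MvPolynomial.X i * MvPolynomial.pderiv i (∏ k, u k)) * (∏ k, v k) -
        (∏ k, u k) * (∑ i : Fin 2, MvPolynomial.X i * MvPolynomial.pderiv i (∏ k, v k)) =
      ∑ j : Fin (n + n),
        Fin.append (fun k => ∑ i : Fin 2, MvPolynomial.X i * MvPolynomial.pderiv i (u k))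
            (fun k => -(∑ i : Fin 2, MvPolynomial.X i * MvPolynomial.pderiv i (v k))) j *
          ∏ i ∈ Finset.univ.erase j, Fin.append u v i :=
  Summit.ValiantsHypothesis.ValiantsHypothesis.Theorems.TwoProducts.EulerLeibnizAppend.stub_eulerLeibnizAppend

/-- STUB 8c — BLOCK LIFT (LANDED p136489, lead c8 wave 1; discharged by import; certifies that 8d is IMPLIED BY the crux).  Let `p_j, q_j` (`j < N`) have total degree `≤ d`
and let `K > N·d`, `Z = x^K y^K`.  Then `∏_j (q_j + Z·p_j) − ∏_j q_j = Z·F + Σ_{s ≥ 2} Z^s F_s` with `F = Σ_j p_j ∏_{i≠j} q_i` and every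
`F_s` of total degree `≤ N·d` (`Finset.prod_add`), and for EVERY positive integer weight `w` each support point of a block `s ≥ 2` has
weight `≥ 2K(w₀+w₁) > K(w₀+w₁) + (w₀+w₁)·N·d ≥` the weight of each point of `supp(Z·F)`; so the blocks do not interact with `Z·F`
(`coeff_{(K,K)+c} = coeff_c F` for `c₀+c₁ ≤ N·d`) and a strict `w`-minimiser `e` of `supp F` shifts to the strict `w`-minimiser
`e + (K,K)` of the support of the two-products difference. -/
theorem stub_blockLift : ∀ (N d K : ℕ) (p q : Fin N → MvPolynomial (Fin 2) ℂ),
    (∀ j, (p j).totalDegree ≤ d) → (∀ j, (q j).totalDegree ≤ d) → N * d < K →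
    ∀ (w : Fin 2 → ℤ), 0 < w 0 → 0 < w 1 → ∀ (e : Fin 2 →₀ ℕ),
    (e ∈ (∑ j, p j * ∏ i ∈ Finset.univ.erase j, q i).support ∧
      ∀ e' ∈ (∑ j, p j * ∏ i ∈ Finset.univ.erase j, q i).support, e' ≠ e →
        w 0 * (e 0 : ℤ) + w 1 * (e 1 : ℤ) < w 0 * (e' 0 : ℤ) + w 1 * (e' 1 : ℤ)) →
    ((e + (Finsupp.single 0 K + Finsupp.single 1 K)) ∈
        ((∏ j, (q j + MvPolynomial.monomial (Finsupp.single 0 K + Finsupp.single 1 K) 1 * p j)) - ∏ j, q j).support ∧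
      ∀ e' ∈ ((∏ j, (q j + MvPolynomial.monomial (Finsupp.single 0 K + Finsupp.single 1 K) 1 * p j)) - ∏ j, q j).support,
        e' ≠ e + (Finsupp.single 0 K + Finsupp.single 1 K) →
        w 0 * (((e + (Finsupp.single 0 K + Finsupp.single 1 K) : Fin 2 →₀ ℕ) 0 : ℕ) : ℤ) +
            w 1 * (((e + (Finsupp.single 0 K + Finsupp.single 1 K) : Fin 2 →₀ ℕ) 1 : ℕ) : ℤ) <
          w 0 * (e' 0 : ℤ) + w 1 * (e' 1 : ℤ)) :=
  Summit.ValiantsHypothesis.ValiantsHypothesis.Theorems.TwoProducts.BlockLift.stub_blockLift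

/-- STUB 8d — PARTIAL-FRACTION BOUND (OPEN — held by the lead; the LINEAR, crux-equivalent normal form).  For `t`-sparse bivariate
polynomials `p_j, q_j` (`j < N`) the partial-fraction numerator `Σ_j p_j ∏_{i≠j} q_i` (the numerator of `Σ_j p_j/q_j`) has at most
`2^(aN)·(t+2)^b` south-west vertices (support points that are the unique minimiser of a positive integer weight).  Engine ⇐ 8d via 8a+8b
(`allDeadEngine_of_partialFraction`); crux ⇒ 8d via 8c (`partialFraction_of_crux`).  `N = 1`: `≤ t` (no cancellation); `N = 2`:
`O(t^{4/3})` (KPTT Thm 5 / EPRS, tree `theorem5_holds`; the numerator IS `p₀q₁ + p₁q₀`); uniformity in `N` is the open content. -/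
theorem stub_partialFractionBound : ∃ a b : ℕ, ∀ (N t : ℕ) (p q : Fin N → MvPolynomial (Fin 2) ℂ),
    (∀ j, (p j).support.card ≤ t) → (∀ j, (q j).support.card ≤ t) →
    {e : Fin 2 →₀ ℕ | ∃ w : Fin 2 → ℤ, 0 < w 0 ∧ 0 < w 1 ∧
      (e ∈ (∑ j, p j * ∏ i ∈ Finset.univ.erase j, q i).support ∧
        ∀ e' ∈ (∑ j, p j * ∏ i ∈ Finset.univ.erase j, q i).support, e' ≠ e →
          w 0 * (e 0 : ℤ) + w 1 * (e 1 : ℤ) < w 0 * (e' 0 : ℤ) + w 1 * (e' 1 : ℤ))}.ncard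
      ≤ 2 ^ (a * N) * (t + 2) ^ b := by
  sorry

/-! ## Rung stubs (lead c8): UNIQUE WORDS — additive uniqueness of cross-factor letter sums forces first order

Expand `∏ u_i = Σ_d (∏_i u_i[d_i]) x^{Σ_i d_i}` over WORDS `d` (one support point — possibly `0` — per factor), and likewise
`∏ v_i`; put `S_i = supp u_i ∪ supp v_i` (`0 ∈ S_i`) and `m(d) = ∏_i u_i[d_i] − ∏_i v_i[d_i]`.  If the word map `d ↦ Σ_i d_i` is
INJECTIVE on `∏_i S_i` (hypothesis UR: no additive coincidence `Σ_i d_i = Σ_i d'_i` between two different cross-factor words), then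
`coeff_e(∏u − ∏v) = m(d_e)` for the unique word of `e`, and a south-west vertex `e` (strict `w`-minimiser, `w > 0`) with word `d` using
`≥ 2` nonzero entries is impossible: each single-entry sub-word `(0,…,d_j,…,0)` gives the point `d_j`, componentwise below `e`, hence
dead, hence `u_j[d_j] = v_j[d_j]`; multiplying, `m(d) = 0` — contradiction.  So EVERY south-west vertex is a LETTER `e = d_j ∈ S_j ∖ 0`
with `u_j[e] ≠ v_j[e]`:  `V ≤ |⋃_i S_i ∖ 0| ≤ 2n(t−1)` — the first-order count (Disproof F9) ON THE NOSE.  CAUTION on the regime: UR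
forbids in particular SHARED letters between factors of different index (the singleton words `(a from factor i)` and `(a from factor j)`
collide), so it is the regime of ADDITIVELY INDEPENDENT factor pairs `(u_i, v_i)` — incomparable with c7's non-resonance and c3's
dissociation (both are hypotheses on the SET `U` of letter points and allow sharing), and with Disproof F8 (no internal cancellation);
its content is the moral "all depth comes from cross-factor additive coincidences `Σ_i d_i = Σ_i d'_i` (sharing included)" and the
radix corollary, where additive independence across scales is automatic.  COROLLARY (carry-free two-product RIGID RADIX, c6 §E /
c7 VII-G): for `u_i = φ_i(x^{M^i}, y^{M^i})`, `v_i = ψ_i(x^{M^i}, y^{M^i})` with digits `< M`, base-`M` uniqueness IS UR, so every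
vertex is `M^i·d` for a digit `d` of scale `i` with `φ_i[d] ≠ ψ_i[d]`, and since `M^j d <  M^i d` componentwise for `j < i` at most one
scale per digit: `V ≤ #digits ≤ min(2k(t−1), M²−1)` — the exponential convex chains of the digit grid (KPTT Ex. 3; c7: 2,3,6,10,16,25,39)
are NEVER the boundary of a two-product zero pattern (exp/radix2_brute.py: max V = 3 = |S∖0| over all 𝔽₂/𝔽₃-labellings, k ≤ 4). -/

/-- RUNG STUB (lead c8) — UNIQUE WORDS ⇒ VERTICES ARE LETTERS (LANDED p137509, wave 2; discharged by import).  Local instance (constant terms `1`); if two words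
`d, d' : Fin n → ℕ²` with `d i, d' i ∈ supp u_i ∪ supp v_i` and the same sum are equal (UR), then every south-west vertex `e` of
`∏u − ∏v` is a nonzero letter of some factor `i` at which the two sides disagree: `e ∈ supp u_i ∪ supp v_i`, `u_i[e] ≠ v_i[e]`.
(`Finset.prod_univ_sum` over `Fintype.piFinset`; under UR the fibre of every point is `≤ 1` word; the single-entry sub-words of the
vertex word are componentwise below it, hence outside the support, hence `u_j[d_j] = v_j[d_j]`; then the vertex coefficient
`∏ u_i[d_i] − ∏ v_i[d_i]` vanishes unless the word has exactly one nonzero entry.) -/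
theorem stub_engineUniqueWords : ∀ (n : ℕ) (u v : Fin n → MvPolynomial (Fin 2) ℂ),
    (∀ i, MvPolynomial.coeff 0 (u i) = 1) → (∀ i, MvPolynomial.coeff 0 (v i) = 1) →
    (∀ d d' : Fin n → (Fin 2 →₀ ℕ), (∀ i, d i ∈ (u i).support ∪ (v i).support) →
      (∀ i, d' i ∈ (u i).support ∪ (v i).support) → ∑ i, d i = ∑ i, d' i → d = d') →
    ∀ (w : Fin 2 → ℤ), 0 < w 0 → 0 < w 1 → ∀ (e : Fin 2 →₀ ℕ),
    (e ∈ (∏ i, u i - ∏ i, v i).support ∧ ∀ e' ∈ (∏ i, u i - ∏ i, v i).support, e' ≠ e →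
      w 0 * (e 0 : ℤ) + w 1 * (e 1 : ℤ) < w 0 * (e' 0 : ℤ) + w 1 * (e' 1 : ℤ)) →
    e ≠ 0 ∧ ∃ i, (e ∈ (u i).support ∨ e ∈ (v i).support) ∧ MvPolynomial.coeff e (u i) ≠ MvPolynomial.coeff e (v i) :=
  Summit.ValiantsHypothesis.ValiantsHypothesis.Theorems.TwoProducts.UniqueWords.stub_engineUniqueWords

/-- RUNG STUB (lead c8) — CARRY-FREE TWO-PRODUCT RIGID RADIX (LANDED p137763, wave 2; discharged by import; c6 §E in the carry-free case, answers c7 VII-G).  For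
digit polynomials `φ_i, ψ_i` (constant terms `1`, every exponent coordinate `< M`) placed at scales `M^i` by `MvPolynomial.expand`, every
south-west vertex of `∏_i φ_i(x^{M^i},y^{M^i}) − ∏_i ψ_i(x^{M^i},y^{M^i})` is `M^i • d` for one scale `i` and one nonzero digit `d` of
that scale with `φ_i[d] ≠ ψ_i[d]`.  (Base-`M` uniqueness of `Σ_i M^i d_i` with digit coordinates `< M` gives hypothesis UR of
`stub_engineUniqueWords` for `u_i = expand (M^i) (φ i)`, `v_i = expand (M^i) (ψ i)`; `supp (expand (M^i) φ) = M^i • supp φ`,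
`coeff_{M^i•d}(expand (M^i) φ) = coeff_d φ`.) -/
theorem stub_engineRadixPairCarryFree : ∀ (k M : ℕ) (φ ψ : Fin k → MvPolynomial (Fin 2) ℂ), 2 ≤ M →
    (∀ i, MvPolynomial.coeff 0 (φ i) = 1) → (∀ i, MvPolynomial.coeff 0 (ψ i) = 1) →
    (∀ i, ∀ d ∈ (φ i).support, d 0 < M ∧ d 1 < M) → (∀ i, ∀ d ∈ (ψ i).support, d 0 < M ∧ d 1 < M) →
    ∀ (w : Fin 2 → ℤ), 0 < w 0 → 0 < w 1 → ∀ (e : Fin 2 →₀ ℕ),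
    (e ∈ ((∏ i : Fin k, MvPolynomial.expand (M ^ (i : ℕ)) (φ i)) - ∏ i : Fin k, MvPolynomial.expand (M ^ (i : ℕ)) (ψ i)).support ∧
      ∀ e' ∈ ((∏ i : Fin k, MvPolynomial.expand (M ^ (i : ℕ)) (φ i)) - ∏ i : Fin k, MvPolynomial.expand (M ^ (i : ℕ)) (ψ i)).support,
        e' ≠ e → w 0 * (e 0 : ℤ) + w 1 * (e 1 : ℤ) < w 0 * (e' 0 : ℤ) + w 1 * (e' 1 : ℤ)) →
    ∃ (i : Fin k) (d : Fin 2 →₀ ℕ), d ≠ 0 ∧ (d ∈ (φ i).support ∨ d ∈ (ψ i).support) ∧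
      MvPolynomial.coeff d (φ i) ≠ MvPolynomial.coeff d (ψ i) ∧ e = (M ^ (i : ℕ)) • d :=
  Summit.ValiantsHypothesis.ValiantsHypothesis.Theorems.TwoProducts.RadixPairCarryFree.stub_engineRadixPairCarryFree

/-! ## Rung stubs (lead c9): TWO-BASE rigid radix (KPTT Example 3 verbatim) and ROW-DISSOCIATION (the valuative first-order count)

Framework IX (crux NOTES.md, lead c9): rows `P_k(x) = [y^k]∏u_i`, valuations `ν_k = ord_x P_k`; the south-west vertices of `∏u_i − 1` are the
vertices of the descending lower hull of `{(ν_k, k)}`, i.e. the Newton polygon of `∏u_i − 1 ∈ ℂ((x))[y]`.  Two rungs in that language.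
(R9a) TWO-BASE RIGID RADIX: c6's residue decomposition works for the lattice `Nℤ × Mℤ` of ANY diagonal dilation `(x,y) ↦ (x^N, y^M)`, so
`f_i = φ_i(x^{N^i}, y^{M^i})` (digit boxes `[0,qN) × [0,qM)`) has `≤ k³q²t` south-west vertices of `∏f_i − 1` — this is KPTT's Example 3
(`N = b²`, `M = b`, `q = b²`) with ARBITRARY coefficients: the digit grids that defeat every convexity argument (`t^{m/3}` convexly independent
candidates) expose only `poly(m, b)` vertices for `f_1⋯f_m + 1`.  (R9b) ROW-DISSOCIATION: if the ROW words are unique (the `y`-exponent sums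
`Σ_i j_i`, `j_i` a row of `u_i`, determine the rows), then `P_k` is ONE product of row polynomials, `ord_x` is additive, and Disproof F8 in the
`(ord, row)` plane makes every south-west vertex the LEFTMOST point of a row of one factor: `V ≤ Σ_i #rows(u_i)` with the `x`-structure of the
rows completely free (incomparable with `stub_engineUniqueWords`, which needs uniqueness of the 2-D words). -/

/-- RUNG STUB (lead c9, R9a) — TWO-BASE RIGID RADIX (LANDED p143675 + helper p142904, wave 1; discharged by import).  For `N, M ≥ 1` and digit polynomials `φ_i` (`i < k`, constant terms `1`, `≤ t` monomials,
exponents `e 0 < qN`, `e 1 < qM`), dilated by `(x, y) ↦ (x^{N^i}, y^{M^i})` (`MvPolynomial.bind₁`), the south-west vertices of `∏_i f_i − 1` number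
`≤ k³q²t`.  Proof = c6's `Radix.lean` with `expand M` replaced by the two-base dilation: residues mod `Nℤ × Mℤ` (off-lattice vertices are letters
of the finest factor; on the lattice the Mahler contraction), induction on `k`. -/
theorem stub_engineTwoBaseRadix : ∀ (k N M q t : ℕ) (φ : Fin k → MvPolynomial (Fin 2) ℂ), 1 ≤ N → 1 ≤ M →
    (∀ i, MvPolynomial.coeff 0 (φ i) = 1) → (∀ i, (φ i).support.card ≤ t) →
    (∀ i, ∀ e ∈ (φ i).support, e 0 < q * N ∧ e 1 < q * M) →
    {e : Fin 2 →₀ ℕ | ∃ w : Fin 2 → ℤ, 0 < w 0 ∧ 0 < w 1 ∧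
        e ∈ ((∏ i : Fin k, MvPolynomial.bind₁ (fun j : Fin 2 => (MvPolynomial.X j : MvPolynomial (Fin 2) ℂ) ^
              (if j = 0 then N ^ (i : ℕ) else M ^ (i : ℕ))) (φ i)) - 1).support ∧
        ∀ e' ∈ ((∏ i : Fin k, MvPolynomial.bind₁ (fun j : Fin 2 => (MvPolynomial.X j : MvPolynomial (Fin 2) ℂ) ^
              (if j = 0 then N ^ (i : ℕ) else M ^ (i : ℕ))) (φ i)) - 1).support, e' ≠ e →
          w 0 * (e 0 : ℤ) + w 1 * (e 1 : ℤ) < w 0 * (e' 0 : ℤ) + w 1 * (e' 1 : ℤ)}.ncard ≤ k ^ 3 * q ^ 2 * t :=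
  Summit.ValiantsHypothesis.ValiantsHypothesis.Theorems.TwoProducts.TwoBaseRadix.stub_engineTwoBaseRadix

/-- RUNG STUB (lead c9, R9b) — ROW-DISSOCIATION ⇒ VERTICES ARE ROW-LEADERS (LANDED p144464, wave 1; discharged by import).  Local one-product instance (constant terms `1`); if two row words
`d, d' : Fin n → ℕ` with `d i, d' i` rows of `u_i` (`y`-exponents of support points) and `Σ d = Σ d'` are equal, then every south-west vertex `e`
of `∏u − 1` off the `x`-axis lies in the support of some factor `u_i` and is the leftmost point of its row there (on the `x`-axis there is at
most the one vertex `(ord_x(∏_i u_i(x,0) − 1), 0)`, which can be deep: `(1−x)(1+x)(1+x²) − 1 = −x⁴`). -/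
theorem stub_engineRowDissociated : ∀ (n : ℕ) (u : Fin n → MvPolynomial (Fin 2) ℂ),
    (∀ i, MvPolynomial.coeff 0 (u i) = 1) →
    (∀ d d' : Fin n → ℕ, (∀ i, d i ∈ (u i).support.image (fun a : Fin 2 →₀ ℕ => a 1)) →
      (∀ i, d' i ∈ (u i).support.image (fun a : Fin 2 →₀ ℕ => a 1)) → ∑ i, d i = ∑ i, d' i → d = d') →
    ∀ (w : Fin 2 → ℤ), 0 < w 0 → 0 < w 1 → ∀ (e : Fin 2 →₀ ℕ),
    (e ∈ (∏ i, u i - 1).support ∧ ∀ e' ∈ (∏ i, u i - 1).support, e' ≠ e →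
      w 0 * (e 0 : ℤ) + w 1 * (e 1 : ℤ) < w 0 * (e' 0 : ℤ) + w 1 * (e' 1 : ℤ)) →
    e ≠ 0 ∧ (e 1 = 0 ∨ ∃ i, e ∈ (u i).support ∧ ∀ a ∈ (u i).support, a 1 = e 1 → e 0 ≤ a 0) :=
  Summit.ValiantsHypothesis.ValiantsHypothesis.Theorems.TwoProducts.RowDissociated.stub_engineRowDissociated

/-! ## Landed around this skeleton (all `--supports stmt-ValiantsHypothesis-5906`, kernel-accepted)
* stubs 1–6: `Theorems/NewtonUnitEquationsTwoProducts{Exposure,Sweep,SectorCover,ConeChart,PowerSumCriterion,RaySeries}.lean`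
  (p78572, p78965, p81938, p78732, p79909, p80017);
* engine RUNGS (special cases of stub 7, n-uniform): `…CommonCone.lean` (p85008: common independent 2-cone ⇒ ≤ 2n, rank
  obstruction), `…Homogeneous.lean` (p86150: graded-homogeneous tails ⇒ ≤ 2n) and `…SignTame.lean` (p87994: `u₀·∏(1−p_i) − 1` with
  positive-real tails `p_i` ⇒ ≤ (n+1)(t+1)² — KPTT §5's `f₁⋯f_m + 1` in the sign-tame regime);
* `…Reduction.lean` (p85082): def-free `vertBound`, `twoProducts_of_logSumNewton` (= this composition) and the UNCONDITIONAL
  binomial case `twoProducts_sparsity_le_two` (t ≤ 2, any m, all regimes ⇒ ≤ 72(m+1)²; contains route item `BinomialPencil`);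
* `…Equivalence.lean` (p85305): `logSumNewton_of_twoProducts` — the crux implies stub 7 with the same constants, so STUB 7 IS
  CRUX-EQUIVALENT (`engine_of_crux` below re-derives it inside this file's vocabulary);
* later rungs: `…DepthOne.lean` (p99106, + `stub_engineDepthK`), `…Localisation.lean` (p101962 = stub 7a),
  `…CancellationFree.lean` (p106835), and (lead c2) `…RayFactors.lean` (p110367: every factor supported on a ray through
  the origin — univariate in one monomial, any sparsity and degrees, rays may differ between factors — ⇒ `≤ 2n`; the
  `t`-free backbone of the binomial rung). -/

/-- The crux implies the engine (landed `Equivalence.logSumNewton_of_twoProducts`): stub 7 is not a strengthening. -/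
theorem engine_of_crux :
    Summit.ValiantsHypothesis.ValiantsHypothesis.Theses.NewtonUnitEquations.TwoProducts →
    ∃ a b : ℕ, ∀ (n t : ℕ) (u v : Fin n → MvPolynomial (Fin 2) ℂ), 3 ≤ t →
    (∀ i, (u i).support.card ≤ t) → (∀ i, (v i).support.card ≤ t) →
    (∀ i, MvPolynomial.coeff 0 (u i) = 1) → (∀ i, MvPolynomial.coeff 0 (v i) = 1) →
    (logVertSet u v).ncard ≤ 2 ^ (a * n) * (t + 2) ^ b :=
  Summit.ValiantsHypothesis.ValiantsHypothesis.Theorems.TwoProducts.Equivalence.logSumNewton_of_twoProducts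

/-! ## The stub statements as named `Prop`s (definitionally the registered statements, in the line's vocabulary) -/

namespace Stmt

/-- Statement of stub 1. -/
def stub_exposure : Prop := ∀ (S : Finset Expo) (p : Fin 2 → ℝ),
    p ∈ Set.extremePoints ℝ (convexHull ℝ (emb '' (S : Set Expo))) →
    ∃ e : Expo, emb e = p ∧ ∃ w : Fin 2 → ℤ, IsStrictMin w S e

/-- Statement of stub 2. -/
def stub_sweep : Prop := ∀ (D : Finset (Fin 2 → ℤ)),
    ∃ Sec : Finset ((Fin 2 → ℤ) × (Fin 2 → ℤ)), Sec.card ≤ 4 * D.card + 4 ∧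
      ∀ w : Fin 2 → ℤ, w 0 ≠ 0 → w 1 ≠ 0 → (∀ d ∈ D, w 0 * d 0 + w 1 * d 1 ≠ 0) →
        ∃ rr ∈ Sec, rr.1 0 * rr.2 1 ≠ rr.1 1 * rr.2 0 ∧
          ∃ a b K : ℤ, 0 < a ∧ 0 < b ∧ 0 < K ∧ K • w = a • rr.1 + b • rr.2 ∧
            ∀ d ∈ D, 0 < w 0 * d 0 + w 1 * d 1 →
              0 ≤ rr.1 0 * d 0 + rr.1 1 * d 1 ∧ 0 ≤ rr.2 0 * d 0 + rr.2 1 * d 1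

/-- The sweep property of a sector family relative to the factors `(f, g)` (hypothesis of stub 3). -/
def SweepFor (f g : Fin m → MvPolynomial (Fin 2) ℂ) (Sec : Finset ((Fin 2 → ℤ) × (Fin 2 → ℤ))) : Prop :=
  ∀ w : Fin 2 → ℤ, w 0 ≠ 0 → w 1 ≠ 0 →
    (∀ j, ∀ p ∈ (f j).support, ∀ q ∈ (f j).support, p ≠ q → wt w p ≠ wt w q) →
    (∀ j, ∀ p ∈ (g j).support, ∀ q ∈ (g j).support, p ≠ q → wt w p ≠ wt w q) →
    ∃ rr ∈ Sec, rr.1 0 * rr.2 1 ≠ rr.1 1 * rr.2 0 ∧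
      ∃ a b K : ℤ, 0 < a ∧ 0 < b ∧ 0 < K ∧ K • w = a • rr.1 + b • rr.2 ∧
        (∀ j, ∀ p ∈ (f j).support, ∀ q ∈ (f j).support, wt w p < wt w q →
          wt rr.1 p ≤ wt rr.1 q ∧ wt rr.2 p ≤ wt rr.2 q) ∧
        (∀ j, ∀ p ∈ (g j).support, ∀ q ∈ (g j).support, wt w p < wt w q →
          wt rr.1 p ≤ wt rr.1 q ∧ wt rr.2 p ≤ wt rr.2 q)

/-- Statement of stub 3. -/
def stub_sectorCover : Prop := ∀ (m t : ℕ) (f g : Fin m → MvPolynomial (Fin 2) ℂ),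
    (∀ j, (f j).support.card ≤ t) → (∀ j, (g j).support.card ≤ t) → (∀ j, f j ≠ 0) → (∀ j, g j ≠ 0) →
    ∀ (Sec : Finset ((Fin 2 → ℤ) × (Fin 2 → ℤ))), SweepFor f g Sec →
    ∀ B : ℕ, (∀ (μ ν : Fin m → Expo) (r₁ r₂ : Fin 2 → ℤ), Adapted f g μ ν r₁ r₂ →
      (sectSet f g μ ν r₁ r₂).ncard ≤ B) →
    (vertSet (∏ j, f j - ∏ j, g j)).ncard ≤ Sec.card * B

/-- Statement of stub 4. -/
def stub_coneChart : Prop := ∀ (m t : ℕ) (f g : Fin m → MvPolynomial (Fin 2) ℂ),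
    (∀ j, (f j).support.card ≤ t) → (∀ j, (g j).support.card ≤ t) →
    ∀ (μ ν : Fin m → Expo) (r₁ r₂ : Fin 2 → ℤ), Adapted f g μ ν r₁ r₂ → (sectSet f g μ ν r₁ r₂).Nonempty →
    ∃ u v : Fin m → MvPolynomial (Fin 2) ℂ,
      (∀ i, (u i).support.card ≤ t) ∧ (∀ i, (v i).support.card ≤ t) ∧
      (∀ i, MvPolynomial.coeff 0 (u i) = 1) ∧ (∀ i, MvPolynomial.coeff 0 (v i) = 1) ∧
      (sectSet f g μ ν r₁ r₂).ncard ≤ (swVertSet (∏ i, u i - ∏ i, v i)).ncard + 2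

/-- Statement of stub 5. -/
def stub_powerSumCriterion : Prop := ∀ (n : ℕ) (u v : Fin n → MvPolynomial (Fin 2) ℂ),
    (∀ i, MvPolynomial.coeff 0 (u i) = 1) → (∀ i, MvPolynomial.coeff 0 (v i) = 1) →
    ∀ (w : Fin 2 → ℤ), 0 < w 0 → 0 < w 1 →
    ∀ (e : Expo) (R : ℕ), wt w e < (R : ℤ) →
      (IsStrictMin w (∏ i, u i - ∏ i, v i).support e ↔ IsStrictMin w (logPowerSum R u v).support e)

/-- Statement of stub 6. -/
def stub_raySeries : Prop := ∀ (n : ℕ) (u v : Fin n → MvPolynomial (Fin 2) ℂ),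
    (∀ i, (u i).support.card ≤ 2) → (∀ i, (v i).support.card ≤ 2) →
    (∀ i, MvPolynomial.coeff 0 (u i) = 1) → (∀ i, MvPolynomial.coeff 0 (v i) = 1) →
    (logVertSet u v).ncard ≤ 2 * n

/-- Truncation of a factor to its DEAD letters: delete every monomial lying in `S` (for `S = supp D` the constant
term survives since `0 ∉ supp D`). -/
def trunc (S : Finset Expo) (f : MvPolynomial (Fin 2) ℂ) : MvPolynomial (Fin 2) ℂ :=
  ∑ a ∈ f.support with a ∉ S, MvPolynomial.monomial a (MvPolynomial.coeff a f)

/-- The dead-letter instance `D‡ = ∏ u‡ − ∏ v‡` of `(u, v)`. -/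
def deadDiff {n : ℕ} (u v : Fin n → MvPolynomial (Fin 2) ℂ) : MvPolynomial (Fin 2) ℂ :=
  ∏ i, trunc (∏ j, u j - ∏ j, v j).support (u i) - ∏ i, trunc (∏ j, u j - ∏ j, v j).support (v i)

/-- All-dead instance: no monomial of any factor survives in `∏ u − ∏ v`. -/
def AllDead {n : ℕ} (u v : Fin n → MvPolynomial (Fin 2) ℂ) : Prop :=
  (∀ i, ∀ e ∈ (u i).support, e ∉ (∏ j, u j - ∏ j, v j).support) ∧
    (∀ i, ∀ e ∈ (v i).support, e ∉ (∏ j, u j - ∏ j, v j).support)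

/-- Statement of stub 7a (localisation to the dead letters). -/
def stub_localisation : Prop := ∀ (n : ℕ) (u v : Fin n → MvPolynomial (Fin 2) ℂ),
    (∀ i, MvPolynomial.coeff 0 (u i) = 1) → (∀ i, MvPolynomial.coeff 0 (v i) = 1) →
    ∀ (w : Fin 2 → ℤ), 0 < w 0 → 0 < w 1 → ∀ (e : Expo),
    IsStrictMin w (∏ i, u i - ∏ i, v i).support e →
    (∃ i, e ∈ (u i).support ∨ e ∈ (v i).support) ∨ IsStrictMin w (deadDiff u v).support e

/-- Statement of stub 7b (the all-dead engine; the two all-dead hypotheses are `AllDead u v` uncurried). -/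
def stub_allDeadEngine : Prop := ∃ a b : ℕ, ∀ (n t : ℕ) (u v : Fin n → MvPolynomial (Fin 2) ℂ),
    (∀ i, (u i).support.card ≤ t) → (∀ i, (v i).support.card ≤ t) →
    (∀ i, MvPolynomial.coeff 0 (u i) = 1) → (∀ i, MvPolynomial.coeff 0 (v i) = 1) →
    (∀ i, ∀ e ∈ (u i).support, e ∉ (∏ j, u j - ∏ j, v j).support) →
    (∀ i, ∀ e ∈ (v i).support, e ∉ (∏ j, u j - ∏ j, v j).support) →
    (swVertSet (∏ i, u i - ∏ i, v i)).ncard ≤ 2 ^ (a * n) * (t + 2) ^ b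

/-- Statement of the engine (old stub 7, now DERIVED from 7a + 7b + the landed power-sum criterion). -/
def stub_logSumNewton : Prop := ∃ a b : ℕ, ∀ (n t : ℕ) (u v : Fin n → MvPolynomial (Fin 2) ℂ), 3 ≤ t →
    (∀ i, (u i).support.card ≤ t) → (∀ i, (v i).support.card ≤ t) →
    (∀ i, MvPolynomial.coeff 0 (u i) = 1) → (∀ i, MvPolynomial.coeff 0 (v i) = 1) →
    (logVertSet u v).ncard ≤ 2 ^ (a * n) * (t + 2) ^ b

/-- Statement of stub 7c (record reduction). -/
def stub_recordReduction : Prop := ∀ (n : ℕ) (u v : Fin n → MvPolynomial (Fin 2) ℂ),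
    (∀ i, MvPolynomial.coeff 0 (u i) = 1) → (∀ i, MvPolynomial.coeff 0 (v i) = 1) →
    ∀ (w : Fin 2 → ℤ), 0 < w 0 → 0 < w 1 → ∀ (e : Fin 2 →₀ ℕ),
    (∀ R : ℕ, wt w e < (R : ℤ) → IsStrictMin w (logPowerSum R u v).support e) →
    (fun i : Fin (n + n) => MvPolynomial.coeff e
          (∑ r ∈ Finset.Icc 1 ((w 0 * (e 0 : ℤ) + w 1 * (e 1 : ℤ)).toNat + 1),
            ((-1 : ℂ) ^ (r + 1) / (r : ℂ)) • (Fin.append u v i - 1) ^ r)) ∉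
        Submodule.span ℂ ((fun q : Fin 2 →₀ ℕ => fun i : Fin (n + n) => MvPolynomial.coeff q
          (∑ r ∈ Finset.Icc 1 ((w 0 * (e 0 : ℤ) + w 1 * (e 1 : ℤ)).toNat + 1),
            ((-1 : ℂ) ^ (r + 1) / (r : ℂ)) • (Fin.append u v i - 1) ^ r)) ''
          {q : Fin 2 →₀ ℕ | w 0 * (q 0 : ℤ) + w 1 * (q 1 : ℤ) < w 0 * (e 0 : ℤ) + w 1 * (e 1 : ℤ)})

/-- Statement of stub 7d (row-record bound, the λ-free engine). -/
def stub_rowRecordBound : Prop := ∃ a b : ℕ, ∀ (N t : ℕ) (f : Fin N → MvPolynomial (Fin 2) ℂ),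
    (∀ i, (f i).support.card ≤ t) → (∀ i, MvPolynomial.coeff 0 (f i) = 1) →
    {p : Fin 2 →₀ ℕ | ∃ w : Fin 2 → ℤ, 0 < w 0 ∧ 0 < w 1 ∧
      (fun i : Fin (N) => MvPolynomial.coeff p
          (∑ r ∈ Finset.Icc 1 ((w 0 * (p 0 : ℤ) + w 1 * (p 1 : ℤ)).toNat + 1),
            ((-1 : ℂ) ^ (r + 1) / (r : ℂ)) • (f i - 1) ^ r)) ∉
        Submodule.span ℂ ((fun q : Fin 2 →₀ ℕ => fun i : Fin (N) => MvPolynomial.coeff q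
          (∑ r ∈ Finset.Icc 1 ((w 0 * (p 0 : ℤ) + w 1 * (p 1 : ℤ)).toNat + 1),
            ((-1 : ℂ) ^ (r + 1) / (r : ℂ)) • (f i - 1) ^ r)) ''
          {q : Fin 2 →₀ ℕ | w 0 * (q 0 : ℤ) + w 1 * (q 1 : ℤ) < w 0 * (p 0 : ℤ) + w 1 * (p 1 : ℤ)})}.Finite ∧
    {p : Fin 2 →₀ ℕ | ∃ w : Fin 2 → ℤ, 0 < w 0 ∧ 0 < w 1 ∧
      (fun i : Fin (N) => MvPolynomial.coeff p
          (∑ r ∈ Finset.Icc 1 ((w 0 * (p 0 : ℤ) + w 1 * (p 1 : ℤ)).toNat + 1),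
            ((-1 : ℂ) ^ (r + 1) / (r : ℂ)) • (f i - 1) ^ r)) ∉
        Submodule.span ℂ ((fun q : Fin 2 →₀ ℕ => fun i : Fin (N) => MvPolynomial.coeff q
          (∑ r ∈ Finset.Icc 1 ((w 0 * (p 0 : ℤ) + w 1 * (p 1 : ℤ)).toNat + 1),
            ((-1 : ℂ) ^ (r + 1) / (r : ℂ)) • (f i - 1) ^ r)) ''
          {q : Fin 2 →₀ ℕ | w 0 * (q 0 : ℤ) + w 1 * (q 1 : ℤ) < w 0 * (p 0 : ℤ) + w 1 * (p 1 : ℤ)})}.ncard ≤ 2 ^ (a * N) * (t + 2) ^ b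

/-- The unit-product power series `G = (∏ u_i)·(∏ v_j)⁻¹` of the peel–shallow normal form. -/
def quotSeries {k m : ℕ} (u : Fin k → MvPolynomial (Fin 2) ℂ) (v : Fin m → MvPolynomial (Fin 2) ℂ) :
    MvPowerSeries (Fin 2) ℂ :=
  (∏ i, ((u i : MvPolynomial (Fin 2) ℂ) : MvPowerSeries (Fin 2) ℂ)) *
    (∏ j, ((v j : MvPolynomial (Fin 2) ℂ) : MvPowerSeries (Fin 2) ℂ))⁻¹

/-- `t`-shallow support points of a power series: support points `e` with a positive weight for which at most `t − 1` OTHER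
nonzero support points are lighter than or as light as `e`. -/
def shallowSet (G : MvPowerSeries (Fin 2) ℂ) (t : ℕ) : Set Expo :=
  {e | MvPowerSeries.coeff e G ≠ 0 ∧ ∃ w : Fin 2 → ℤ, 0 < w 0 ∧ 0 < w 1 ∧
    {q : Expo | q ≠ 0 ∧ q ≠ e ∧ MvPowerSeries.coeff q G ≠ 0 ∧ wt w q ≤ wt w e}.ncard ≤ t - 1}

/-- Statement of stub 7e (peel–shallow reduction). -/
def stub_peelShallow : Prop := ∀ (k m : ℕ) (u : Fin k → MvPolynomial (Fin 2) ℂ) (v : Fin m → MvPolynomial (Fin 2) ℂ)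
    (p : MvPolynomial (Fin 2) ℂ), (∀ j, MvPolynomial.coeff 0 (v j) = 1) →
    ∀ (w : Fin 2 → ℤ), 0 < w 0 → 0 < w 1 → ∀ (e : Expo),
    IsStrictMin w ((∏ i, u i) - p * ∏ j, v j).support e →
    e ∈ p.support ∨ (MvPowerSeries.coeff e (quotSeries u v) ≠ 0 ∧
      ∀ q : Expo, q ≠ 0 → q ≠ e → MvPowerSeries.coeff q (quotSeries u v) ≠ 0 → wt w q ≤ wt w e → q ∈ p.support)

/-- Statement of stub 7f (shallow bound, OPEN). -/
def stub_shallowBound : Prop := ∃ a b : ℕ, ∀ (k m t : ℕ) (u : Fin k → MvPolynomial (Fin 2) ℂ)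
    (v : Fin m → MvPolynomial (Fin 2) ℂ),
    (∀ i, (u i).support.card ≤ t) → (∀ j, (v j).support.card ≤ t) →
    (∀ i, MvPolynomial.coeff 0 (u i) = 1) → (∀ j, MvPolynomial.coeff 0 (v j) = 1) →
    (shallowSet (quotSeries u v) t).Finite ∧ (shallowSet (quotSeries u v) t).ncard ≤ 2 ^ (a * (k + m)) * (t + 2) ^ b

/-- `L`-PINNED support points of a power series: support points `e` with a positive weight for which every OTHER nonzero support point
lighter than or as light as `e` lies in the fixed finite set `L`. -/
def pinnedSet (G : MvPowerSeries (Fin 2) ℂ) (L : Finset Expo) : Set Expo :=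
  {e | MvPowerSeries.coeff e G ≠ 0 ∧ ∃ w : Fin 2 → ℤ, 0 < w 0 ∧ 0 < w 1 ∧
    ∀ q : Expo, q ≠ 0 → q ≠ e → MvPowerSeries.coeff q G ≠ 0 → wt w q ≤ wt w e → q ∈ L}

/-- Statement of stub 7g (pinned shallow bound, OPEN; engine-equivalent). -/
def stub_pinnedShallowBound : Prop := ∃ a b : ℕ, ∀ (k m t : ℕ) (u : Fin k → MvPolynomial (Fin 2) ℂ)
    (v : Fin m → MvPolynomial (Fin 2) ℂ) (L : Finset Expo),
    (∀ i, (u i).support.card ≤ t) → (∀ j, (v j).support.card ≤ t) →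
    (∀ i, MvPolynomial.coeff 0 (u i) = 1) → (∀ j, MvPolynomial.coeff 0 (v j) = 1) → L.card ≤ t - 1 →
    (pinnedSet (quotSeries u v) L).Finite ∧ (pinnedSet (quotSeries u v) L).ncard ≤ 2 ^ (a * (k + m)) * (t + 2) ^ b

/-- Hypothesis UR of the unique-words rung: cross-factor words with equal sums are equal. -/
def UniqueWords {n : ℕ} (u v : Fin n → MvPolynomial (Fin 2) ℂ) : Prop :=
  ∀ d d' : Fin n → Expo, (∀ i, d i ∈ (u i).support ∪ (v i).support) →
    (∀ i, d' i ∈ (u i).support ∪ (v i).support) → ∑ i, d i = ∑ i, d' i → d = d'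

/-- Statement of the unique-words rung. -/
def stub_engineUniqueWords : Prop := ∀ (n : ℕ) (u v : Fin n → MvPolynomial (Fin 2) ℂ),
    (∀ i, MvPolynomial.coeff 0 (u i) = 1) → (∀ i, MvPolynomial.coeff 0 (v i) = 1) → UniqueWords u v →
    ∀ (w : Fin 2 → ℤ), 0 < w 0 → 0 < w 1 → ∀ (e : Expo), IsStrictMin w (∏ i, u i - ∏ i, v i).support e →
    e ≠ 0 ∧ ∃ i, (e ∈ (u i).support ∨ e ∈ (v i).support) ∧ MvPolynomial.coeff e (u i) ≠ MvPolynomial.coeff e (v i)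

/-- Statement of the carry-free two-product rigid radix rung. -/
def stub_engineRadixPairCarryFree : Prop := ∀ (k M : ℕ) (φ ψ : Fin k → MvPolynomial (Fin 2) ℂ), 2 ≤ M →
    (∀ i, MvPolynomial.coeff 0 (φ i) = 1) → (∀ i, MvPolynomial.coeff 0 (ψ i) = 1) →
    (∀ i, ∀ d ∈ (φ i).support, d 0 < M ∧ d 1 < M) → (∀ i, ∀ d ∈ (ψ i).support, d 0 < M ∧ d 1 < M) →
    ∀ (w : Fin 2 → ℤ), 0 < w 0 → 0 < w 1 → ∀ (e : Expo),
    IsStrictMin w ((∏ i : Fin k, MvPolynomial.expand (M ^ (i : ℕ)) (φ i)) -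
        ∏ i : Fin k, MvPolynomial.expand (M ^ (i : ℕ)) (ψ i)).support e →
    ∃ (i : Fin k) (d : Expo), d ≠ 0 ∧ (d ∈ (φ i).support ∨ d ∈ (ψ i).support) ∧
      MvPolynomial.coeff d (φ i) ≠ MvPolynomial.coeff d (ψ i) ∧ e = (M ^ (i : ℕ)) • d

/-- Statement of the no-sharing one-product rung. -/
def stub_engineNoSharing : Prop := ∀ (n : ℕ) (u : Fin n → MvPolynomial (Fin 2) ℂ),
    (∀ i, MvPolynomial.coeff 0 (u i) = 1) →
    (∀ i j, i ≠ j → ∀ a ∈ (u i).support, a ∈ (u j).support → a = 0) →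
    ∀ (w : Fin 2 → ℤ), 0 < w 0 → 0 < w 1 → ∀ (e : Expo), IsStrictMin w (∏ i, u i - 1).support e →
    e ≠ 0 ∧ ∃ i, e ∈ (u i).support ∧ ∀ j, ∀ a ∈ (u j).support, a ≠ 0 → wt w e ≤ wt w a

/-- Statement of the two-base rigid radix rung (lead c9). -/
def stub_engineTwoBaseRadix : Prop := ∀ (k N M q t : ℕ) (φ : Fin k → MvPolynomial (Fin 2) ℂ), 1 ≤ N → 1 ≤ M →
    (∀ i, MvPolynomial.coeff 0 (φ i) = 1) → (∀ i, (φ i).support.card ≤ t) →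
    (∀ i, ∀ e ∈ (φ i).support, e 0 < q * N ∧ e 1 < q * M) →
    (swVertSet ((∏ i : Fin k, MvPolynomial.bind₁ (fun j : Fin 2 => (MvPolynomial.X j : MvPolynomial (Fin 2) ℂ) ^
        (if j = 0 then N ^ (i : ℕ) else M ^ (i : ℕ))) (φ i)) - 1)).ncard ≤ k ^ 3 * q ^ 2 * t

/-- Statement of the row-dissociation rung (lead c9). -/
def stub_engineRowDissociated : Prop := ∀ (n : ℕ) (u : Fin n → MvPolynomial (Fin 2) ℂ),
    (∀ i, MvPolynomial.coeff 0 (u i) = 1) →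
    (∀ d d' : Fin n → ℕ, (∀ i, d i ∈ (u i).support.image (fun a : Expo => a 1)) →
      (∀ i, d' i ∈ (u i).support.image (fun a : Expo => a 1)) → ∑ i, d i = ∑ i, d' i → d = d') →
    ∀ (w : Fin 2 → ℤ), 0 < w 0 → 0 < w 1 → ∀ (e : Expo), IsStrictMin w (∏ i, u i - 1).support e →
    e ≠ 0 ∧ (e 1 = 0 ∨ ∃ i, e ∈ (u i).support ∧ ∀ a ∈ (u i).support, a 1 = e 1 → e 0 ≤ a 0)

/-- Statement of stub 8a (Euler transfer). -/
def stub_eulerTransfer : Prop := ∀ (P Q : MvPolynomial (Fin 2) ℂ),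
    MvPolynomial.coeff 0 P = MvPolynomial.coeff 0 Q → MvPolynomial.coeff 0 Q ≠ 0 →
    ∀ (w : Fin 2 → ℤ), 0 < w 0 → 0 < w 1 → ∀ (e : Expo),
    (IsStrictMin w (P - Q).support e ↔ IsStrictMin w (euler P * Q - P * euler Q).support e)

/-- Statement of stub 8b (Euler–Leibniz in partial-fraction form). -/
def stub_eulerLeibnizAppend : Prop := ∀ (n : ℕ) (u v : Fin n → MvPolynomial (Fin 2) ℂ),
    euler (∏ k, u k) * (∏ k, v k) - (∏ k, u k) * euler (∏ k, v k) =
      pfNum (Fin.append (fun k => euler (u k)) (fun k => -euler (v k))) (Fin.append u v)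

/-- The block monomial exponent `(K, K)`. -/
def blockExp (K : ℕ) : Expo := Finsupp.single 0 K + Finsupp.single 1 K

/-- Statement of stub 8c (block lift). -/
def stub_blockLift : Prop := ∀ (N d K : ℕ) (p q : Fin N → MvPolynomial (Fin 2) ℂ),
    (∀ j, (p j).totalDegree ≤ d) → (∀ j, (q j).totalDegree ≤ d) → N * d < K →
    ∀ (w : Fin 2 → ℤ), 0 < w 0 → 0 < w 1 → ∀ (e : Expo),
    IsStrictMin w (pfNum p q).support e →
    IsStrictMin w ((∏ j, (q j + MvPolynomial.monomial (blockExp K) 1 * p j)) - ∏ j, q j).support (e + blockExp K)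

/-- Statement of stub 8d (partial-fraction bound, OPEN; crux-equivalent). -/
def stub_partialFractionBound : Prop := ∃ a b : ℕ, ∀ (N t : ℕ) (p q : Fin N → MvPolynomial (Fin 2) ℂ),
    (∀ j, (p j).support.card ≤ t) → (∀ j, (q j).support.card ≤ t) →
    (swVertSet (pfNum p q)).ncard ≤ 2 ^ (a * N) * (t + 2) ^ b

end Stmt

/-! ### The registered stubs prove the named statements (definitional unfolding only) -/

theorem holds_stub_exposure : Stmt.stub_exposure := stub_exposure
theorem holds_stub_sweep : Stmt.stub_sweep := stub_sweep
theorem holds_stub_sectorCover : Stmt.stub_sectorCover := stub_sectorCover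
theorem holds_stub_coneChart : Stmt.stub_coneChart := stub_coneChart
theorem holds_stub_powerSumCriterion : Stmt.stub_powerSumCriterion := stub_powerSumCriterion
theorem holds_stub_raySeries : Stmt.stub_raySeries := stub_raySeries
theorem holds_stub_localisation : Stmt.stub_localisation := stub_localisation
theorem holds_stub_recordReduction : Stmt.stub_recordReduction := stub_recordReduction
theorem holds_stub_peelShallow : Stmt.stub_peelShallow := stub_peelShallow
theorem holds_stub_engineNoSharing : Stmt.stub_engineNoSharing := stub_engineNoSharing
theorem holds_stub_engineUniqueWords : Stmt.stub_engineUniqueWords := stub_engineUniqueWords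
theorem holds_stub_engineRadixPairCarryFree : Stmt.stub_engineRadixPairCarryFree := stub_engineRadixPairCarryFree
theorem holds_stub_engineTwoBaseRadix : Stmt.stub_engineTwoBaseRadix := stub_engineTwoBaseRadix
theorem holds_stub_engineRowDissociated : Stmt.stub_engineRowDissociated := stub_engineRowDissociated
theorem holds_stub_eulerTransfer : Stmt.stub_eulerTransfer := stub_eulerTransfer
theorem holds_stub_eulerLeibnizAppend : Stmt.stub_eulerLeibnizAppend := stub_eulerLeibnizAppend
theorem holds_stub_blockLift : Stmt.stub_blockLift := stub_blockLift
theorem holds_stub_partialFractionBound : Stmt.stub_partialFractionBound := stub_partialFractionBound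

/-! ## Proved glue -/

/-- `2 n ≤ 2^n`. -/
theorem two_mul_le_two_pow (n : ℕ) : 2 * n ≤ 2 ^ n := by
  induction n with
  | zero => simp
  | succ k ih =>
    rcases Nat.eq_zero_or_pos k with hk | hk
    · subst hk; simp
    · have h1 : 2 ≤ 2 ^ k := by
        calc 2 = 2 * 1 := by ring
          _ ≤ 2 * k := Nat.mul_le_mul_left 2 hk
          _ ≤ 2 ^ k := ih
      calc 2 * (k + 1) = 2 * k + 2 := by ring
        _ ≤ 2 ^ k + 2 ^ k := Nat.add_le_add ih h1
        _ = 2 ^ (k + 1) := by ring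

/-- Monotonicity of the bound shape in the constant `a`. -/
theorem shape_mono (a a' b n t : ℕ) (h : a ≤ a') :
    2 ^ (a * n) * (t + 2) ^ b ≤ 2 ^ (a' * n) * (t + 2) ^ b :=
  Nat.mul_le_mul_right _ (Nat.pow_le_pow_right (by norm_num) (Nat.mul_le_mul_right n h))

/-- From the power-sum criterion: the south-west vertices of a local instance ARE the stable log vertices. -/
theorem swVertSet_eq_logVertSet (hPS : Stmt.stub_powerSumCriterion) {n : ℕ}
    (u v : Fin n → MvPolynomial (Fin 2) ℂ)
    (hu : ∀ i, MvPolynomial.coeff 0 (u i) = 1) (hv : ∀ i, MvPolynomial.coeff 0 (v i) = 1) :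
    swVertSet (∏ i, u i - ∏ i, v i) = logVertSet u v := by
  ext e
  constructor
  · rintro ⟨w, hw0, hw1, h⟩
    exact ⟨w, hw0, hw1, fun R hR => (hPS n u v hu hv w hw0 hw1 e R hR).1 h⟩
  · rintro ⟨w, hw0, hw1, h⟩
    refine ⟨w, hw0, hw1, ?_⟩
    have hR : wt w e < ((wt w e).toNat + 1 : ℕ) := by
      have := Int.self_le_toNat (wt w e)
      push_cast
      omega
    exact (hPS n u v hu hv w hw0 hw1 e _ hR).2 (h _ hR)

/-- LOCAL BOUND from stubs 5–7: every local instance satisfies the south-west bound with constants `(a+1, b)`. -/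
theorem local_bound (hPS : Stmt.stub_powerSumCriterion) (hRay : Stmt.stub_raySeries) {a b : ℕ}
    (hLog : ∀ (n t : ℕ) (u v : Fin n → MvPolynomial (Fin 2) ℂ), 3 ≤ t →
      (∀ i, (u i).support.card ≤ t) → (∀ i, (v i).support.card ≤ t) →
      (∀ i, MvPolynomial.coeff 0 (u i) = 1) → (∀ i, MvPolynomial.coeff 0 (v i) = 1) →
      (logVertSet u v).ncard ≤ 2 ^ (a * n) * (t + 2) ^ b) :
    ∀ (n t : ℕ) (u v : Fin n → MvPolynomial (Fin 2) ℂ),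
      (∀ i, (u i).support.card ≤ t) → (∀ i, (v i).support.card ≤ t) →
      (∀ i, MvPolynomial.coeff 0 (u i) = 1) → (∀ i, MvPolynomial.coeff 0 (v i) = 1) →
      (swVertSet (∏ i, u i - ∏ i, v i)).ncard ≤ 2 ^ ((a + 1) * n) * (t + 2) ^ b := by
  intro n t u v hut hvt hu hv
  rw [swVertSet_eq_logVertSet hPS u v hu hv]
  by_cases ht : t ≤ 2
  · have h := hRay n u v (fun i => (hut i).trans ht) (fun i => (hvt i).trans ht) hu hv
    calc (logVertSet u v).ncard ≤ 2 * n := h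
      _ ≤ 2 ^ n := two_mul_le_two_pow n
      _ = 2 ^ (1 * n) * (t + 2) ^ 0 := by ring
      _ ≤ 2 ^ ((a + 1) * n) * (t + 2) ^ 0 := shape_mono 1 (a + 1) 0 n t (by omega)
      _ ≤ 2 ^ ((a + 1) * n) * (t + 2) ^ b :=
          Nat.mul_le_mul_left _ (Nat.pow_le_pow_right (by omega) (Nat.zero_le b))
  · have h := hLog n t u v (by omega) hut hvt hu hv
    exact h.trans (shape_mono a (a + 1) b n t (by omega))

/-- PER-SECTOR BOUND from stub 4 and a local bound `N`: every adapted sector datum has `≤ N + 2` sector vertices. -/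
theorem sect_bound (hChart : Stmt.stub_coneChart) {N m t : ℕ} (f g : Fin m → MvPolynomial (Fin 2) ℂ)
    (hf : ∀ j, (f j).support.card ≤ t) (hg : ∀ j, (g j).support.card ≤ t)
    (hloc : ∀ (u v : Fin m → MvPolynomial (Fin 2) ℂ),
      (∀ i, (u i).support.card ≤ t) → (∀ i, (v i).support.card ≤ t) →
      (∀ i, MvPolynomial.coeff 0 (u i) = 1) → (∀ i, MvPolynomial.coeff 0 (v i) = 1) →
      (swVertSet (∏ i, u i - ∏ i, v i)).ncard ≤ N)
    (μ ν : Fin m → Expo) (r₁ r₂ : Fin 2 → ℤ) (hA : Adapted f g μ ν r₁ r₂) :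
    (sectSet f g μ ν r₁ r₂).ncard ≤ N + 2 := by
  rcases (sectSet f g μ ν r₁ r₂).eq_empty_or_nonempty with h0 | hne
  · rw [h0, Set.ncard_empty]; exact Nat.zero_le _
  · obtain ⟨u, v, hu, hv, hu1, hv1, hle⟩ := hChart m t f g hf hg μ ν r₁ r₂ hA hne
    exact hle.trans (Nat.add_le_add_right (hloc u v hu hv hu1 hv1) 2)

/-! ### The within-factor difference vectors and the sweep hypothesis of stub 3 -/

/-- The integer difference vector `p − q` of two exponents. -/
def dvec (p q : Expo) : Fin 2 → ℤ := fun i => (p i : ℤ) - (q i : ℤ)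

/-- All within-factor difference vectors `p − q`, `p ≠ q` in the support of one factor (both families, both signs). -/
def diffs (f g : Fin m → MvPolynomial (Fin 2) ℂ) : Finset (Fin 2 → ℤ) :=
  (Finset.univ.biUnion fun j => (f j).support.offDiag.image fun pq => dvec pq.1 pq.2) ∪
  (Finset.univ.biUnion fun j => (g j).support.offDiag.image fun pq => dvec pq.1 pq.2)

theorem wt_sub (w : Fin 2 → ℤ) (p q : Expo) :
    wt w p - wt w q = w 0 * dvec p q 0 + w 1 * dvec p q 1 := by
  simp only [wt, dvec]; ring

theorem card_diffs_le (t : ℕ) (f g : Fin m → MvPolynomial (Fin 2) ℂ)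
    (hf : ∀ j, (f j).support.card ≤ t) (hg : ∀ j, (g j).support.card ≤ t) :
    (diffs f g).card ≤ 2 * m * t ^ 2 := by
  have h1 : ∀ (h : Fin m → MvPolynomial (Fin 2) ℂ), (∀ j, (h j).support.card ≤ t) →
      (Finset.univ.biUnion fun j => (h j).support.offDiag.image fun pq => dvec pq.1 pq.2).card ≤ m * t ^ 2 := by
    intro h hh
    calc _ ≤ ∑ j : Fin m, ((h j).support.offDiag.image fun pq => dvec pq.1 pq.2).card :=
          Finset.card_biUnion_le
      _ ≤ ∑ _j : Fin m, t ^ 2 := Finset.sum_le_sum fun j _ => by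
          calc _ ≤ (h j).support.offDiag.card := Finset.card_image_le
            _ = (h j).support.card * (h j).support.card - (h j).support.card := Finset.offDiag_card _
            _ ≤ (h j).support.card * (h j).support.card := Nat.sub_le _ _
            _ ≤ t * t := Nat.mul_le_mul (hh j) (hh j)
            _ = t ^ 2 := (sq t).symm
      _ = m * t ^ 2 := by simp
  calc (diffs f g).card ≤ _ + _ := Finset.card_union_le _ _
    _ ≤ m * t ^ 2 + m * t ^ 2 := Nat.add_le_add (h1 f hf) (h1 g hg)
    _ = 2 * m * t ^ 2 := by ring

theorem mem_diffs_f (f g : Fin m → MvPolynomial (Fin 2) ℂ) (j : Fin m) {p q : Expo}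
    (hp : p ∈ (f j).support) (hq : q ∈ (f j).support) (hpq : p ≠ q) : dvec p q ∈ diffs f g :=
  Finset.mem_union_left _ (Finset.mem_biUnion.2 ⟨j, Finset.mem_univ _,
    Finset.mem_image.2 ⟨(p, q), Finset.mem_offDiag.2 ⟨hp, hq, hpq⟩, rfl⟩⟩)

theorem mem_diffs_g (f g : Fin m → MvPolynomial (Fin 2) ℂ) (j : Fin m) {p q : Expo}
    (hp : p ∈ (g j).support) (hq : q ∈ (g j).support) (hpq : p ≠ q) : dvec p q ∈ diffs f g :=
  Finset.mem_union_right _ (Finset.mem_biUnion.2 ⟨j, Finset.mem_univ _,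
    Finset.mem_image.2 ⟨(p, q), Finset.mem_offDiag.2 ⟨hp, hq, hpq⟩, rfl⟩⟩)

/-- The sweep (stub 2) applied to the within-factor differences yields the sweep hypothesis of stub 3. -/
theorem sweepFor_of_sweep (hSweep : Stmt.stub_sweep) (f g : Fin m → MvPolynomial (Fin 2) ℂ) :
    ∃ Sec : Finset ((Fin 2 → ℤ) × (Fin 2 → ℤ)), Sec.card ≤ 4 * (diffs f g).card + 4 ∧ Stmt.SweepFor f g Sec := by
  obtain ⟨Sec, hcard, hsw⟩ := hSweep (diffs f g)
  refine ⟨Sec, hcard, ?_⟩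
  intro w hw0 hw1 hgenf hgeng
  have hD : ∀ d ∈ diffs f g, w 0 * d 0 + w 1 * d 1 ≠ 0 := by
    intro d hd
    simp only [diffs, Finset.mem_union, Finset.mem_biUnion, Finset.mem_univ, true_and,
      Finset.mem_image, Finset.mem_offDiag, Prod.exists] at hd
    rcases hd with ⟨j, p, q, ⟨hp, hq, hpq⟩, rfl⟩ | ⟨j, p, q, ⟨hp, hq, hpq⟩, rfl⟩
    · have := hgenf j p hp q hq hpq
      rwa [Ne, ← sub_eq_zero, wt_sub] at this
    · have := hgeng j p hp q hq hpq
      rwa [Ne, ← sub_eq_zero, wt_sub] at this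
  obtain ⟨rr, hrr, hdet, a, b, K, ha, hb, hK, hKw, hsign⟩ := hsw w hw0 hw1 hD
  refine ⟨rr, hrr, hdet, a, b, K, ha, hb, hK, hKw, ?_, ?_⟩
  · intro j p hp q hq hlt
    have hpq : q ≠ p := fun h => by subst h; exact lt_irrefl _ hlt
    have hpos : 0 < w 0 * dvec q p 0 + w 1 * dvec q p 1 := by rw [← wt_sub]; omega
    have h := hsign _ (mem_diffs_f f g j hq hp hpq) hpos
    have e1 := wt_sub rr.1 q p
    have e2 := wt_sub rr.2 q p
    constructor <;> omega
  · intro j p hp q hq hlt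
    have hpq : q ≠ p := fun h => by subst h; exact lt_irrefl _ hlt
    have hpos : 0 < w 0 * dvec q p 0 + w 1 * dvec q p 1 := by rw [← wt_sub]; omega
    have h := hsign _ (mem_diffs_g f g j hq hp hpq) hpos
    have e1 := wt_sub rr.1 q p
    have e2 := wt_sub rr.2 q p
    constructor <;> omega

/-! ### The vertex bound for nonzero factors, and the reduction of zero factors (doubling trick) -/

/-- NONZERO FACTORS: `#vertSet(∏f − ∏g) ≤ (8mt² + 4)·(N + 2)` from stubs 2–4 and a local bound `N`. -/
theorem vert_bound_nonzero (h2 : Stmt.stub_sweep) (h3 : Stmt.stub_sectorCover) (h4 : Stmt.stub_coneChart)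
    {N m t : ℕ} (f g : Fin m → MvPolynomial (Fin 2) ℂ)
    (hf : ∀ j, (f j).support.card ≤ t) (hg : ∀ j, (g j).support.card ≤ t)
    (hf0 : ∀ j, f j ≠ 0) (hg0 : ∀ j, g j ≠ 0)
    (hloc : ∀ (u v : Fin m → MvPolynomial (Fin 2) ℂ),
      (∀ i, (u i).support.card ≤ t) → (∀ i, (v i).support.card ≤ t) →
      (∀ i, MvPolynomial.coeff 0 (u i) = 1) → (∀ i, MvPolynomial.coeff 0 (v i) = 1) →
      (swVertSet (∏ i, u i - ∏ i, v i)).ncard ≤ N) :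
    (vertSet (∏ j, f j - ∏ j, g j)).ncard ≤ (8 * m * t ^ 2 + 4) * (N + 2) := by
  obtain ⟨Sec, hcard, hSF⟩ := sweepFor_of_sweep h2 f g
  have h := h3 m t f g hf hg hf0 hg0 Sec hSF (N + 2)
    (fun μ ν r₁ r₂ hA => sect_bound h4 f g hf hg hloc μ ν r₁ r₂ hA)
  have hD := card_diffs_le t f g hf hg
  calc (vertSet (∏ j, f j - ∏ j, g j)).ncard ≤ Sec.card * (N + 2) := h
    _ ≤ (4 * (diffs f g).card + 4) * (N + 2) := Nat.mul_le_mul_right _ hcard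
    _ ≤ (8 * m * t ^ 2 + 4) * (N + 2) := Nat.mul_le_mul_right _ (by
        calc 4 * (diffs f g).card + 4 ≤ 4 * (2 * m * t ^ 2) + 4 := by omega
          _ = 8 * m * t ^ 2 + 4 := by ring)

/-- The combinatorial vertex set depends only on the support. -/
theorem vertSet_congr {F G : MvPolynomial (Fin 2) ℂ} (h : F.support = G.support) : vertSet F = vertSet G := by
  simp only [vertSet, h]

/-- Doubling one factor: `∏_j (if j = j₀ then 2 else 1)·h_j = 2·∏_j h_j`. -/
theorem prod_double (h : Fin m → MvPolynomial (Fin 2) ℂ) (j₀ : Fin m) :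
    (∏ j, (if j = j₀ then (MvPolynomial.C 2 : MvPolynomial (Fin 2) ℂ) else 1) * h j) =
      MvPolynomial.C 2 * ∏ j, h j := by
  rw [Finset.prod_mul_distrib, Finset.prod_ite_eq']
  simp

theorem support_double (p : MvPolynomial (Fin 2) ℂ) :
    (MvPolynomial.C (2 : ℂ) * p).support = p.support := by
  rw [MvPolynomial.C_mul', MvPolynomial.support_smul_eq (two_ne_zero)]

/-- GENERAL FACTORS: the same bound, the zero-factor cases being reduced to nonzero families. -/
theorem vert_bound (h2 : Stmt.stub_sweep) (h3 : Stmt.stub_sectorCover) (h4 : Stmt.stub_coneChart)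
    {N m t : ℕ} (f g : Fin m → MvPolynomial (Fin 2) ℂ)
    (hf : ∀ j, (f j).support.card ≤ t) (hg : ∀ j, (g j).support.card ≤ t)
    (hloc : ∀ (u v : Fin m → MvPolynomial (Fin 2) ℂ),
      (∀ i, (u i).support.card ≤ t) → (∀ i, (v i).support.card ≤ t) →
      (∀ i, MvPolynomial.coeff 0 (u i) = 1) → (∀ i, MvPolynomial.coeff 0 (v i) = 1) →
      (swVertSet (∏ i, u i - ∏ i, v i)).ncard ≤ N) :
    (vertSet (∏ j, f j - ∏ j, g j)).ncard ≤ (8 * m * t ^ 2 + 4) * (N + 2) := by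
  by_cases hf0 : ∀ j, f j ≠ 0
  · by_cases hg0 : ∀ j, g j ≠ 0
    · exact vert_bound_nonzero h2 h3 h4 f g hf hg hf0 hg0 hloc
    · -- some `g j₀ = 0`: `∏f − ∏g = ∏f = ∏f' − ∏f` with `f'` = `f` doubled at `j₀`
      push Not at hg0
      obtain ⟨j₀, hj₀⟩ := hg0
      have hpg : (∏ j, g j) = 0 := Finset.prod_eq_zero (Finset.mem_univ j₀) hj₀
      set f' : Fin m → MvPolynomial (Fin 2) ℂ :=
        fun j => (if j = j₀ then (MvPolynomial.C 2 : MvPolynomial (Fin 2) ℂ) else 1) * f j with hf'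
      have hprod : (∏ j, f' j) - ∏ j, f j = (∏ j, f j) - ∏ j, g j := by
        rw [hpg, sub_zero, hf', prod_double, MvPolynomial.C_mul', two_smul, add_sub_cancel_right]
      have hsupp' : ∀ j, (f' j).support = (f j).support := by
        intro j; simp only [hf']
        split_ifs
        · exact support_double _
        · rw [one_mul]
      have hf'0 : ∀ j, f' j ≠ 0 := by
        intro j h0
        have := hsupp' j
        rw [h0, MvPolynomial.support_zero] at this
        exact hf0 j (MvPolynomial.support_eq_empty.1 this.symm)
      have key := vert_bound_nonzero h2 h3 h4 f' f (fun j => by rw [hsupp' j]; exact hf j) hf hf'0 hf0 hloc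
      rwa [hprod] at key
  · push Not at hf0
    obtain ⟨j₀, hj₀⟩ := hf0
    have hpf : (∏ j, f j) = 0 := Finset.prod_eq_zero (Finset.mem_univ j₀) hj₀
    by_cases hg0 : ∀ j, g j ≠ 0
    · -- `∏f − ∏g = −∏g`, same support as `∏g = ∏g' − ∏g`
      set g' : Fin m → MvPolynomial (Fin 2) ℂ :=
        fun j => (if j = j₀ then (MvPolynomial.C 2 : MvPolynomial (Fin 2) ℂ) else 1) * g j with hg'
      have hprod : (∏ j, g' j) - ∏ j, g j = ∏ j, g j := by
        rw [hg', prod_double, MvPolynomial.C_mul', two_smul, add_sub_cancel_right]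
      have hsupp : ((∏ j, f j) - ∏ j, g j).support = ((∏ j, g' j) - ∏ j, g j).support := by
        rw [hprod, hpf, zero_sub, MvPolynomial.support_neg]
      have hsupp' : ∀ j, (g' j).support = (g j).support := by
        intro j; simp only [hg']
        split_ifs
        · exact support_double _
        · rw [one_mul]
      have hg'0 : ∀ j, g' j ≠ 0 := by
        intro j h0
        have := hsupp' j
        rw [h0, MvPolynomial.support_zero] at this
        exact hg0 j (MvPolynomial.support_eq_empty.1 this.symm)
      have key := vert_bound_nonzero h2 h3 h4 g' g (fun j => by rw [hsupp' j]; exact hg j) hg hg'0 hg0 hloc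
      rwa [vertSet_congr hsupp]
    · push Not at hg0
      obtain ⟨j₁, hj₁⟩ := hg0
      have hpg : (∏ j, g j) = 0 := Finset.prod_eq_zero (Finset.mem_univ j₁) hj₁
      have h0 : vertSet ((∏ j, f j) - ∏ j, g j) = ∅ := by
        rw [hpf, hpg, sub_zero]
        ext e
        simp [vertSet, IsStrictMin]
      rw [h0, Set.ncard_empty]
      exact Nat.zero_le _

/-! ### Arithmetic -/

/-- The final arithmetic: `(8mt² + 4)·(2^((a+1)m)(t+2)^b + 2) ≤ 2^((a+2)m)·(t+2)^(b+8)`. -/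
theorem bound_arith (a b m t : ℕ) :
    (8 * m * t ^ 2 + 4) * (2 ^ ((a + 1) * m) * (t + 2) ^ b + 2) ≤ 2 ^ ((a + 2) * m) * (t + 2) ^ (b + 8) := by
  set X : ℕ := 2 ^ ((a + 1) * m) * (t + 2) ^ b with hX
  have hX1 : 1 ≤ X := Nat.one_le_iff_ne_zero.2 (by positivity)
  have hm : m ≤ 2 ^ m := Nat.lt_two_pow_self.le
  have h12 : 1 ≤ 2 ^ m := Nat.one_le_two_pow
  have ht : t ^ 2 ≤ (t + 2) ^ 2 := Nat.pow_le_pow_left (by omega) 2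
  have h4 : 4 ≤ (t + 2) ^ 2 := by
    calc 4 = 2 ^ 2 := by norm_num
      _ ≤ (t + 2) ^ 2 := Nat.pow_le_pow_left (by omega) 2
  -- first factor
  have hA : 8 * m * t ^ 2 + 4 ≤ 16 * (2 ^ m * (t + 2) ^ 2) := by
    have e1 : 8 * m * t ^ 2 ≤ 8 * (2 ^ m * (t + 2) ^ 2) := by
      calc 8 * m * t ^ 2 = 8 * (m * t ^ 2) := by ring
        _ ≤ 8 * (2 ^ m * (t + 2) ^ 2) := by gcongr
    have e2 : 4 ≤ 8 * (2 ^ m * (t + 2) ^ 2) := by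
      calc 4 ≤ 1 * 4 := by norm_num
        _ ≤ 2 ^ m * (t + 2) ^ 2 := Nat.mul_le_mul h12 h4
        _ ≤ 8 * (2 ^ m * (t + 2) ^ 2) := by omega
    omega
  -- second factor
  have hB : X + 2 ≤ 4 * X := by omega
  have h64 : 64 ≤ (t + 2) ^ 6 := by
    calc 64 = 2 ^ 6 := by norm_num
      _ ≤ (t + 2) ^ 6 := Nat.pow_le_pow_left (by omega) 6
  calc (8 * m * t ^ 2 + 4) * (X + 2) ≤ (16 * (2 ^ m * (t + 2) ^ 2)) * (4 * X) := Nat.mul_le_mul hA hB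
    _ = 64 * (2 ^ m * X) * (t + 2) ^ 2 := by ring
    _ ≤ (t + 2) ^ 6 * (2 ^ m * X) * (t + 2) ^ 2 := by gcongr
    _ = 2 ^ ((a + 2) * m) * (t + 2) ^ (b + 8) := by rw [hX]; ring

/-! ### Lead c1 reshape: the engine from LOCALISATION (7a) + the ALL-DEAD ENGINE (7b)

`trunc`, `deadDiff`, `AllDead` are the readable forms of the objects inlined in stubs 7a/7b.  The derivation:
strong induction on the letter count `Σ_i |supp u_i| + Σ_i |supp v_i|` — an all-dead instance is bounded by 7b; otherwise
7a puts every south-west vertex either among the alive first-order exponents or among the south-west vertices of the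
dead-letter instance, which has strictly fewer letters, the same sparsity and constant terms `1`. -/

section Reshape

open MvPolynomial

variable {n : ℕ}

theorem coeff_trunc (S : Finset Expo) (f : MvPolynomial (Fin 2) ℂ) (b : Expo) :
    coeff b (Stmt.trunc S f) = if b ∉ S then coeff b f else 0 := by
  classical
  unfold Stmt.trunc
  rw [coeff_sum]
  simp only [coeff_monomial]
  rw [Finset.sum_ite_eq' (f.support.filter (· ∉ S)) b (fun a => coeff a f)]
  simp only [Finset.mem_filter, mem_support_iff]
  by_cases hb : b ∉ S
  · by_cases hc : coeff b f = 0
    · simp [hb, hc]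
    · simp [hb, hc]
  · simp [hb]

theorem support_trunc (S : Finset Expo) (f : MvPolynomial (Fin 2) ℂ) :
    (Stmt.trunc S f).support = f.support.filter (· ∉ S) := by
  classical
  ext b
  rw [mem_support_iff, coeff_trunc, Finset.mem_filter, mem_support_iff]
  by_cases hb : b ∉ S <;> simp [hb]

theorem card_support_trunc_le (S : Finset Expo) (f : MvPolynomial (Fin 2) ℂ) :
    (Stmt.trunc S f).support.card ≤ f.support.card := by
  rw [support_trunc]; exact Finset.card_filter_le _ _

/-- The constant term of `∏ u − ∏ v` vanishes when all constant terms are `1`. -/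
theorem coeff_zero_diff (u v : Fin n → MvPolynomial (Fin 2) ℂ)
    (hu : ∀ i, coeff 0 (u i) = 1) (hv : ∀ i, coeff 0 (v i) = 1) :
    coeff 0 (∏ i, u i - ∏ i, v i) = 0 := by
  have h1 : coeff 0 (∏ i, u i) = 1 := by
    rw [← constantCoeff_eq, map_prod]
    exact Finset.prod_eq_one fun i _ => by rw [constantCoeff_eq]; exact hu i
  have h2 : coeff 0 (∏ i, v i) = 1 := by
    rw [← constantCoeff_eq, map_prod]
    exact Finset.prod_eq_one fun i _ => by rw [constantCoeff_eq]; exact hv i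
  rw [coeff_sub, h1, h2, sub_self]

theorem zero_notMem_support_diff (u v : Fin n → MvPolynomial (Fin 2) ℂ)
    (hu : ∀ i, coeff 0 (u i) = 1) (hv : ∀ i, coeff 0 (v i) = 1) :
    (0 : Expo) ∉ (∏ i, u i - ∏ i, v i).support := by
  rw [mem_support_iff, coeff_zero_diff u v hu hv]; exact fun h => h rfl

theorem coeff_zero_trunc (u v : Fin n → MvPolynomial (Fin 2) ℂ)
    (hu : ∀ i, coeff 0 (u i) = 1) (hv : ∀ i, coeff 0 (v i) = 1) (f : MvPolynomial (Fin 2) ℂ) :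
    coeff 0 (Stmt.trunc (∏ j, u j - ∏ j, v j).support f) = coeff 0 f := by
  rw [coeff_trunc, if_pos (zero_notMem_support_diff u v hu hv)]

/-- Letter count of an instance. -/
def letters (u v : Fin n → MvPolynomial (Fin 2) ℂ) : ℕ :=
  ∑ i, (u i).support.card + ∑ i, (v i).support.card

/-- The alive first-order exponents (monomials of some factor surviving in `∏ u − ∏ v`), as a finset. -/
def alive (u v : Fin n → MvPolynomial (Fin 2) ℂ) : Finset Expo :=
  (Finset.univ.biUnion fun i => (u i).support ∪ (v i).support).filter
    (· ∈ (∏ j, u j - ∏ j, v j).support)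

/-- Letter bookkeeping: alive letters plus the letters of the dead-letter instance are at most all letters. -/
theorem card_alive_add_letters_le (u v : Fin n → MvPolynomial (Fin 2) ℂ) :
    (alive u v).card + letters (fun i => Stmt.trunc (∏ j, u j - ∏ j, v j).support (u i))
      (fun i => Stmt.trunc (∏ j, u j - ∏ j, v j).support (v i)) ≤ letters u v := by
  classical
  set S := (∏ j, u j - ∏ j, v j).support with hS
  have hsplit : ∀ f : MvPolynomial (Fin 2) ℂ,
      (f.support.filter (· ∈ S)).card + (Stmt.trunc S f).support.card = f.support.card := by
    intro f
    rw [support_trunc]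
    exact Finset.card_filter_add_card_filter_not (fun a => a ∈ S)
  have hal : (alive u v).card ≤ ∑ i, ((u i).support.filter (· ∈ S)).card +
      ∑ i, ((v i).support.filter (· ∈ S)).card := by
    unfold alive
    rw [Finset.filter_biUnion]
    refine Finset.card_biUnion_le.trans ?_
    rw [← Finset.sum_add_distrib]
    refine Finset.sum_le_sum fun i _ => ?_
    rw [Finset.filter_union]
    exact Finset.card_union_le _ _
  unfold letters
  have eu : ∀ i, ((u i).support.filter (· ∈ S)).card + (Stmt.trunc S (u i)).support.card =
      (u i).support.card := fun i => hsplit (u i)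
  have ev : ∀ i, ((v i).support.filter (· ∈ S)).card + (Stmt.trunc S (v i)).support.card =
      (v i).support.card := fun i => hsplit (v i)
  have su : ∑ i, (u i).support.card = ∑ i, ((u i).support.filter (· ∈ S)).card +
      ∑ i, (Stmt.trunc S (u i)).support.card := by
    rw [← Finset.sum_add_distrib]; exact Finset.sum_congr rfl fun i _ => (eu i).symm
  have sv : ∑ i, (v i).support.card = ∑ i, ((v i).support.filter (· ∈ S)).card +
      ∑ i, (Stmt.trunc S (v i)).support.card := by
    rw [← Finset.sum_add_distrib]; exact Finset.sum_congr rfl fun i _ => (ev i).symm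
  rw [su, sv]
  simp only [hS] at hal ⊢
  omega

/-- Not all-dead ⇒ the dead-letter instance has strictly fewer letters. -/
theorem letters_trunc_lt (u v : Fin n → MvPolynomial (Fin 2) ℂ) (h : ¬ Stmt.AllDead u v) :
    letters (fun i => Stmt.trunc (∏ j, u j - ∏ j, v j).support (u i))
      (fun i => Stmt.trunc (∏ j, u j - ∏ j, v j).support (v i)) < letters u v := by
  classical
  have hpos : 0 < (alive u v).card := by
    rw [Finset.card_pos]
    unfold Stmt.AllDead at h
    rw [not_and_or] at h
    rcases h with h | h
    · push Not at h
      obtain ⟨i, e, he, heD⟩ := h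
      exact ⟨e, Finset.mem_filter.2 ⟨Finset.mem_biUnion.2 ⟨i, Finset.mem_univ _,
        Finset.mem_union_left _ he⟩, heD⟩⟩
    · push Not at h
      obtain ⟨i, e, he, heD⟩ := h
      exact ⟨e, Finset.mem_filter.2 ⟨Finset.mem_biUnion.2 ⟨i, Finset.mem_univ _,
        Finset.mem_union_right _ he⟩, heD⟩⟩
  have := card_alive_add_letters_le u v
  omega

/-- LOCALISATION, set form: south-west vertices are alive first-order exponents or south-west vertices of the
dead-letter instance. -/
theorem swVertSet_subset_alive_union (h7a : Stmt.stub_localisation) (u v : Fin n → MvPolynomial (Fin 2) ℂ)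
    (hu : ∀ i, coeff 0 (u i) = 1) (hv : ∀ i, coeff 0 (v i) = 1) :
    swVertSet (∏ i, u i - ∏ i, v i) ⊆ ↑(alive u v) ∪ swVertSet (Stmt.deadDiff u v) := by
  rintro e ⟨w, hw0, hw1, hmin⟩
  rcases h7a n u v hu hv w hw0 hw1 e hmin with ⟨i, hi⟩ | hdead
  · left
    refine Finset.mem_coe.2 (Finset.mem_filter.2 ⟨Finset.mem_biUnion.2 ⟨i, Finset.mem_univ _, ?_⟩, hmin.1⟩)
    rcases hi with hi | hi
    · exact Finset.mem_union_left _ hi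
    · exact Finset.mem_union_right _ hi
  · right; exact ⟨w, hw0, hw1, hdead⟩

theorem swVertSet_finite (D : MvPolynomial (Fin 2) ℂ) : (swVertSet D).Finite :=
  Set.Finite.subset (Finset.finite_toSet D.support) fun _ ⟨_, _, _, he, _⟩ => Finset.mem_coe.2 he

/-- THE DERIVATION: letters-plus-constant bound by strong induction on the letter count. -/
theorem sw_le_letters_add (h7a : Stmt.stub_localisation) (t K : ℕ)
    (hK : ∀ (u v : Fin n → MvPolynomial (Fin 2) ℂ),
      (∀ i, (u i).support.card ≤ t) → (∀ i, (v i).support.card ≤ t) →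
      (∀ i, coeff 0 (u i) = 1) → (∀ i, coeff 0 (v i) = 1) → Stmt.AllDead u v →
      (swVertSet (∏ i, u i - ∏ i, v i)).ncard ≤ K) :
    ∀ (L : ℕ) (u v : Fin n → MvPolynomial (Fin 2) ℂ),
      (∀ i, (u i).support.card ≤ t) → (∀ i, (v i).support.card ≤ t) →
      (∀ i, coeff 0 (u i) = 1) → (∀ i, coeff 0 (v i) = 1) → letters u v ≤ L →
      (swVertSet (∏ i, u i - ∏ i, v i)).ncard ≤ L + K := by
  intro L
  induction L using Nat.strong_induction_on with
  | _ L ih =>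
    intro u v hut hvt hu hv hL
    by_cases hdead : Stmt.AllDead u v
    · exact (hK u v hut hvt hu hv hdead).trans (Nat.le_add_left K L)
    · set U : Fin n → MvPolynomial (Fin 2) ℂ := fun i => Stmt.trunc (∏ j, u j - ∏ j, v j).support (u i) with hU
      set V : Fin n → MvPolynomial (Fin 2) ℂ := fun i => Stmt.trunc (∏ j, u j - ∏ j, v j).support (v i) with hV
      have hUt : ∀ i, (U i).support.card ≤ t := fun i => (card_support_trunc_le _ _).trans (hut i)
      have hVt : ∀ i, (V i).support.card ≤ t := fun i => (card_support_trunc_le _ _).trans (hvt i)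
      have hU1 : ∀ i, coeff 0 (U i) = 1 := fun i => by rw [hU, coeff_zero_trunc u v hu hv]; exact hu i
      have hV1 : ∀ i, coeff 0 (V i) = 1 := fun i => by rw [hV, coeff_zero_trunc u v hu hv]; exact hv i
      have hlt : letters U V < letters u v := letters_trunc_lt u v hdead
      have hbook : (alive u v).card + letters U V ≤ letters u v := card_alive_add_letters_le u v
      have hIH := ih (letters U V) (by omega) U V hUt hVt hU1 hV1 le_rfl
      have hsub := swVertSet_subset_alive_union h7a u v hu hv
      have hdd : Stmt.deadDiff u v = ∏ i, U i - ∏ i, V i := rfl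
      rw [hdd] at hsub
      calc (swVertSet (∏ i, u i - ∏ i, v i)).ncard
          ≤ (↑(alive u v) ∪ swVertSet (∏ i, U i - ∏ i, V i)).ncard :=
            Set.ncard_le_ncard hsub ((alive u v).finite_toSet.union (swVertSet_finite _))
        _ ≤ (↑(alive u v) : Set Expo).ncard + (swVertSet (∏ i, U i - ∏ i, V i)).ncard := Set.ncard_union_le _ _
        _ = (alive u v).card + (swVertSet (∏ i, U i - ∏ i, V i)).ncard := by rw [Set.ncard_coe_finset]
        _ ≤ (alive u v).card + (letters U V + K) := Nat.add_le_add_left hIH _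
        _ ≤ L + K := by omega

/-- The south-west bound for every local instance, from 7a + 7b: `≤ 2nt + 2^(an)(t+2)^b ≤ 2^((a+2)n)(t+2)^(b+1)`. -/
theorem sw_bound (h7a : Stmt.stub_localisation) {a b : ℕ}
    (h7b : ∀ (n t : ℕ) (u v : Fin n → MvPolynomial (Fin 2) ℂ),
      (∀ i, (u i).support.card ≤ t) → (∀ i, (v i).support.card ≤ t) →
      (∀ i, coeff 0 (u i) = 1) → (∀ i, coeff 0 (v i) = 1) → Stmt.AllDead u v →
      (swVertSet (∏ i, u i - ∏ i, v i)).ncard ≤ 2 ^ (a * n) * (t + 2) ^ b)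
    (n t : ℕ) (u v : Fin n → MvPolynomial (Fin 2) ℂ)
    (hut : ∀ i, (u i).support.card ≤ t) (hvt : ∀ i, (v i).support.card ≤ t)
    (hu : ∀ i, coeff 0 (u i) = 1) (hv : ∀ i, coeff 0 (v i) = 1) :
    (swVertSet (∏ i, u i - ∏ i, v i)).ncard ≤ 2 ^ ((a + 2) * n) * (t + 2) ^ (b + 1) := by
  have h := sw_le_letters_add h7a t (2 ^ (a * n) * (t + 2) ^ b) (fun u v hu' hv' h1 h2 hd =>
    h7b n t u v hu' hv' h1 h2 hd) (letters u v) u v hut hvt hu hv le_rfl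
  have hL : letters u v ≤ n * t + n * t := by
    unfold letters
    have e1 : ∑ i, (u i).support.card ≤ ∑ _i : Fin n, t := Finset.sum_le_sum fun i _ => hut i
    have e2 : ∑ i, (v i).support.card ≤ ∑ _i : Fin n, t := Finset.sum_le_sum fun i _ => hvt i
    simp only [Finset.sum_const, Finset.card_univ, Fintype.card_fin, smul_eq_mul] at e1 e2
    omega
  -- arithmetic: 2nt + 2^(an)(t+2)^b ≤ 2^((a+2)n) (t+2)^(b+1)
  have hnt : n * t + n * t ≤ 2 ^ ((a + 1) * n) * (t + 2) ^ (b + 1) := by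
    have h1 : n * t + n * t = (2 * n) * t := by ring
    have h2 : 2 * n ≤ 2 ^ ((a + 1) * n) :=
      (two_mul_le_two_pow n).trans (Nat.pow_le_pow_right (by norm_num) (by nlinarith))
    have h3 : t ≤ (t + 2) ^ (b + 1) :=
      calc t ≤ t + 2 := Nat.le_add_right t 2
        _ = (t + 2) ^ 1 := (pow_one _).symm
        _ ≤ (t + 2) ^ (b + 1) := Nat.pow_le_pow_right (by omega) (by omega)
    rw [h1]; exact Nat.mul_le_mul h2 h3
  have hK : 2 ^ (a * n) * (t + 2) ^ b ≤ 2 ^ ((a + 1) * n) * (t + 2) ^ (b + 1) :=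
    Nat.mul_le_mul (Nat.pow_le_pow_right (by norm_num) (by nlinarith))
      (Nat.pow_le_pow_right (by omega) (by omega))
  rcases Nat.eq_zero_or_pos n with hn0 | hnpos
  · subst hn0
    have : letters u v = 0 := by unfold letters; simp
    rw [this] at h
    calc (swVertSet (∏ i, u i - ∏ i, v i)).ncard ≤ 0 + 2 ^ (a * 0) * (t + 2) ^ b := h
      _ ≤ 2 ^ ((a + 2) * 0) * (t + 2) ^ (b + 1) := by
          simp only [mul_zero, pow_zero, one_mul, zero_add]
          exact Nat.pow_le_pow_right (by omega) (by omega)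
  · have h22 : 2 ≤ 2 ^ n := by
      calc 2 = 2 ^ 1 := by norm_num
        _ ≤ 2 ^ n := Nat.pow_le_pow_right (by norm_num) hnpos
    calc (swVertSet (∏ i, u i - ∏ i, v i)).ncard ≤ letters u v + 2 ^ (a * n) * (t + 2) ^ b := h
      _ ≤ 2 ^ ((a + 1) * n) * (t + 2) ^ (b + 1) + 2 ^ ((a + 1) * n) * (t + 2) ^ (b + 1) :=
          Nat.add_le_add (hL.trans hnt) hK
      _ = 2 * (2 ^ ((a + 1) * n) * (t + 2) ^ (b + 1)) := by ring
      _ ≤ 2 ^ n * (2 ^ ((a + 1) * n) * (t + 2) ^ (b + 1)) := Nat.mul_le_mul_right _ h22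
      _ = 2 ^ ((a + 2) * n) * (t + 2) ^ (b + 1) := by ring

/-- The engine statement (old stub 7) DERIVED from stubs 7a, 7b and the landed power-sum criterion (stub 5), with
constants `(a+2, b+1)`. -/
theorem logSumNewton_of_reshape (h5 : Stmt.stub_powerSumCriterion) (h7a : Stmt.stub_localisation)
    (h7b : Stmt.stub_allDeadEngine) : Stmt.stub_logSumNewton := by
  obtain ⟨a, b, hab⟩ := h7b
  refine ⟨a + 2, b + 1, ?_⟩
  intro n t u v _ hut hvt hu hv
  rw [← swVertSet_eq_logVertSet h5 u v hu hv]
  exact sw_bound h7a (fun n t u v h1 h2 h3 h4 hd => hab n t u v h1 h2 h3 h4 hd.1 hd.2) n t u v hut hvt hu hv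

end Reshape


section Records

/-- Sparsity of the appended family. -/
theorem card_support_append_le {n t : ℕ} (u v : Fin n → MvPolynomial (Fin 2) ℂ)
    (hut : ∀ i, (u i).support.card ≤ t) (hvt : ∀ i, (v i).support.card ≤ t) :
    ∀ i, (Fin.append u v i).support.card ≤ t := by
  intro i
  refine Fin.addCases (fun j => ?_) (fun j => ?_) i
  · rw [Fin.append_left]; exact hut j
  · rw [Fin.append_right]; exact hvt j

/-- Constant terms of the appended family. -/
theorem coeff_zero_append {n : ℕ} (u v : Fin n → MvPolynomial (Fin 2) ℂ)
    (hu : ∀ i, MvPolynomial.coeff 0 (u i) = 1) (hv : ∀ i, MvPolynomial.coeff 0 (v i) = 1) :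
    ∀ i, MvPolynomial.coeff 0 (Fin.append u v i) = 1 := by
  intro i
  refine Fin.addCases (fun j => ?_) (fun j => ?_) i
  · rw [Fin.append_left]; exact hu j
  · rw [Fin.append_right]; exact hv j

/-- The engine statement (old stub 7) DERIVED from the record reduction (7c) and the row-record bound (7d), constants
`(2a, b)`: the log-vertices are row-records of the family `Fin.append u v` (`N = 2n`). -/
theorem logSumNewton_of_records (hRed : Stmt.stub_recordReduction) (hRR : Stmt.stub_rowRecordBound) :
    Stmt.stub_logSumNewton := by
  obtain ⟨a, b, hab⟩ := hRR
  refine ⟨2 * a, b, ?_⟩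
  intro n t u v _ hut hvt hu hv
  obtain ⟨hfin, hcard⟩ := hab (n + n) t (Fin.append u v) (card_support_append_le u v hut hvt)
    (coeff_zero_append u v hu hv)
  have hpow : 2 ^ (a * (n + n)) * (t + 2) ^ b = 2 ^ (2 * a * n) * (t + 2) ^ b := by ring_nf
  rw [← hpow]
  refine le_trans (Set.ncard_le_ncard ?_ hfin) hcard
  rintro e ⟨w, hw0, hw1, hstab⟩
  exact ⟨w, hw0, hw1, hRed n u v hu hv w hw0 hw1 e hstab⟩

/-- Old stub 7b DERIVED (all-dead hypotheses unused): the south-west vertices are log-vertices (stub 5) hence records. -/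
theorem allDeadEngine_of_records (h5 : Stmt.stub_powerSumCriterion) (hRed : Stmt.stub_recordReduction)
    (hRR : Stmt.stub_rowRecordBound) : Stmt.stub_allDeadEngine := by
  obtain ⟨a, b, hab⟩ := hRR
  refine ⟨2 * a, b, ?_⟩
  intro n t u v hut hvt hu hv _ _
  rw [swVertSet_eq_logVertSet h5 u v hu hv]
  obtain ⟨hfin, hcard⟩ := hab (n + n) t (Fin.append u v) (card_support_append_le u v hut hvt)
    (coeff_zero_append u v hu hv)
  have hpow : 2 ^ (a * (n + n)) * (t + 2) ^ b = 2 ^ (2 * a * n) * (t + 2) ^ b := by ring_nf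
  rw [← hpow]
  refine le_trans (Set.ncard_le_ncard ?_ hfin) hcard
  rintro e ⟨w, hw0, hw1, hstab⟩
  exact ⟨w, hw0, hw1, hRed n u v hu hv w hw0 hw1 e hstab⟩

end Records


section Shallow

/-- Pointwise weight lemma: a nonzero exponent has positive weight for a positive weight vector. -/
theorem wt_pos_of_ne_zero (w : Fin 2 → ℤ) (hw0 : 0 < w 0) (hw1 : 0 < w 1) {q : Expo} (hq : q ≠ 0) :
    0 < wt w q := by
  have h : q 0 ≠ 0 ∨ q 1 ≠ 0 := by
    by_contra hcon
    push Not at hcon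
    exact hq (by ext i; fin_cases i <;> simp [hcon.1, hcon.2])
  unfold wt
  rcases h with h | h
  · have h1 : (1 : ℤ) ≤ (q 0 : ℤ) := by exact_mod_cast Nat.one_le_iff_ne_zero.mpr h
    have h2 : (0 : ℤ) ≤ (q 1 : ℤ) := by positivity
    nlinarith
  · have h1 : (1 : ℤ) ≤ (q 1 : ℤ) := by exact_mod_cast Nat.one_le_iff_ne_zero.mpr h
    have h2 : (0 : ℤ) ≤ (q 0 : ℤ) := by positivity
    nlinarith

/-- THE DERIVATION of old stub 7b from the peel–shallow pair (the all-dead hypotheses are not used): peel `v 0`, bound the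
south-west vertices by the letters of `v 0` plus the `t`-shallow support points of `(∏ u)·(∏_{j ≥ 1} v_j)⁻¹`; constants
`(2a+1, b+1)`. -/
theorem allDeadEngine_of_shallow (hS1 : Stmt.stub_peelShallow) (hS2 : Stmt.stub_shallowBound) :
    Stmt.stub_allDeadEngine := by
  obtain ⟨a, b, hab⟩ := hS2
  refine ⟨2 * a + 1, b + 1, ?_⟩
  intro n t u v hut hvt hu hv _ _
  cases n with
  | zero =>
    have h0 : (∏ i, u i - ∏ i, v i : MvPolynomial (Fin 2) ℂ) = 0 := by
      simp [Finset.univ_eq_empty]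
    have hempty : swVertSet (∏ i, u i - ∏ i, v i) = ∅ := by
      rw [h0]
      ext e
      simp only [swVertSet, IsStrictMin, MvPolynomial.support_zero, Finset.notMem_empty, false_and, and_false,
        exists_false, Set.mem_setOf_eq, Set.mem_empty_iff_false]
    rw [hempty, Set.ncard_empty]
    positivity
  | succ k =>
    -- peel `v 0`
    set v' : Fin k → MvPolynomial (Fin 2) ℂ := fun j => v j.succ with hv'
    have hprod : (∏ i, v i) = v 0 * ∏ j, v' j := Fin.prod_univ_succ v
    set G := Stmt.quotSeries u v' with hG
    set T := Stmt.shallowSet G t with hT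
    have hv'1 : ∀ j, MvPolynomial.coeff 0 (v' j) = 1 := fun j => hv j.succ
    have hv't : ∀ j, (v' j).support.card ≤ t := fun j => hvt j.succ
    obtain ⟨hfin, hcard⟩ := hab (k + 1) k t u v' hut hv't hu hv'1
    -- the vertex set is inside `supp (v 0) ∪ T`
    have hsub : swVertSet (∏ i, u i - ∏ i, v i) ⊆ ((v 0).support : Set Expo) ∪ T := by
      rintro e ⟨w, hw0, hw1, hmin⟩
      rw [hprod] at hmin
      rcases hS1 (k + 1) k u v' (v 0) hv'1 w hw0 hw1 e hmin with he | ⟨hGe, hq⟩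
      · exact Or.inl (Finset.mem_coe.2 he)
      · refine Or.inr ⟨hGe, w, hw0, hw1, ?_⟩
        -- the competitors inject into the nonzero letters of `v 0`
        have hsubq : {q : Expo | q ≠ 0 ∧ q ≠ e ∧ MvPowerSeries.coeff q G ≠ 0 ∧ wt w q ≤ wt w e} ⊆
            (((v 0).support.erase 0 : Finset Expo) : Set Expo) := by
          rintro q ⟨hq0, hqe, hGq, hle⟩
          exact Finset.mem_coe.2 (Finset.mem_erase.2 ⟨hq0, hq q hq0 hqe hGq hle⟩)
        have h0mem : (0 : Expo) ∈ (v 0).support := by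
          rw [MvPolynomial.mem_support_iff, hv 0]; exact one_ne_zero
        calc {q : Expo | q ≠ 0 ∧ q ≠ e ∧ MvPowerSeries.coeff q G ≠ 0 ∧ wt w q ≤ wt w e}.ncard
            ≤ ((((v 0).support.erase 0 : Finset Expo) : Set Expo)).ncard :=
              Set.ncard_le_ncard hsubq (Finset.finite_toSet _)
          _ = ((v 0).support.erase 0).card := Set.ncard_coe_finset _
          _ = (v 0).support.card - 1 := Finset.card_erase_of_mem h0mem
          _ ≤ t - 1 := Nat.sub_le_sub_right (hvt 0) 1
    have hfinU : (((v 0).support : Set Expo) ∪ T).Finite := (Finset.finite_toSet _).union hfin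
    have hX : 1 ≤ 2 ^ (a * (k + 1 + k)) * (t + 2) ^ b := Nat.one_le_iff_ne_zero.mpr (by positivity)
    calc (swVertSet (∏ i, u i - ∏ i, v i)).ncard
        ≤ (((v 0).support : Set Expo) ∪ T).ncard := Set.ncard_le_ncard hsub hfinU
      _ ≤ ((v 0).support : Set Expo).ncard + T.ncard := Set.ncard_union_le _ _
      _ = (v 0).support.card + T.ncard := by rw [Set.ncard_coe_finset]
      _ ≤ t + 2 ^ (a * (k + 1 + k)) * (t + 2) ^ b := Nat.add_le_add (hvt 0) hcard
      _ ≤ (t + 2) * (2 ^ (a * (k + 1 + k)) * (t + 2) ^ b) := by nlinarith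
      _ ≤ (t + 2) * (2 ^ ((2 * a + 1) * (k + 1)) * (t + 2) ^ b) := by
          apply Nat.mul_le_mul_left
          apply Nat.mul_le_mul_right
          apply Nat.pow_le_pow_right (by norm_num)
          nlinarith
      _ = 2 ^ ((2 * a + 1) * (k + 1)) * (t + 2) ^ (b + 1) := by ring

/-- c4's `t`-shallow bound implies the pinned bound (same constants): the competitors of an `L`-pinned point inject into `L`. -/
theorem pinned_of_shallow (hS : Stmt.stub_shallowBound) : Stmt.stub_pinnedShallowBound := by
  obtain ⟨a, b, hab⟩ := hS
  refine ⟨a, b, ?_⟩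
  intro k m t u v L hut hvt hu hv hL
  obtain ⟨hfin, hcard⟩ := hab k m t u v hut hvt hu hv
  have hsub : Stmt.pinnedSet (Stmt.quotSeries u v) L ⊆ Stmt.shallowSet (Stmt.quotSeries u v) t := by
    rintro e ⟨hGe, w, hw0, hw1, hq⟩
    refine ⟨hGe, w, hw0, hw1, ?_⟩
    have hsubq : {q : Expo | q ≠ 0 ∧ q ≠ e ∧ MvPowerSeries.coeff q (Stmt.quotSeries u v) ≠ 0 ∧ wt w q ≤ wt w e} ⊆
        ((L : Finset Expo) : Set Expo) := by
      rintro q ⟨hq0, hqe, hGq, hle⟩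
      exact Finset.mem_coe.2 (hq q hq0 hqe hGq hle)
    calc {q : Expo | q ≠ 0 ∧ q ≠ e ∧ MvPowerSeries.coeff q (Stmt.quotSeries u v) ≠ 0 ∧ wt w q ≤ wt w e}.ncard
        ≤ ((L : Finset Expo) : Set Expo).ncard := Set.ncard_le_ncard hsubq (Finset.finite_toSet _)
      _ = L.card := Set.ncard_coe_finset _
      _ ≤ t - 1 := hL
  exact ⟨hfin.subset hsub, (Set.ncard_le_ncard hsub hfin).trans hcard⟩

/-- THE DERIVATION of old stub 7b from the peel reduction 7e + the PINNED bound 7g (lead c5; the all-dead hypotheses are not used): peel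
`v 0`; a south-west vertex outside `supp (v 0)` is a support point of `G = (∏ u)·(∏_{j ≥ 1} v_j)⁻¹` pinned by the fixed set
`L = supp (v 0) ∖ {0}` (`|L| ≤ t − 1`); constants `(2a+1, b+1)`. -/
theorem allDeadEngine_of_pinned (hS1 : Stmt.stub_peelShallow) (hS2 : Stmt.stub_pinnedShallowBound) :
    Stmt.stub_allDeadEngine := by
  obtain ⟨a, b, hab⟩ := hS2
  refine ⟨2 * a + 1, b + 1, ?_⟩
  intro n t u v hut hvt hu hv _ _
  cases n with
  | zero =>
    have h0 : (∏ i, u i - ∏ i, v i : MvPolynomial (Fin 2) ℂ) = 0 := by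
      simp [Finset.univ_eq_empty]
    have hempty : swVertSet (∏ i, u i - ∏ i, v i) = ∅ := by
      rw [h0]
      ext e
      simp only [swVertSet, IsStrictMin, MvPolynomial.support_zero, Finset.notMem_empty, false_and, and_false,
        exists_false, Set.mem_setOf_eq, Set.mem_empty_iff_false]
    rw [hempty, Set.ncard_empty]
    positivity
  | succ k =>
    set v' : Fin k → MvPolynomial (Fin 2) ℂ := fun j => v j.succ with hv'
    have hprod : (∏ i, v i) = v 0 * ∏ j, v' j := Fin.prod_univ_succ v
    set G := Stmt.quotSeries u v' with hG
    set L : Finset Expo := (v 0).support.erase 0 with hLdef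
    set T := Stmt.pinnedSet G L with hT
    have hv'1 : ∀ j, MvPolynomial.coeff 0 (v' j) = 1 := fun j => hv j.succ
    have hv't : ∀ j, (v' j).support.card ≤ t := fun j => hvt j.succ
    have h0mem : (0 : Expo) ∈ (v 0).support := by
      rw [MvPolynomial.mem_support_iff, hv 0]; exact one_ne_zero
    have hL : L.card ≤ t - 1 := by
      rw [hLdef, Finset.card_erase_of_mem h0mem]
      exact Nat.sub_le_sub_right (hvt 0) 1
    obtain ⟨hfin, hcard⟩ := hab (k + 1) k t u v' L hut hv't hu hv'1 hL
    have hsub : swVertSet (∏ i, u i - ∏ i, v i) ⊆ ((v 0).support : Set Expo) ∪ T := by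
      rintro e ⟨w, hw0, hw1, hmin⟩
      rw [hprod] at hmin
      rcases hS1 (k + 1) k u v' (v 0) hv'1 w hw0 hw1 e hmin with he | ⟨hGe, hq⟩
      · exact Or.inl (Finset.mem_coe.2 he)
      · refine Or.inr ⟨hGe, w, hw0, hw1, ?_⟩
        intro q hq0 hqe hGq hle
        exact Finset.mem_erase.2 ⟨hq0, hq q hq0 hqe hGq hle⟩
    have hfinU : (((v 0).support : Set Expo) ∪ T).Finite := (Finset.finite_toSet _).union hfin
    have hX : 1 ≤ 2 ^ (a * (k + 1 + k)) * (t + 2) ^ b := Nat.one_le_iff_ne_zero.mpr (by positivity)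
    calc (swVertSet (∏ i, u i - ∏ i, v i)).ncard
        ≤ (((v 0).support : Set Expo) ∪ T).ncard := Set.ncard_le_ncard hsub hfinU
      _ ≤ ((v 0).support : Set Expo).ncard + T.ncard := Set.ncard_union_le _ _
      _ = (v 0).support.card + T.ncard := by rw [Set.ncard_coe_finset]
      _ ≤ t + 2 ^ (a * (k + 1 + k)) * (t + 2) ^ b := Nat.add_le_add (hvt 0) hcard
      _ ≤ (t + 2) * (2 ^ (a * (k + 1 + k)) * (t + 2) ^ b) := by nlinarith
      _ ≤ (t + 2) * (2 ^ ((2 * a + 1) * (k + 1)) * (t + 2) ^ b) := by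
          apply Nat.mul_le_mul_left
          apply Nat.mul_le_mul_right
          apply Nat.pow_le_pow_right (by norm_num)
          nlinarith
      _ = 2 ^ ((2 * a + 1) * (k + 1)) * (t + 2) ^ (b + 1) := by ring

end Shallow

section PartialFraction

open MvPolynomial
open scoped Pointwise

/-! ### LEAD c8: the partial-fraction composition (8a + 8b + 8d ⇒ 7b) and the converse (crux ⇒ 8d via 8c) -/

/-- Coefficients of the Euler operator: `coeff_a (θ f) = (a₀ + a₁)·coeff_a f`. -/
theorem coeff_euler (f : MvPolynomial (Fin 2) ℂ) (a : Expo) :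
    coeff a (euler f) = ((a 0 + a 1 : ℕ) : ℂ) * coeff a f := by
  have key : ∀ i : Fin 2, coeff a (X i * pderiv i f) = ((a i : ℕ) : ℂ) * coeff a f := by
    intro i
    rw [coeff_X_mul']
    by_cases h : i ∈ a.support
    · rw [if_pos h, coeff_pderiv]
      have hi : a i ≠ 0 := Finsupp.mem_support_iff.1 h
      rw [Finsupp.sub_add_single_one_cancel hi, Finsupp.tsub_apply, Finsupp.single_eq_same]
      have : 1 ≤ a i := Nat.one_le_iff_ne_zero.2 hi
      push_cast [Nat.cast_sub this]
      ring
    · rw [if_neg h]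
      have hi : a i = 0 := by simpa [Finsupp.mem_support_iff] using h
      rw [hi, Nat.cast_zero, zero_mul]
  unfold euler
  rw [coeff_sum, Fin.sum_univ_two, key 0, key 1]
  push_cast
  ring

/-- The Euler operator does not enlarge supports. -/
theorem support_euler_subset (f : MvPolynomial (Fin 2) ℂ) : (euler f).support ⊆ f.support := by
  intro a ha
  rw [mem_support_iff] at ha ⊢
  rw [coeff_euler] at ha
  intro h0
  exact ha (by rw [h0, mul_zero])

/-- Sparsity of `θ f`. -/
theorem card_support_euler_le (f : MvPolynomial (Fin 2) ℂ) : (euler f).support.card ≤ f.support.card :=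
  Finset.card_le_card (support_euler_subset f)

/-- Sparsity of `−θ f`. -/
theorem card_support_neg_euler_le (f : MvPolynomial (Fin 2) ℂ) : (-euler f).support.card ≤ f.support.card := by
  rw [support_neg]; exact card_support_euler_le f

/-- Constant term of a product of factors with constant term `1`. -/
theorem coeff_zero_prod_eq_one {n : ℕ} (u : Fin n → MvPolynomial (Fin 2) ℂ) (hu : ∀ i, coeff 0 (u i) = 1) :
    coeff 0 (∏ i, u i) = 1 := by
  rw [← constantCoeff_eq, map_prod]
  exact Finset.prod_eq_one fun i _ => by rw [constantCoeff_eq]; exact hu i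

/-- Sparsity of the appended numerators `(θu, −θv)`. -/
theorem card_support_append_euler_le {n t : ℕ} (u v : Fin n → MvPolynomial (Fin 2) ℂ)
    (hut : ∀ i, (u i).support.card ≤ t) (hvt : ∀ i, (v i).support.card ≤ t) :
    ∀ j, (Fin.append (fun k => euler (u k)) (fun k => -euler (v k)) j).support.card ≤ t := by
  intro j
  refine Fin.addCases (fun k => ?_) (fun k => ?_) j
  · rw [Fin.append_left]; exact (card_support_euler_le _).trans (hut k)
  · rw [Fin.append_right]; exact (card_support_neg_euler_le _).trans (hvt k)

/-- COUNT for the no-sharing one-product rung: the south-west vertices of `∏u − 1` are nonzero letters, `V ≤ Σ_i |supp u_i| ≤ nt`. -/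
theorem sw_le_letters_of_noSharing (hNS : Stmt.stub_engineNoSharing) {n t : ℕ} (u : Fin n → MvPolynomial (Fin 2) ℂ)
    (hut : ∀ i, (u i).support.card ≤ t) (hu : ∀ i, coeff 0 (u i) = 1)
    (hdis : ∀ i j, i ≠ j → ∀ a ∈ (u i).support, a ∈ (u j).support → a = 0) :
    (swVertSet (∏ i, u i - 1)).ncard ≤ n * t := by
  classical
  set U : Finset Expo := Finset.univ.biUnion fun i => (u i).support with hU
  have hsub : swVertSet (∏ i, u i - 1) ⊆ (U : Set Expo) := by
    rintro e ⟨w, hw0, hw1, hmin⟩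
    obtain ⟨-, i, hi, -⟩ := hNS n u hu hdis w hw0 hw1 e hmin
    exact Finset.mem_coe.2 (Finset.mem_biUnion.2 ⟨i, Finset.mem_univ i, hi⟩)
  calc (swVertSet (∏ i, u i - 1)).ncard ≤ (U : Set Expo).ncard := Set.ncard_le_ncard hsub (Finset.finite_toSet U)
    _ = U.card := Set.ncard_coe_finset U
    _ ≤ ∑ i, (u i).support.card := Finset.card_biUnion_le
    _ ≤ ∑ _i : Fin n, t := Finset.sum_le_sum fun i _ => hut i
    _ = n * t := by rw [Finset.sum_const, Finset.card_univ, Fintype.card_fin, smul_eq_mul]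

/-- COUNT for the unique-words rung: under UR the south-west vertices are nonzero letters, `V ≤ Σ_i (|supp u_i| + |supp v_i|)`;
with `t`-sparse factors `≤ 2nt` — the first-order count, and in particular crux-shaped. -/
theorem sw_le_letters_of_uniqueWords (hUW : Stmt.stub_engineUniqueWords) {n t : ℕ} (u v : Fin n → MvPolynomial (Fin 2) ℂ)
    (hut : ∀ i, (u i).support.card ≤ t) (hvt : ∀ i, (v i).support.card ≤ t)
    (hu : ∀ i, coeff 0 (u i) = 1) (hv : ∀ i, coeff 0 (v i) = 1) (hUR : Stmt.UniqueWords u v) :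
    (swVertSet (∏ i, u i - ∏ i, v i)).ncard ≤ 2 * n * t := by
  classical
  set U : Finset Expo := Finset.univ.biUnion fun i => (u i).support ∪ (v i).support with hU
  have hsub : swVertSet (∏ i, u i - ∏ i, v i) ⊆ (U : Set Expo) := by
    rintro e ⟨w, hw0, hw1, hmin⟩
    obtain ⟨-, i, hi, -⟩ := hUW n u v hu hv hUR w hw0 hw1 e hmin
    refine Finset.mem_coe.2 (Finset.mem_biUnion.2 ⟨i, Finset.mem_univ i, ?_⟩)
    rcases hi with h | h
    · exact Finset.mem_union_left _ h
    · exact Finset.mem_union_right _ h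
  calc (swVertSet (∏ i, u i - ∏ i, v i)).ncard ≤ (U : Set Expo).ncard := Set.ncard_le_ncard hsub (Finset.finite_toSet U)
    _ = U.card := Set.ncard_coe_finset U
    _ ≤ ∑ i, ((u i).support ∪ (v i).support).card := Finset.card_biUnion_le
    _ ≤ ∑ _i : Fin n, (t + t) := Finset.sum_le_sum fun i _ =>
        (Finset.card_union_le _ _).trans (Nat.add_le_add (hut i) (hvt i))
    _ = 2 * n * t := by rw [Finset.sum_const, Finset.card_univ, Fintype.card_fin, smul_eq_mul]; ring

/-- COUNT for the carry-free two-product rigid radix rung: every south-west vertex is a scaled digit `M^i • d` of one scale, so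
`V ≤ Σ_i (|supp φ_i| + |supp ψ_i|) ≤ 2kt` (the first-order count; the `k`-free refinement `≤ #distinct digits` follows from the domination
`M^j • d < M^i • d` for `j < i` and is recorded in the crux NOTES). -/
theorem sw_le_digits_of_radixPair (hR : Stmt.stub_engineRadixPairCarryFree) {k M t : ℕ} (φ ψ : Fin k → MvPolynomial (Fin 2) ℂ)
    (hM : 2 ≤ M) (hφ1 : ∀ i, coeff 0 (φ i) = 1) (hψ1 : ∀ i, coeff 0 (ψ i) = 1)
    (hφM : ∀ i, ∀ d ∈ (φ i).support, d 0 < M ∧ d 1 < M) (hψM : ∀ i, ∀ d ∈ (ψ i).support, d 0 < M ∧ d 1 < M)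
    (hφt : ∀ i, (φ i).support.card ≤ t) (hψt : ∀ i, (ψ i).support.card ≤ t) :
    (swVertSet ((∏ i : Fin k, MvPolynomial.expand (M ^ (i : ℕ)) (φ i)) -
        ∏ i : Fin k, MvPolynomial.expand (M ^ (i : ℕ)) (ψ i))).ncard ≤ 2 * k * t := by
  classical
  set U : Finset Expo := Finset.univ.biUnion fun i : Fin k =>
    ((φ i).support ∪ (ψ i).support).image fun d => (M ^ (i : ℕ)) • d with hU
  have hsub : swVertSet ((∏ i : Fin k, MvPolynomial.expand (M ^ (i : ℕ)) (φ i)) -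
      ∏ i : Fin k, MvPolynomial.expand (M ^ (i : ℕ)) (ψ i)) ⊆ (U : Set Expo) := by
    rintro e ⟨w, hw0, hw1, hmin⟩
    obtain ⟨i, d, -, hd, -, rfl⟩ := hR k M φ ψ hM hφ1 hψ1 hφM hψM w hw0 hw1 e hmin
    refine Finset.mem_coe.2 (Finset.mem_biUnion.2 ⟨i, Finset.mem_univ i, Finset.mem_image.2 ⟨d, ?_, rfl⟩⟩)
    rcases hd with h | h
    · exact Finset.mem_union_left _ h
    · exact Finset.mem_union_right _ h
  calc (swVertSet ((∏ i : Fin k, MvPolynomial.expand (M ^ (i : ℕ)) (φ i)) -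
          ∏ i : Fin k, MvPolynomial.expand (M ^ (i : ℕ)) (ψ i))).ncard
      ≤ (U : Set Expo).ncard := Set.ncard_le_ncard hsub (Finset.finite_toSet U)
    _ = U.card := Set.ncard_coe_finset U
    _ ≤ ∑ i, (((φ i).support ∪ (ψ i).support).image fun d => (M ^ (i : ℕ)) • d).card := Finset.card_biUnion_le
    _ ≤ ∑ _i : Fin k, (t + t) := Finset.sum_le_sum fun i _ =>
        Finset.card_image_le.trans ((Finset.card_union_le _ _).trans (Nat.add_le_add (hφt i) (hψt i)))
    _ = 2 * k * t := by rw [Finset.sum_const, Finset.card_univ, Fintype.card_fin, smul_eq_mul]; ring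

/-- THE DERIVATION of 7b from the partial-fraction normal form (lead c8): 8a (Euler transfer) + 8b (Leibniz/append) turn the south-west
vertex set of `∏u − ∏v` into that of the partial-fraction numerator of the `2n` pairs `((θu, −θv), (u, v))`, and 8d bounds it; constants
`(2a, b)`.  (The all-dead hypotheses are idle, as in every derivation since c4.) -/
theorem allDeadEngine_of_partialFraction (hT : Stmt.stub_eulerTransfer) (hL : Stmt.stub_eulerLeibnizAppend)
    (hS : Stmt.stub_partialFractionBound) : Stmt.stub_allDeadEngine := by
  obtain ⟨a, b, hab⟩ := hS
  refine ⟨2 * a, b, ?_⟩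
  intro n t u v hut hvt hu hv _ _
  have hP : coeff 0 (∏ i, u i) = 1 := coeff_zero_prod_eq_one u hu
  have hQ : coeff 0 (∏ i, v i) = 1 := coeff_zero_prod_eq_one v hv
  have hEq : swVertSet (∏ i, u i - ∏ i, v i) =
      swVertSet (pfNum (Fin.append (fun k => euler (u k)) (fun k => -euler (v k))) (Fin.append u v)) := by
    ext e
    simp only [swVertSet, Set.mem_setOf_eq]
    rw [← hL n u v]
    constructor
    · rintro ⟨w, hw0, hw1, h⟩
      exact ⟨w, hw0, hw1, (hT _ _ (hP.trans hQ.symm) (by rw [hQ]; exact one_ne_zero) w hw0 hw1 e).1 h⟩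
    · rintro ⟨w, hw0, hw1, h⟩
      exact ⟨w, hw0, hw1, (hT _ _ (hP.trans hQ.symm) (by rw [hQ]; exact one_ne_zero) w hw0 hw1 e).2 h⟩
  rw [hEq]
  calc (swVertSet (pfNum (Fin.append (fun k => euler (u k)) (fun k => -euler (v k))) (Fin.append u v))).ncard
      ≤ 2 ^ (a * (n + n)) * (t + 2) ^ b :=
        hab (n + n) t _ _ (card_support_append_euler_le u v hut hvt) (card_support_append_le u v hut hvt)
    _ = 2 ^ (2 * a * n) * (t + 2) ^ b := by ring_nf

/-- THE CONVERSE (lead c8): the crux implies 8d, with constants `(a + b, b)` — so 8d is NOT a strengthening of the crux.  Block lift 8c with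
`K = N·d + 1`, `d` = the largest total degree in sight; the shifted south-west vertices are strictly exposed, hence extreme, points of the
hull of the support of `∏_j (q_j + x^K y^K p_j) − ∏_j q_j`, whose factors are `2t`-sparse. -/
theorem partialFraction_of_crux (hB : Stmt.stub_blockLift) :
    Summit.ValiantsHypothesis.ValiantsHypothesis.Theses.NewtonUnitEquations.TwoProducts →
      Stmt.stub_partialFractionBound := by
  rintro ⟨a, b, h⟩
  refine ⟨a + b, b, ?_⟩
  intro N t p q hp hq
  -- the block parameters
  set d : ℕ := Finset.univ.sup fun j : Fin N => max (p j).totalDegree (q j).totalDegree with hd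
  set K : ℕ := N * d + 1 with hK
  have hpd : ∀ j, (p j).totalDegree ≤ d := fun j =>
    (le_max_left _ _).trans (Finset.le_sup (f := fun j : Fin N => max (p j).totalDegree (q j).totalDegree)
      (Finset.mem_univ j))
  have hqd : ∀ j, (q j).totalDegree ≤ d := fun j =>
    (le_max_right _ _).trans (Finset.le_sup (f := fun j : Fin N => max (p j).totalDegree (q j).totalDegree)
      (Finset.mem_univ j))
  have hNK : N * d < K := Nat.lt_succ_self _
  -- the two-products instance
  set f : Fin N → MvPolynomial (Fin 2) ℂ := fun j => q j + monomial (Stmt.blockExp K) 1 * p j with hf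
  set g : Fin N → MvPolynomial (Fin 2) ℂ := q with hg
  set D : MvPolynomial (Fin 2) ℂ := ∏ j, f j - ∏ j, g j with hD
  have hft : ∀ j, (f j).support.card ≤ 2 * t := by
    intro j
    calc (f j).support.card ≤ ((q j).support ∪ (monomial (Stmt.blockExp K) (1 : ℂ) * p j).support).card :=
          Finset.card_le_card (support_add)
      _ ≤ (q j).support.card + (monomial (Stmt.blockExp K) (1 : ℂ) * p j).support.card := Finset.card_union_le _ _
      _ ≤ t + t := by
          refine Nat.add_le_add (hq j) ?_
          calc (monomial (Stmt.blockExp K) (1 : ℂ) * p j).support.card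
              ≤ ((monomial (Stmt.blockExp K) (1 : ℂ)).support + (p j).support).card :=
                Finset.card_le_card (support_mul _ _)
            _ ≤ (monomial (Stmt.blockExp K) (1 : ℂ)).support.card * (p j).support.card := Finset.card_add_le
            _ ≤ 1 * t := Nat.mul_le_mul ((Finset.card_le_card support_monomial_subset).trans (by simp)) (hp j)
            _ = t := one_mul t
      _ = 2 * t := by ring
  have hgt : ∀ j, (g j).support.card ≤ 2 * t := fun j => (hq j).trans (by omega)
  have key := h N (2 * t) f g hft hgt
  -- the shift `e ↦ e + (K,K)` injects the south-west vertices of the numerator into those of `D`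
  have hshift : ∀ e ∈ swVertSet (pfNum p q), e + Stmt.blockExp K ∈ swVertSet D := by
    rintro e ⟨w, hw0, hw1, hmin⟩
    exact ⟨w, hw0, hw1, hB N d K p q hpd hqd hNK w hw0 hw1 e hmin⟩
  have hinj : Set.InjOn (fun e : Expo => e + Stmt.blockExp K) (swVertSet (pfNum p q)) :=
    fun e _ e' _ hee => add_right_cancel hee
  have hmaps : Set.MapsTo (fun e : Expo => e + Stmt.blockExp K) (swVertSet (pfNum p q)) (swVertSet D) :=
    fun e he => hshift e he
  -- south-west vertices of `D` are extreme points of the hull of its support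
  have hemb : Function.Injective (fun e : Fin 2 →₀ ℕ => fun i : Fin 2 => ((e i : ℕ) : ℝ)) := by
    intro e e' hee
    ext i
    have := congrFun hee i
    simp only [Nat.cast_inj] at this
    exact this
  have hsub : (fun e : Fin 2 →₀ ℕ => fun i : Fin 2 => ((e i : ℕ) : ℝ)) '' swVertSet D ⊆
      Set.extremePoints ℝ (convexHull ℝ ((fun e : Fin 2 →₀ ℕ => fun i : Fin 2 => ((e i : ℕ) : ℝ)) ''
        (D.support : Set (Fin 2 →₀ ℕ)))) := by
    rintro _ ⟨e, ⟨w, -, -, he, hmin⟩, rfl⟩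
    exact Summit.ValiantsHypothesis.ValiantsHypothesis.Theorems.TwoProducts.Equivalence.mem_extremePoints_of_strictMin
      D w e he hmin
  have hfinE : (Set.extremePoints ℝ (convexHull ℝ ((fun e : Fin 2 →₀ ℕ => fun i : Fin 2 => ((e i : ℕ) : ℝ)) ''
      (D.support : Set (Fin 2 →₀ ℕ))))).Finite :=
    ((Finset.finite_toSet D.support).image _).subset extremePoints_convexHull_subset
  have hfinD : (swVertSet D).Finite := swVertSet_finite D
  -- counting
  rcases Nat.eq_zero_or_pos N with hN | hN
  · subst hN
    have h0 : pfNum p q = 0 := by simp [pfNum]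
    have hempty : swVertSet (pfNum p q) = ∅ := by
      rw [h0]
      ext e
      simp only [swVertSet, IsStrictMin, support_zero, Finset.notMem_empty, false_and, and_false, exists_false,
        Set.mem_setOf_eq, Set.mem_empty_iff_false]
    rw [hempty, Set.ncard_empty]
    positivity
  · have harith : 2 ^ (a * N) * (2 * t + 2) ^ b ≤ 2 ^ ((a + b) * N) * (t + 2) ^ b := by
      calc 2 ^ (a * N) * (2 * t + 2) ^ b ≤ 2 ^ (a * N) * (2 * (t + 2)) ^ b :=
            Nat.mul_le_mul_left _ (Nat.pow_le_pow_left (by omega) b)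
        _ = 2 ^ (a * N + b) * (t + 2) ^ b := by rw [mul_pow, pow_add]; ring
        _ ≤ 2 ^ ((a + b) * N) * (t + 2) ^ b := by
            apply Nat.mul_le_mul_right
            apply Nat.pow_le_pow_right (by norm_num)
            nlinarith
    calc (swVertSet (pfNum p q)).ncard
        = ((fun e : Expo => e + Stmt.blockExp K) '' swVertSet (pfNum p q)).ncard :=
          (hinj.ncard_image).symm
      _ ≤ (swVertSet D).ncard := Set.ncard_le_ncard hmaps.image_subset hfinD
      _ = ((fun e : Fin 2 →₀ ℕ => fun i : Fin 2 => ((e i : ℕ) : ℝ)) '' swVertSet D).ncard :=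
          (Set.ncard_image_of_injective _ hemb).symm
      _ ≤ (Set.extremePoints ℝ (convexHull ℝ ((fun e : Fin 2 →₀ ℕ => fun i : Fin 2 => ((e i : ℕ) : ℝ)) ''
            (D.support : Set (Fin 2 →₀ ℕ))))).ncard := Set.ncard_le_ncard hsub hfinE
      _ ≤ 2 ^ (a * N) * (2 * t + 2) ^ b := key
      _ ≤ 2 ^ ((a + b) * N) * (t + 2) ^ b := harith

end PartialFraction

/-- STUB 7b — THE ALL-DEAD ENGINE (registered by lead c1; DERIVED — since lead c8 from the partial-fraction stubs 8a + 8b + 8d; the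
all-dead hypotheses are idle in this derivation).  If NO monomial of any factor survives in `D = ∏ u − ∏ v`, then the south-west vertices
of `D` number at most `2^(a n)·(t+2)^b`.  Conjecturally (first-order count, Disproof F9): `≤ Σ_i (|supp u_i| − 1) + Σ_i (|supp v_i| − 1)`
(letters WITH multiplicity); the sharper guess "`≤` the number of DISTINCT dead exponents" is FALSE (lead c2, exact, all-dead, `n = 3`,
`t = 5`, evidence `foc-distinct-counterexample.md`). -/
theorem stub_allDeadEngine : ∃ a b : ℕ, ∀ (n t : ℕ) (u v : Fin n → MvPolynomial (Fin 2) ℂ),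
    (∀ i, (u i).support.card ≤ t) → (∀ i, (v i).support.card ≤ t) →
    (∀ i, MvPolynomial.coeff 0 (u i) = 1) → (∀ i, MvPolynomial.coeff 0 (v i) = 1) →
    (∀ i, ∀ e ∈ (u i).support, e ∉ (∏ j, u j - ∏ j, v j).support) →
    (∀ i, ∀ e ∈ (v i).support, e ∉ (∏ j, u j - ∏ j, v j).support) →
    {e : Fin 2 →₀ ℕ | ∃ w : Fin 2 → ℤ, 0 < w 0 ∧ 0 < w 1 ∧ e ∈ (∏ i, u i - ∏ i, v i).support ∧
        ∀ e' ∈ (∏ i, u i - ∏ i, v i).support, e' ≠ e →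
          w 0 * (e 0 : ℤ) + w 1 * (e 1 : ℤ) < w 0 * (e' 0 : ℤ) + w 1 * (e' 1 : ℤ)}.ncard
      ≤ 2 ^ (a * n) * (t + 2) ^ b :=
  allDeadEngine_of_partialFraction holds_stub_eulerTransfer holds_stub_eulerLeibnizAppend holds_stub_partialFractionBound

theorem holds_stub_allDeadEngine : Stmt.stub_allDeadEngine := stub_allDeadEngine

/-- The engine (statement of the former stub 7) now follows from the landed 7a + 5 and the partial-fraction stubs. -/
theorem holds_stub_logSumNewton : Stmt.stub_logSumNewton :=
  logSumNewton_of_reshape holds_stub_powerSumCriterion holds_stub_localisation holds_stub_allDeadEngine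

/-! ## The composition -/

/-- COMPOSITION.  The registered open stub 8d (PARTIAL-FRACTION bound, lead c8) implies the crux BY NAME: 8a + 8b + 8d ⇒ all-dead engine
(`allDeadEngine_of_partialFraction`, constants `(2a, b)`) ⇒ engine (`logSumNewton_of_reshape` with the landed localisation 7a and power-sum
criterion 5) ⇒ local bound ⇒ per-sector bound (landed 2–4, 6) ⇒ extreme points (landed 1) ⇒ `bound_arith`. -/
theorem TwoProducts_of :
    Stmt.stub_partialFractionBound →
      Summit.ValiantsHypothesis.ValiantsHypothesis.Theses.NewtonUnitEquations.TwoProducts := by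
  intro h8d
  have h7 : Stmt.stub_logSumNewton :=
    logSumNewton_of_reshape holds_stub_powerSumCriterion holds_stub_localisation
      (allDeadEngine_of_partialFraction holds_stub_eulerTransfer holds_stub_eulerLeibnizAppend h8d)
  have h1 : Stmt.stub_exposure := holds_stub_exposure
  have h2 : Stmt.stub_sweep := holds_stub_sweep
  have h3 : Stmt.stub_sectorCover := holds_stub_sectorCover
  have h4 : Stmt.stub_coneChart := holds_stub_coneChart
  have h5 : Stmt.stub_powerSumCriterion := holds_stub_powerSumCriterion
  have h6 : Stmt.stub_raySeries := holds_stub_raySeries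
  obtain ⟨a, b, hLog⟩ := h7
  refine ⟨a + 2, b + 8, ?_⟩
  intro m t f g hf hg
  -- local bound with constants (a+1, b) at n = m, then the global combinatorial vertex bound
  have hlocal := local_bound h5 h6 hLog
  have hvert := vert_bound h2 h3 h4 (N := 2 ^ ((a + 1) * m) * (t + 2) ^ b) f g hf hg
    (fun u v hu hv hu1 hv1 => hlocal m t u v hu hv hu1 hv1)
  set F : MvPolynomial (Fin 2) ℂ := ∏ j, f j - ∏ j, g j with hF
  -- extreme points inject into `emb '' vertSet F`
  have hfin : (vertSet F).Finite := by
    refine Set.Finite.subset (Finset.finite_toSet F.support) ?_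
    rintro e ⟨w, he, -⟩
    exact Finset.mem_coe.2 he
  have hcover : Set.extremePoints ℝ (convexHull ℝ ((fun e : Fin 2 →₀ ℕ => fun i : Fin 2 =>
      ((e i : ℕ) : ℝ)) '' (F.support : Set (Fin 2 →₀ ℕ)))) ⊆ emb '' vertSet F := by
    intro p hp
    obtain ⟨e, hep, w, hw⟩ := h1 F.support p hp
    exact ⟨e, ⟨w, hw⟩, hep⟩
  calc (Set.extremePoints ℝ (convexHull ℝ ((fun e : Fin 2 →₀ ℕ => fun i : Fin 2 =>
          ((e i : ℕ) : ℝ)) '' (F.support : Set (Fin 2 →₀ ℕ))))).ncard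
        ≤ (emb '' vertSet F).ncard := Set.ncard_le_ncard hcover (hfin.image _)
    _ ≤ (vertSet F).ncard := Set.ncard_image_le hfin
    _ ≤ (8 * m * t ^ 2 + 4) * (2 ^ ((a + 1) * m) * (t + 2) ^ b + 2) := hvert
    _ ≤ 2 ^ ((a + 2) * m) * (t + 2) ^ (b + 8) := bound_arith a b m t

/-- THE SKELETON: the crux, modulo exactly the ONE registered open stub 8d `stub_partialFractionBound` (8a p136755, 8b p136492, 8c p136489 landed). -/
theorem TwoProducts_proof :
    Summit.ValiantsHypothesis.ValiantsHypothesis.Theses.NewtonUnitEquations.TwoProducts :=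
  TwoProducts_of holds_stub_partialFractionBound

/-! (Documentation) The superseded sufficient conditions still imply the crux: c5's pinned bound 7g via `allDeadEngine_of_pinned` (+ the
landed 7e), c4's `t`-shallow bound 7f via `pinned_of_shallow`, and c3's λ-free record bound 7d via `logSumNewton_of_records` + the landed 7c
(then `logSumNewton_of_reshape` / `local_bound` / `vert_bound` as in `TwoProducts_of`).  They are not restated as theorems concluding the
crux, so that the skeleton audit sees exactly one hypothesis-taking composition (`TwoProducts_of`) and the closed `TwoProducts_proof`;
conversely `partialFraction_of_crux` (+ 8c) and `engine_of_crux` certify that 8d and the engine are crux-EQUIVALENT. -/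

end

end Summit.ValiantsHypothesis.ValiantsHypothesis.Cruxes.TwoProducts.CornerLogLinearization
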